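import Mathlib
import HarnessLib
import Literature.Analysis.FluidPDE.ClassicalSolution
import Literature.Analysis.FluidPDE.Vorticity
import Summits.NavierStokesRegularity.NavierStokesRegularity.Theorems.QuarterLogPincerBeadCensusDefs
import Summits.NavierStokesRegularity.NavierStokesRegularity.Theorems.QuarterLogPincerBeadCensusKernel
import Summits.NavierStokesRegularity.NavierStokesRegularity.Theorems.QuarterLogPincerCubicRungDefs
import Summits.NavierStokesRegularity.NavierStokesRegularity.Theorems.QuarterLogPincerThinCascadeDefs
import Summits.NavierStokesRegularity.NavierStokesRegularity.Theorems.QuarterLogPincerTypeIQuantSubcubicExpStubUniformScaledEnergy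
import Summits.NavierStokesRegularity.NavierStokesRegularity.Theorems.QuarterLogPincerTypeIQuantSubcubicExpFrameTools
import Summits.NavierStokesRegularity.NavierStokesRegularity.Theorems.QuarterLogPincerTypeIQuantSubcubicExpZoomEnergyA
import Summits.NavierStokesRegularity.NavierStokesRegularity.Theorems.QuarterLogPincerTypeIQuantSubcubicExpRescaleTools
import Summits.NavierStokesRegularity.NavierStokesRegularity.Theorems.QuarterLogPincerTypeIQuantSubcubicExpUnitScaleTools
import Summits.NavierStokesRegularity.NavierStokesRegularity.Theorems.QuarterLogPincerHelmholtzCentreDefs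
import Summits.NavierStokesRegularity.NavierStokesRegularity.Theorems.QuarterLogPincerHelmholtzCentreShellKernel
import Summits.NavierStokesRegularity.NavierStokesRegularity.Theorems.QuarterLogPincerFlatChainDefs
import Summits.NavierStokesRegularity.NavierStokesRegularity.Theorems.QuarterLogPincerFlatChainTypeIEpoch
import Summits.NavierStokesRegularity.NavierStokesRegularity.Theorems.QuarterLogPincerFlatChainKernel
import Summits.NavierStokesRegularity.NavierStokesRegularity.Theorems.QuarterLogPincerFlatChainRegularBlockTransfer
import Literature.Analysis.FluidPDE.BarkerPrangeLocalizedSmoothingBounds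
import Literature.Analysis.FluidPDE.BarkerPrangeConcentrationProofs
import Literature.Analysis.FluidPDE.BackwardHeatPointwise
import Literature.Analysis.FluidPDE.AncientWeakL3BackwardLiouvilleAssembly
import Literature.Analysis.FluidPDE.LocalEnergySolutionsOn
import Literature.Analysis.FluidPDE.LocalLerayExistence
import Literature.Analysis.FluidPDE.BoundedMildWeakL3LocalEnergySolution
import Literature.Analysis.FluidPDE.BoundedMildWeakL3RieszPressure
import Literature.Analysis.FluidPDE.KatoLocalLerayPressureProofs
import Literature.Analysis.FluidPDE.VeryWeakToDistributional
import Literature.Analysis.FluidPDE.VeryWeakToDistributionalFour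
import Literature.Analysis.FluidPDE.ClassicalBoundedWeak
import Literature.Analysis.FluidPDE.MildSolution
import Literature.Analysis.SingularIntegrals.HardyLittlewoodSobolev
import Literature.Analysis.FluidPDE.VorticityCalculus
import Literature.Analysis.FluidPDE.BiotSavartWeakLp
import Summits.NavierStokesRegularity.NavierStokesRegularity.Theorems.QuarterLogPincerFlatChainBoundedRegularity

/-!
# LINE `flat_chain` v1.16 (ns-idea-7 g14–g15, D-0145) — SORRY-FREE: every node of the E-chain below the census is a theorem — G2 `BeadCensus.BPChainRate` ANATOMISED in the rate gauge;
# §7–§8 = LINE g14-2 `slice_census` — the census node re-routed to slab-initial time slices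

Crux of record: `stmt-NavierStokesRegularity-24077`
(`Summit.NavierStokesRegularity.NavierStokesRegularity.Theses.QuarterLogPincer.TypeIQuantSubcubicExp`, OPEN).
bears_on: W7 «R0-rate» rung `CubicRung.TypeIQuantCubicExp` (decl of record, Theorems/QuarterLogPincerCubicRungDefs),
through the E-chain edge `BeadCensus → BPChainRate → TypeIQuantCubicExp` (Theorems/QuarterLogPincerBeadCensusKernel).

TARGETS BY NAME (existing decls): the rung `CubicRung.TypeIQuantCubicExp` via the kernel-checked edge
`typeIQuantCubicExp_of_beadCensus_of_bpChainRateFlat : BeadCensus → BPChainRateFlat → TypeIQuantCubicExp`,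
where `BPChainRateFlat` (G2♭, this file) is the flattened form of `BeadCensus.BPChainRate` (G2) —
`bpChainRateFlat_of_bpChainRate : BPChainRate → BPChainRateFlat` — and the composition
`bpChainRateFlat_of : S2 → (S2 → S1) → S3 → S4 → BPChainRateFlat` (sorry-free; sorries ONLY in `stub_*`).

## Why this line
G2 (`stub_bpChainRate`, bead_census line) is the one XL monolithic stub of the E-chain («Barker–Prange §3 chain in the
sup-rate gauge»).  Re-reading BP21 §3 against the tree shows: (i) the seed needs NO frequency-bubble / weak-L³ step in the
rate gauge — the violator `e^{a(n+1)} ≤ |u(t₁,x₀)|√t₁` IS the seed, so `b = 0`; (ii) BP21 Lemma 4 (violator ⇒ backward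
enstrophy concentration at every admissible depth) transfers to the rate gauge with the uniform-local-energy input
supplied by the PROVED E-chain theorem I1 `ThinCascade.stub_uniformScaledEnergy` (scale-uniform `r⁻¹∫_{B_r}|u|² ≤ C(M)`
at every radius `r² ≤ t₁` — exactly what kills the `S_*`-fixed-point circularity of BP's rescaling), plus ONE literature
port, local-in-space short-time smoothing for `L⁶(B₂)` data (Jia–Šverák 2014 Thm 3.1 (m = 6) / BP21 Thm 3); (iii) the
deposit at a GOOD level is Tao's (5.7) → (5.17) → (5.18), all THREE already tree theorems BY NAME
(`vorticity_gaussian_lower_bound_uniform`, `IsClassicalNSSolutionOn.vorticity_annulus_lower_bound`,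
`IsClassicalNSSolutionOn.velocity_cube_mass_of_vorticity_mass`); the summation is `levelShell_disjoint` +
`lintegral_biUnion_finset` (as in `censusAt_of_flarePersistenceAt`).
FINDING (instrument row): the Carleman transfer across a good annulus of radius `R ≤ e^{a}√s·M^{-10μ}` inside the
GoodLevel window `[t₁ − s/32, t₁]` costs a Gaussian factor `exp(−C·Λ²R²/s) ≥ exp(−C e^{2a})`: the deposit is
`c = c(M, μ, a)`, NOT uniform in `a` as G2 (`∃ a₁ c, ∀ a ≥ a₁`) demands; and the annulus ratio `Λ = M^{10μ}` must dominate
the (5.7)-constants, which are functions of `M` — so `μ = μ(M)`.  Both relaxations are harmless for the rung: the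
consumer `typeIQuantCubicExp_of_beadCensus_of_bpChainRate` only ever uses ONE `a := max a₀ a₁` and one `μ` per `M`.
Hence G2♭ `BPChainRateFlat := ∃ M₀, ∀ M ≥ M₀, ∃ μ b a₁, ∀ a ≥ a₁, ∃ c, ChainAt M μ a b c`, with the rung edge RE-PROVED here.

## Why novel vs listed routes / lines
No listed route or line types BP21 Lemma 4 in the sup-rate gauge or identifies I1 as its uloc input; TerminalTrace's
quiet-shell files (`TerminalTraceTypeITraceScarL3QuietShell*`) run the same Tao tools on the extinct-apex class with
zero final data (different target, no level chain); bead_census's `stub_bpChainRate` is monolithic and (by the finding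
above) over-demands uniformity in `a`.  Nearest print: BP21 §3 (weak-L³ gauge, frequency bubbles, `M^{700}`-type
constants); delta = rate gauge, `b = 0`, I1 replaces `L^{3,∞} ⊂ L²_uloc`, deposit constants honest in `a`.

## Obligations (typed Props below; stubs `stub_*`; sizes)
* S2 `LocalSmoothingL6` — local-in-space short-time smoothing for locally-`L⁶` data over the classical frame
  [JiaSverak2014 Thm 3.1 (m = 6), qualitative; BarkerPrange2021 = arXiv:2003.06717 Thm 3 p. 26, quantitative
  `S_* = O(1)M^{-30}N^{-70}`, bound `C_*M⁸N^{19}`].  XL (literature port).  Constants existential — the qualitative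
  version suffices.
* S1 `LocalSmoothingL6 → LevelConcentration` — BP21 Lemma 4 in the rate gauge: violator ⇒ `ConcBlock` at every level
  `k < n` (depths `s_{k+1}/D … 4s_{k+1}/D`), via I1 + interior elliptic estimate `‖∇U‖_{L²(B₂)} ≲ ‖Ω‖_{L²(B₄)} +
  ‖U‖_{L²(B₄)}` + Sobolev `H¹(B₂) ⊂ L⁶` + S2 by contradiction.  M–L.  HARDEST GAUGE-SPECIFIC STEP.
* S3 `TypeIEpoch` — Type-I ⇒ global `C¹`-bounds on `u, ω` at depth `≥ s/D` (`EpochBlock`), by bounded-mild smoothing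
  (BP21 Prop. 19 route: `NSBoundedHigherRegularityBounds_holds` + I1-D at unit scale, tree, PROVED) from the run-up `[t₁ − 8s/D, t₁ − 4s/D]`.  L.
* S4 `GoodLevelTransfer` — GoodLevel annulus + `EpochBlock` + `ConcBlock` ⇒ `c(M,μ,a) ≤ ∫_{levelShell}|u(t₁)|³`, by the
  three tree theorems (5.7)u/(5.17)/(5.18) with `T₇ := (s/D)/Ce²`, `T₅ := s/32`, `R' := 2R`, `Λ' := Λ/4`,
  `y₀` at distance `250R'`, `D ≥ 5.12·10¹⁴` so the block sits in the `ζ`-window, ratio threshold `Λ₁(M,Ce,ρ,η)`.  L.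
Cheapest falsifier: (S1) a Type-I classical flow with a rate-violating point `(t₁,x₀)` but NO enstrophy `≥ η(M)σ^{-1/2}`
in `B(x₀, ρ(M)√σ)` at some admissible depth — refuted in print in the weak-L³ gauge (BP21 Lemma 4); in the rate gauge the
only new input is I1 (PROVED).  (G2 vs G2♭) an `a`-uniform deposit would need UC across distance `R` in time `s/32` at
cost independent of `R²/s` — false for the heat kernel; hence the flat re-typing.
Instrument row that would refute the key lemma S1: `uloc(t₁ − σ, r) · r⁻¹ > C(M)` for some `r² ≤ t₁` under Type-I(M) —
impossible by I1 (`stub_uniformScaledEnergy`, PROVED); so S1 can only fail at the L⁶-smoothing port S2 (published twice).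
No summit is proved by any line: NavierStokesRegularity, the crux ⟨24077⟩, W7 and R0-rate remain OPEN; this file proves
only G2 ⇒ G2♭, (BeadCensus ∧ G2♭) ⇒ R0-rate, (S1 ∧ S2 ∧ S3 ∧ S4′) ⇒ G2♭ and (v1.1) (SliceCensus ∧ β ∧ S1 ∧ S2 ∧ S3 ∧ S4′) ⇒ R0-rate.

## v1.16: B1|P PROVED — `sliceWindowBound_of_slice_holds : LocalEnergySlice → SliceWindowBound` (§12; P at `(x, t₁ − 2s, r := ϑ√s/2, S_BP)` with
`ϑ := √(8/S_BP(Mt))`, datum `L³ ≤ γ` from the light block by the §11 transport, `BarkerPrange2020_thm1_slab_bounds` (i) a.e. on `(S/2,S) × B(0,1/3)`,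
everywhere by `norm_le_of_ae_le_of_continuousOn`, unscaled at `σ = (t − t₁ + 2s)/r² ∈ (S/2, S)`, `y' = r⁻¹(y − x) ∈ B(0,1/3)`; `Cb/r ≤ Cb/√s`).
**THE WORKFILE IS SORRY-FREE** (`lean check --no-snap --json` rc 0 · sorries 0): β|P, hence β `stub_lightSliceRegular : LightSliceRegular`, are
THEOREMS, and the concluding edge `typeIQuantCubicExp_of_sliceCensus_of_stubs : SliceCensus → TypeIQuantCubicExp` has axioms
[propext, Classical.choice, Quot.sound] — LINE g14-2's single open node is `SliceCensus` (R0-EQUIVALENT given β, S1 by `Negative/SliceCensusIsRung.lean`,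
✓p725489 — so with β and S1 now theorems, `SliceCensus ↔ TypeIQuantCubicExp` UNCONDITIONALLY: the slice census IS the rung R0, restated); LINE g14-1's
is `BeadCensus` (R0-strength or harder).  HONEST LABEL: this closes the TRANSFER/REGULARITY infrastructure of the E-chain, not R0: no open node of
positive information content below R0 remains on these two lines — the next ideation must attack R0 ≡ SliceCensus itself or leave the E-chain.
No summit is proved by any line: R0 `CubicRung.TypeIQuantCubicExp`, ⟨24077⟩, W7 and NS regularity are OPEN.

## v1.15: B2 CLOSED BY NAME — `stub_boundedCylinderRegular : BoundedCylinderRegular` is DERIVED (30 lines: shrink the cylinder to radius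
`min 1 (κ/B)·ϱ`) from the tree theorem `FlatChain.boundedRegularity` (`Theorems/QuarterLogPincerFlatChainBoundedRegularity.lean`, pub-ns-dss typer
g39, PROVED, std axioms — the bounded twin of `ColdSmoothing.coldRegularity_of_stubs`, written independently from the g14 β execution plan and
identical in mechanism to §12's B2).  Registered sorries ONE = B1|P `stub_sliceWindowBound_of_slice : LocalEnergySlice → SliceWindowBound`
(P + Barker–Prange 2020 Thm 1 (i) at interior points; §11 is the template).  After B1|P: β|P, β, and the whole E-chain below the census node
are theorems; the open mathematics of LINE g14-2 is exactly `SliceCensus` (R0-equivalent, recorded).  No summit is proved by any line.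

## v1.14 (LINE g15-1 «light_slice», §12): β|P EXECUTED — `stub_lightSliceRegular_of_slice : LocalEnergySlice → LightSliceRegular` is DERIVED
from two registered obligations by the sorry-free kernel `lightSliceRegular_of_windowBound_of_cylinder : SliceWindowBound → BoundedCylinderRegular →
LightSliceRegular`: B1|P `stub_sliceWindowBound_of_slice : LocalEnergySlice → SliceWindowBound` (M−; P + Barker–Prange 2020 Thm 1 (i) on the light
slice = §11's BP step with an interior point) and B2 `stub_boundedCylinderRegular : BoundedCylinderRegular` (M; «bounded cylinders of a Type-I frame are
quantitatively regular up to the vertex» = the E-chain's PROVED `ColdSmoothing.coldRegularity_of_stubs` with COLDNESS REPLACED BY BOUNDEDNESS: the cube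
functional of a bounded field decays like `κ³` under the ratio `κ`, so one Seregin–Šverák pressure-decay step from the Type-I pressure budget CS2 reaches
the ε-regularity threshold CS3 — both CS2/CS3 PROVED in `Theorems/QuarterLogPincerColdSmoothing{PressureGauge,SmallEnergy}.lean`).  The β plan of record
(`NSBoundedHigherRegularityBounds` representative + gauge bookkeeping + a.e.→everywhere) is superseded.  Registered sorries TWO = B1|P, B2 (β|P no longer
a sorry).  No summit is proved by any line.

## v1.13: S4′ CLOSED BY NAME — `Theorems/QuarterLogPincerFlatChainRegularBlockTransfer.lean` (typer g39, ✓p723153: `stub_regularBlockTransfer := regularBlockTransfer_proof`)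
and the KERNEL port `Theorems/QuarterLogPincerFlatChainKernel.lean` (✓p722930, the ten kernel theorems, same FQNs) are IMPORTED; the local S4′ `sorry`
and the ten local kernel copies are DELETED (typer REBASE LIST 13:47:07Z/13:57:42Z).  Registered sorries ONE = β|P `stub_lightSliceRegular_of_slice` (M).
Consequently the BEAD chain is UNCONDITIONAL relative to its census node: `bpChainRateFlat_holds_of_stubs : BPChainRateFlat` (G2♭) and
`typeIQuantCubicExp_of_beadCensus_of_conc hcensus levelConcentration_of_stubs stub_typeIEpoch goodLevelTransfer_of_stub : BeadCensus → TypeIQuantCubicExp`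
are sorry-free (S1 here, S3/S4′ tree); the SLICE chain `typeIQuantCubicExp_of_sliceCensus_of_stubs : SliceCensus → TypeIQuantCubicExp` carries
exactly β|P.

## v1.12: S1 `LevelConcentration` IS A THEOREM — Q4|P PROVED (`levelConcentration_of_slice_holds`, §11), so `levelConcentration_of_stubs : LevelConcentration` is sorry-free
Barker–Prange 2020 Thm 1 (i) (tree `BarkerPrange2020_thm1_slab_bounds`, PROVED) on the rescaled slice `v = sliceField u x₀ t* r`, `r² = (t₁−t*)/S_BP`,
fed by P (local energy frame, PROVED v1.11), Q3 (quiet slice ⇒ small cube, PROVED v1.3), I1 (`ThinCascade.stub_uniformScaledEnergy`, PROVED) and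
Cauchy–Schwarz; `ρ = ρ(M)` large kills the `R`-tail terms of Q3, `η = η(M, ρ)` small kills the vorticity terms, `a₁ = ρ² + 1/S + C√(SD) + 1`;
the a.e. bound of BP (i) is upgraded to the corner point `(S, 0)` by joint continuity of the classical slice field, giving
`‖u(t₁,x₀)‖√t₁ ≤ C√(SD)e^{a(k+1)} < e^{a(n+1)}` against the violator.  `#print axioms levelConcentration_of_slice_holds` =
`[propext, Classical.choice, Quot.sound]`.  Registered sorries TWO = S4′ `stub_regularBlockTransfer` (typer g39 in progress:
`Theorems/QuarterLogPincerFlatChainTransfer{Annulus,Deposit,Gaussian}.lean`) and β|P `stub_lightSliceRegular_of_slice` (M; BP (iii) + higher regularity,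
the SAME plumbing as §11 with the gradient clause).  With S3 (tree) and S1 (here) proved, the flat chain's G2♭ needs exactly S4′ and β.

## v1.11: THE PLUMBING LEMMA P IS A THEOREM — P♭♭ `SlicePressure` PROVED (`slicePressure_holds`), hence P♭ `LocalEnergySliceLES` and P `LocalEnergySlice`
The pressure swap needs no uniqueness argument: the rescaled slice `v` is a KNSS bounded weak solution on `(0,S)`
(`IsClassicalNSSolutionOn.isBoundedWeakNSSolutionOn` — the classical pressure drops out against divergence-free tests), its slices are
weakly divergence free (`VectorCalculus.IsDivFree.isWeaklyDivFree_holds`), `v ∈ L⁴(slab)` (§10a) has a slab Riesz pressure `π ∈ L²`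
solving the weak Poisson equation slice-wise (`exists_rieszPressure_two_slab`), and the tree's `isDistributionalNSSolutionOn_slab_of_veryWeak_four`
(Lemarié-Rieusset 2016 Prop. 6.5) reassembles `(v, π)` as a distributional solution — verbatim the architecture of the tree's
`isDistributionalNSSolutionOn_slab_of_oseenForward` with «Oseen-mild» replaced by «classical».  Registered sorries THREE =
S4′ `stub_regularBlockTransfer` (typer in progress), Q4|P `stub_levelConcentration_of_slice` (M), β|P `stub_lightSliceRegular_of_slice` (M);
`stub_slicePressure`, `stub_localEnergySliceLES`, `stub_localEnergySlice` are now sorry-free aliases, so Q4 and β are served WITH the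
local-energy frame `(E², uloc ≤ M̃(M), Seregin local energy solution on every admissible slice window)` as a proved hypothesis.

## v1.10: S3 CLOSED BY NAME — `Theorems/QuarterLogPincerFlatChainTypeIEpoch.lean` (typer g39, ✓p720976) imported, local `stub_typeIEpoch` sorry deleted
Registered sorries FOUR = S4′ `stub_regularBlockTransfer`, P♭♭ `stub_slicePressure` (M), Q4|P `stub_levelConcentration_of_slice` (M),
β|P `stub_lightSliceRegular_of_slice` (M).  (S3's proved FQN `FlatChain.stub_typeIEpoch` is the one the kernels below consume.)

## v1.9: the typer's Defs port PART 2 (13:25Z) is IMPORTED — all statement objects now live in `Theorems/QuarterLogPincerFlatChainDefs.lean`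
The local copies of `BPChainRateFlat` (+ `bpChainRateFlat_of_bpChainRate`, `typeIQuantCubicExp_of_beadCensus_of_bpChainRateFlat`), `ConcBlock`,
`LocalSmoothingL6`, `LevelConcentration`, `GoodLevelTransfer`, `RegularBlock` (+ `goodLevel_iff_regularBlock`, `RegularBlock.mono`),
`RegularBlockTransfer` (+ `goodLevelTransfer_of_regularBlockTransfer`), `sliceTime`, `LightBlock`, `HeavySlice`, `SliceCensusAt`, `SliceCensus`,
`LightSliceRegular`, `GoodDepositAt` are DELETED (the typer's port is byte-identical; every occurrence below denotes the tree declaration, so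
the registered stubs S3/S4′/β and the kernels type against the tree decls and ports close them BY NAME).  What remains LOCAL: Q3
`QuietSliceSmallCube` + its proof (§9a; port annex `Lines/quiet_seed_port_QuietSliceSmallCube.lean`), the §10 plumbing objects
(`sliceField`, `LocalEnergySlice`, `LocalEnergySliceLES`, `SlicePressure`) with the §10a toolkit, the kernels, and the five registered stubs.
Registered sorries unchanged (FIVE = S3, S4′, P♭♭, Q4|P, β|P).

## v1.8: P reduced to the PRESSURE SWAP — registered residue P♭♭ = `SlicePressure` (size M)
§10a additionally PROVES, for the slice field `v = sliceField u x t* r` of a crux frame on an admissible window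
(`0 ≤ t*`, `t* + S r² ≤ T`, `r > 0`, `S > 0`): `sliceField_eq_rescale_shift` (origin-`0` form), `sliceField_classical`
(`(v, r² • stPull (r²) r t* x p)` is classical on `[0,S]`, `ν = 1`, by `IsClassicalNSSolutionOn.stRescale` + `.mono`),
`sliceField_rate` / `sliceField_bound` (`‖v‖ ≤ M r τ^{-1/2}` on `[0,S] × ℝ³`), `sliceField_continuousOn`, and `sliceField_memLp_four`
(`v ∈ L⁴((0,S) × ℝ³)`: bounded × uniformly `L²` slices, Tonelli on the restricted product measure).  With the tree's
`isSuitableWeakSolutionOn_slab_of_bounded_of_memLp_two` and `isLocalEnergySolutionOn_of_bounded_suitable` this gives the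
kernel-checked `localEnergySliceLES_of_slicePressure : SlicePressure → LocalEnergySliceLES`, where **`SlicePressure`** says only:
«∃ π ∈ L²((0,S) × ℝ³) with `IsDistributionalNSSolutionOn (slab ℝ³ (0,S)) 1 0 v π`» — the pressure swap `q ↦ Π[v]`
(`exists_rieszPressure_two_slab (sliceField_memLp_four …)` is the witness; `q − Π[v] = c(t)` a.e. by
`pressure_ae_eq_rieszPressure_add_const`; `∫ c(t) div φ = 0`).  Registered sorries stay FIVE = S3, S4′, P♭♭ (M), Q4|P (M), β|P (M);
P♭ and P are DERIVED.  No summit is proved by any line.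

## v1.7: two of P's three clauses PROVED; P's registered residual is the local-energy-solution clause alone
`sliceField` is re-typed as the tree's `r • stPull (r²) r t* x u` (pointwise form `sliceField_apply`, `rfl`; P's text unchanged), so
the rescaling tool-kit applies verbatim; §10a PROVES the `E²` clause (`sliceField_memE2`: continuity from classical smoothness +
`ThinCascade.rescale_lintegral_sq`) and the uloc clause (`sliceField_eLpNorm_unitBall_le`: I1 clause A at the auxiliary vertex
`T' = min(t* + r², T)` after `frame_restrict`/`typeI_restrict`, transported by `ThinCascade.lintegral_sq_ball_zoom`; constant
`M̃(M) = C₊(M)^{1/2} + 1`), and `localEnergySlice_of_les : LocalEnergySliceLES → LocalEnergySlice` is kernel-checked.  Registered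
sorries stay FIVE = S3, S4′, P♭ `stub_localEnergySliceLES` (L−), Q4|P (M), β|P (M); `stub_localEnergySlice` is now DERIVED.

## v1.6: import of the typer's Defs port + the shared plumbing lemma P typed (critic N1 on g14-3)
`EpochBlock` and S3 `TypeIEpoch` are now IMPORTED from `Theorems/QuarterLogPincerFlatChainDefs.lean` (typer g39, 12:58Z, verbatim
port; local copies deleted — `stub_typeIEpoch` types against the tree decl, so the typer's S3 proof can close it BY NAME).  §10 types
P = `LocalEnergySlice` («the NS-rescaled crux frame about `(t*,x)` at scale `r` is a Seregin local energy solution on `(0,S)` with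
`E²` datum and uloc bound `M̃(M)`») over the tree classes `IsLocalEnergySolutionOn` / `MemE2`, and re-cuts the two BP2020 ports
through it: registered sorries are now FIVE = S3, S4′, P (L), Q4|P (M), β|P (M); `stub_lightSliceRegular` and
`stub_levelConcentration_of_quietSlice` are derived terms.  Kernels unchanged and still sorry-free.

## v1.5: PORT MAP (docstrings only; defs/kernels byte-identical to v1.3)
S3's tool pointer corrected (the Oseen-mild `knss2009_smoothing_of_local` needs a mild representation the crux frame lacks an
adapter for; the port goes through `NSBoundedHigherRegularityBounds_holds` + `ThinCascade.exists_unitScale_pressure_bound` +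
`ThinCascade.rescale_*`, all PROVED) and S3 re-graded L; the full tool-by-tool map for S3, S4′, β, Q4 (one shared plumbing
lemma P for β and Q4) is in `Lines/flat-chain.md` § PORT MAP.  Registered sorries unchanged (4).

## v1.4: critic notes answered (docstrings only; defs/kernels byte-identical to v1.3)
`SliceCensus` docstring records that its proof obligation is CROSS-TIME (simultaneity across ≤ 2 turnovers; idea-crit-4 N3 on
g14-2, 12:49Z) and carries the toy design row; registered sorries unchanged (4: S3, S4′, β, Q4).

## v1.3: Q3 `QuietSliceSmallCube` PROVED (§9a, `quietSliceSmallCube_holds`, sorry-free)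
from H2♭ `HelmholtzCentre.stub_shellKernelBound` (PROVED), `enorm_biotSavart_le_rieszPotential`, the tree's strong
Hardy–Littlewood–Sobolev inequality `lintegral_rieszPotential_rpow_le` (PROVED) and Cauchy–Schwarz on the ball.  Registered
stubs v1.3 (the ONLY sorries): S3 `stub_typeIEpoch`, S4′ `stub_regularBlockTransfer`, β `stub_lightSliceRegular`, Q4
`stub_levelConcentration_of_quietSlice` — four ports over PROVED tree theorems (KNSS epochs; Tao transfer; BP2020 Thm 1 + I1 twice).

## v1.2 (LINE g14-3 `quiet_seed`, §9): S1 WITHOUT S2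
The XL port S2 (`LocalSmoothingL6`, Jia–Šverák / BP21 Thm 3) is RETIRED from the registered stubs: S1 `LevelConcentration`
follows from Q3 `QuietSliceSmallCube` (harmonic analysis over the PROVED H2♭ `ShellKernelBound` and the tree's weak HLS
bound for `K₃∗`) and Q4 (the PROVED small-data smoothing `BarkerPrange2020_thm1_slab_bounds` with uloc from I1), because the
vorticity-quiet ball may be taken much larger than the smoothing ball, which bounds the harmonic remainder by the uloc
AVERAGE `√C_I/R` instead of the Type-I sup (§9 FINDING; corrects g13's «harmonic-gradient part» dead end).  Registered stubs
v1.2 (the ONLY sorries): S3, S4′, β, Q3, Q3 → S1 — all M/L ports over PROVED tree theorems; open nodes: `BeadCensus` (G1♯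
chain) for LINE g14-1, `SliceCensus` for LINE g14-2.  Kernels re-keyed on `LevelConcentration` (`bpChainRateFlat_of_conc`,
`typeIQuantCubicExp_of_sliceCensus_conc`, `…_of_beadCensus_of_conc`); the v1/v1.1 signatures remain as corollaries.

## v1.1 (LINE g14-2 «slice_census», §7–§8 below): the CENSUS NODE RE-ROUTED to slab-initial time slices
By-product of S4's anatomy: Tao's transfer needs only a BOUNDED-regular annulus (`‖∇ʲu‖ ≤ Cg·s^{-(j+1)/2}` for any
fixed `Cg ≥ 1` — the heat-kernel time `T₅ := s/(C·Cg²)` is free), not a QUIET one (`M^{-3μ}`).  `RegularBlock Cg Λ` is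
`GoodLevel` with `(M^{-3μ}, M^{10μ}) ↦ (Cg, Λ)`, definitionally (`goodLevel_iff_regularBlock`, `Iff.rfl`); S4 is re-cut
as S4′ `RegularBlockTransfer` and S4 is DERIVED (`goodLevelTransfer_of_regularBlockTransfer`).  New typed Props:
`SliceCensus` (OPEN — the re-routed census node: under the violator, the levels whose slab is `γ`-heavy in EVERY
admissible block at the slice time `t₁ − 2s_k` number `≤ C·A³`), β `LightSliceRegular` (a light block at the slice time
⇒ a regular block on the level window `[t₁ − s/32, t₁]`: Barker–Prange 2020 Thm 1 = tree
`BarkerPrange2020_thm1_slab_bounds` (PROVED) over the I1 background (PROVED), `j = 2` by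
`NSBoundedHigherRegularityBounds_holds` (PROVED) with the pressure normalised by I1(c); = BP21 Prop. 19 / Lemma 22
LOCALISED to one block and paid by the block's own slice mass [corpus:paper:arxiv-2003.06717 p.32–33]; size L), and the
sorry-free kernel `typeIQuantCubicExp_of_sliceCensus : SliceCensus → β → S2 → (S2 → S1) → S3 → S4′ → TypeIQuantCubicExp`
(R0-rate BY NAME).  No persistence of anything through the late window is asserted anywhere in §7–§8 (G1♯
`FlarePersistence` is not used); a DSS-type profile saturates the census's shape (`#heavy ~ A³ ~ log(t₁/D)`, BP21 Thm 1 +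
Cor. 1, optimal log rate) without violating it.  Registered stubs of v1.1 (the ONLY sorries): S2, S2 → S1, S3, S4′, β.
-/

set_option linter.dupNamespace false
set_option linter.unusedVariables false

namespace Summit.NavierStokesRegularity.NavierStokesRegularity.Cruxes.TypeIQuantSubcubicExp.FlatChain

noncomputable section

open MeasureTheory Set Metric
open scoped ENNReal NNReal Classical
open Literature.Analysis Literature.Analysis.FluidPDE
open Summit.NavierStokesRegularity.NavierStokesRegularity.Cruxes.TypeIQuantSubcubicExp.BeadCensus
open Summit.NavierStokesRegularity.NavierStokesRegularity.Cruxes.TypeIQuantSubcubicExp.CubicRung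

/-! ## G2♭ — the flattened chain statement and the re-proved rung edge -/

/-! ## The two data blocks exchanged between the stubs -/

/-! **`EpochBlock`** (v1–v1.5 text) is PORTED VERBATIM to `Theorems/QuarterLogPincerFlatChainDefs.lean` (pub-ns-dss typer g39,
12:58Z) in this very namespace and is IMPORTED from there since v1.6 (the local copy is deleted so that both files can be imported
together; every occurrence of `EpochBlock` below now denotes the tree declaration). -/

/-! ## Obligation Props -/

/-! **S3 `TypeIEpoch`** (the `def` is PORTED VERBATIM to `Theorems/QuarterLogPincerFlatChainDefs.lean`, typer g39 12:58Z, and IMPORTED since v1.6; `stub_typeIEpoch : TypeIEpoch` below types against the tree declaration) — epochs of regularity are free under the Type-I rate: for `0 < s ≤ t₁ ≤ T` and `D ≥ 8` the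
block `[t₁ − 4s/D, t₁ − s/D]` carries global bounds `|u| ≤ Ce(s/D)^{-1/2}`, `‖∇u‖, |ω| ≤ Ce(s/D)^{-1}`,
`‖∇ω‖ ≤ Ce(s/D)^{-3/2}` (`Ce = Ce(M)`), by Type-I (`T+τ−t ≥ s/D` there) and bounded-mild smoothing from the run-up
`[t₁ − 8s/D, t₁ − 4s/D] ⊂ [0,T]`.  [KNSS2009; Tao2021 (5.9); BP21 Prop. 19]  Size L (re-graded v1.5).
PORT (v1.5, names verified): restrict (`ThinCascade.frame_restrict`/`typeI_restrict`) → rescale to unit scale about `(x,t)`,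
`λ² = s/D` (`ThinCascade.rescale_classical`/`rescale_rate`; `|w| ≤ M` on the whole rescaled frame since `T+τ−t ≥ λ²`) →
unit-scale pressure `ThinCascade.exists_unitScale_pressure_bound` (PROVED) → `(w, q − ⨍q)` classical on the cylinder
(`isClassicalNSSolutionOnRegion_sub_normaliser`-type step) → `IsClassicalNSSolutionOnRegion.isDistributionalNSSolutionOn` →
`NSBoundedHigherRegularityBounds_holds` with `(R,M,P) = (1, M, B_D(M))` → a.e. representative = `w` by joint smoothness, every `t`
by continuity of `t ↦ fderiv ℝ (w t) y` → unscale; `‖curl v x‖ ≤ ‖curlCLM‖‖fderiv ℝ v x‖` (`norm_curl_le`).  The pointer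
`knss2009_smoothing_of_local` (PROVED) is the Oseen-mild toolchain and needs a mild representation the crux frame has no adapter
for (only `IsTaoSolutionOn` does) — use the route above.  Full map: `Lines/flat-chain.md` § PORT MAP. -/

/-! ## §7 (v1.1, LINE g14-2 «slice_census») — regular blocks, S4′, the slice census, light-slice smoothing -/

/-! ## §9 LINE g14-3 `quiet_seed` — S1 `LevelConcentration` WITHOUT the XL port S2

FINDING (g14-3).  S2 (`LocalSmoothingL6`, the Jia–Šverák / BP21 Thm 3 LARGE-data local smoothing, XL port) was on the
path only to serve S1.  It is not needed: in S1's contrapositive the vorticity-quiet ball `B(x₀, ρ√σ)` may be taken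
MUCH LARGER than the smoothing ball `B(x₀, 2r)`, `r² = (t₁ − t*)/S`, and then the local Helmholtz identity at a point
(tree H2♭ `HelmholtzCentre.ShellKernelBound`, PROVED as `stub_shellKernelBound`, `…HelmholtzCentreShellKernel`) splits
`u(t*)` on `B(x₀, 2r)` into the Biot–Savart field of the vorticity cut off to `B(x, R)` — whose local cube mass is
`≤ C r^{3/2}‖ω‖³_{L²(B(x₀,2R))}` by the tree's weak-type Hardy–Littlewood–Sobolev bound for `K₃∗`
(`meas_lt_norm_biotSavart_le`, `p = 2 ↦ L^{6,∞}`, PROVED) and a layer-cake on the ball — plus a remainder bounded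
POINTWISE by `C(R⁻³∫_{B(x₀,2R)}‖u‖ + R⁻²∫_{B(x₀,2R)}‖ω‖) ≤ C'(√C_I(M)/R + R^{-1/2}‖ω‖_{L²})`: the harmonic remainder is
controlled by the uniformly-local AVERAGE `√C_I/R` (I1, PROVED), not by the Type-I sup `M/√σ`.  Hence
`‖u(t*)‖_{L³(B(x₀,2r))} ≤ γ` once `R = ϱ(M)√σ` is large and `η(M)` is small, and the PROVED small-data theorem
`BarkerPrange2020_thm1_slab_bounds` (uloc hypothesis from I1) bounds `|u(t₁,x₀)| ≤ C(M̃)/r ≤ K(M)/√σ`, contradicting the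
violator.  (g13 recorded «S1 via small-L³ smoothing — dead: harmonic-gradient part `M S^{-1/2} ≫ γ`»; that analysis took
the quiet ball EQUAL to the smoothing ball.  With `R ≫ r` the objection disappears; no Galilean boost is needed.)
So S1 ⟸ Q3 ∧ Q4 below, both over PROVED tree theorems; the registered S2 stubs are RETIRED (the Props stay as the
alternative large-data route). -/

/-- **Q3 `QuietSliceSmallCube`** — pure harmonic analysis at one time slice: for a `C²` divergence-free field `v`
on `ℝ³`, `0 < r`, `2r ≤ R`,
`∫_{B(x₀,2r)}‖v‖³ ≤ C·( r^{3/2}(∫_{B(x₀,2R)}‖curl v‖²)^{3/2} + r³(R⁻³∫_{B(x₀,2R)}‖v‖)³ + r³(R⁻²∫_{B(x₀,2R)}‖curl v‖)³ )`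
with an ABSOLUTE constant `C`.  PROVED below (§9a `quietSliceSmallCube_holds`, v1.3; via STRONG HLS + Cauchy–Schwarz).  Route: at each `x ∈ B(x₀,2r)`, H2♭ `ShellKernelBound` (PROVED) with the cutoff ball
`B(x,R) ⊆ B(x₀,2R)` gives `‖v(x) − K₃∗(cutVorticity v x R)(x)‖ ≤ C_H(R⁻³∫_{B(x₀,2R)}‖v‖ + R⁻²∫_{B(x₀,2R)}‖curl v‖)`
(monotonicity of the nonnegative integrals in the domain); the main term is dominated pointwise by the Riesz potential
`(4π)⁻¹ I₁(‖curl v‖·1_{B(x₀,2R)})(x)` (`enorm_biotSavart_le_rieszPotential`, cutoff `≤ 1`), whose weak-`L⁶` quasi-norm is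
`≤ C‖curl v‖_{L²(B(x₀,2R))}` (tree weak HLS `exists_weakHLS_one_R3` / `meas_lt_norm_biotSavart_le` at `p = 2`, Chebyshev
`eWeakLpPow ω 2 ≤ ‖ω‖₂²`), and `∫_E g³ ≤ 2C³|E|^{1/2}‖f‖₂³` for a weak-`L⁶` function on a set of finite measure (layer
cake, split at `λ³ = C³‖f‖₂³|E|^{-1/2}`); Minkowski in `L³(B(x₀,2r))`.  Why it might fail: not as mathematics (each step is a
tree theorem or a layer-cake); porting cost M (ENNReal bookkeeping).  [Stein 1970 Ch. V §1; Majda–Bertozzi §2.4.1; tree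
`BiotSavartWeakLp`, `…HelmholtzCentreShellKernel`]  Size M. -/
def QuietSliceSmallCube : Prop :=
  ∃ C : ℝ, 0 < C ∧
    ∀ (v : EuclideanSpace ℝ (Fin 3) → EuclideanSpace ℝ (Fin 3)), ContDiff ℝ 2 v →
      VectorCalculus.IsDivFree v →
      ∀ (x₀ : EuclideanSpace ℝ (Fin 3)) (r R : ℝ), 0 < r → 2 * r ≤ R →
        ∫⁻ x in ball x₀ (2 * r), ‖v x‖ₑ ^ (3 : ℝ) ≤
          ENNReal.ofReal (C *
            (r ^ (3 / 2 : ℝ) * (∫ x in ball x₀ (2 * R), ‖curl v x‖ ^ 2) ^ (3 / 2 : ℝ) +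
              r ^ 3 * ((R ^ 3)⁻¹ * ∫ x in ball x₀ (2 * R), ‖v x‖) ^ 3 +
              r ^ 3 * ((R ^ 2)⁻¹ * ∫ x in ball x₀ (2 * R), ‖curl v x‖) ^ 3))

/-! ### §9a (v1.3) **Q3 PROVED**: `quietSliceSmallCube_holds` — H2♭ (PROVED) + the tree's STRONG HLS inequality
`lintegral_rieszPotential_rpow_le` (`α = 1`, `p = 2 ↦ L⁶`, PROVED, `Literature/Analysis/SingularIntegrals/HardyLittlewoodSobolev`)
+ Cauchy–Schwarz on the ball (no layer cake needed).  Constant: `C = 4(a⁶c_S)^{1/2}(8|B₁|)^{1/2} + 128 C_H³|B₁| + 1`,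
`a = (4π)⁻¹`. -/

open Literature.Analysis.SingularIntegrals

/-- `dim ℝ³ = 3` as a real number. -/
theorem finrank_E3_real : (Module.finrank ℝ (EuclideanSpace ℝ (Fin 3)) : ℝ) = 3 := by
  rw [finrank_euclideanSpace_fin]; norm_num

/-- The tree's Hardy–Littlewood–Sobolev inequality (`lintegral_rieszPotential_rpow_le`, PROVED) on `ℝ³` at
`α = 1`, `p = 2`: `∫ (I₁Φ)⁶ ≤ C (∫ Φ²)³`. -/
theorem hls_one_two_six :
    ∃ C : ℝ≥0∞, C < ∞ ∧ ∀ Φ : EuclideanSpace ℝ (Fin 3) → ℝ≥0∞, AEMeasurable Φ volume →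
      ∫⁻ x, rieszPotential volume 1 Φ x ^ (6 : ℝ) ≤ C * (∫⁻ y, Φ y ^ (2 : ℝ)) ^ (3 : ℝ) := by
  obtain ⟨C, hC, H⟩ := lintegral_rieszPotential_rpow_le
    (volume : Measure (EuclideanSpace ℝ (Fin 3))) (α := 1) (p := 2) (by norm_num) (by norm_num)
    (by rw [finrank_E3_real]; norm_num)
  refine ⟨C, hC, fun Φ hΦ => ?_⟩
  have h := H Φ hΦ
  have e1 : (Module.finrank ℝ (EuclideanSpace ℝ (Fin 3)) : ℝ) * 2 /
      ((Module.finrank ℝ (EuclideanSpace ℝ (Fin 3)) : ℝ) - 1 * 2) = 6 := by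
    rw [finrank_E3_real]; norm_num
  have e2 : (Module.finrank ℝ (EuclideanSpace ℝ (Fin 3)) : ℝ) /
      ((Module.finrank ℝ (EuclideanSpace ℝ (Fin 3)) : ℝ) - 1 * 2) = 3 := by
    rw [finrank_E3_real]; norm_num
  rw [e1, e2] at h
  exact h

/-- Cauchy–Schwarz on a set: `∫_s g³ ≤ (∫_s g⁶)^{1/2} · |s|^{1/2}`. -/
theorem setLIntegral_rpow_three_le {g : EuclideanSpace ℝ (Fin 3) → ℝ≥0∞} (hg : Measurable g)
    (s : Set (EuclideanSpace ℝ (Fin 3))) :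
    ∫⁻ x in s, g x ^ (3 : ℝ) ≤ (∫⁻ x in s, g x ^ (6 : ℝ)) ^ (1 / 2 : ℝ) * volume s ^ (1 / 2 : ℝ) := by
  have h := ENNReal.lintegral_mul_le_Lp_mul_Lq (volume.restrict s) Real.HolderConjugate.two_two
    (f := fun x => g x ^ (3 : ℝ)) (g := fun _ => (1 : ℝ≥0∞))
    ((hg.pow_const _).aemeasurable) aemeasurable_const
  have e1 : ∀ x, (g x ^ (3 : ℝ)) ^ (2 : ℝ) = g x ^ (6 : ℝ) := fun x => by
    rw [← ENNReal.rpow_mul]; norm_num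
  simp only [Pi.mul_apply, mul_one, e1, ENNReal.one_rpow, lintegral_const, Measure.restrict_apply_univ,
    one_mul] at h
  exact h

/-- `(A·x³)^{1/2} = A^{1/2} x^{3/2}` for `A, x ≥ 0`. -/
theorem mul_rpow_three_sqrt {A x : ℝ} (hA : 0 ≤ A) (hx : 0 ≤ x) :
    (A * x ^ (3 : ℝ)) ^ (1 / 2 : ℝ) = A ^ (1 / 2 : ℝ) * x ^ (3 / 2 : ℝ) := by
  rw [Real.mul_rpow hA (Real.rpow_nonneg hx _), ← Real.rpow_mul hx]; norm_num

/-- **Q3 `QuietSliceSmallCube` PROVED** (v1.3) from the PROVED H2♭ `HelmholtzCentre.stub_shellKernelBound`, the tree's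
pointwise bound `‖K₃∗ω‖ ≤ (4π)⁻¹ I₁|ω|` (`enorm_biotSavart_le_rieszPotential`), the tree's strong HLS inequality
(`lintegral_rieszPotential_rpow_le`, `p = 2 ↦ L⁶`) and Cauchy–Schwarz on the ball. -/
theorem quietSliceSmallCube_holds : QuietSliceSmallCube := by
  obtain ⟨CH, hCH1, HH⟩ := HelmholtzCentre.stub_shellKernelBound
  obtain ⟨CS, hCS, HS⟩ := hls_one_two_six
  have hCH0 : 0 ≤ CH := by linarith
  obtain ⟨v1, hv1, hV1eq⟩ : ∃ v1 : ℝ, 0 ≤ v1 ∧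
      volume (ball (0 : EuclideanSpace ℝ (Fin 3)) 1) = ENNReal.ofReal v1 :=
    ⟨_, ENNReal.toReal_nonneg, (ENNReal.ofReal_toReal measure_ball_lt_top.ne).symm⟩
  obtain ⟨cS, hcS, hCSeq⟩ : ∃ c : ℝ, 0 ≤ c ∧ CS = ENNReal.ofReal c :=
    ⟨_, ENNReal.toReal_nonneg, (ENNReal.ofReal_toReal hCS.ne).symm⟩
  obtain ⟨a, ha_def⟩ : ∃ a : ℝ, a = (4 * Real.pi)⁻¹ := ⟨_, rfl⟩
  have ha : 0 ≤ a := by rw [ha_def]; positivity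
  obtain ⟨K₁, hK₁⟩ : ∃ K : ℝ, K = 4 * (a ^ (6 : ℝ) * cS) ^ (1 / 2 : ℝ) * (8 * v1) ^ (1 / 2 : ℝ) := ⟨_, rfl⟩
  obtain ⟨K₂, hK₂⟩ : ∃ K : ℝ, K = 128 * CH ^ 3 * v1 := ⟨_, rfl⟩
  have hK₁0 : 0 ≤ K₁ := by rw [hK₁]; positivity
  have hK₂0 : 0 ≤ K₂ := by rw [hK₂]; positivity
  refine ⟨K₁ + K₂ + 1, by positivity, fun v hv hdiv x₀ r R hr hrR => ?_⟩
  have hR : 0 < R := by linarith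
  -- the three real quantities of the statement
  set X : ℝ := ∫ x in ball x₀ (2 * R), ‖curl v x‖ ^ 2 with hX
  set Y : ℝ := (R ^ 3)⁻¹ * ∫ x in ball x₀ (2 * R), ‖v x‖ with hY
  set Z : ℝ := (R ^ 2)⁻¹ * ∫ x in ball x₀ (2 * R), ‖curl v x‖ with hZ
  have hX0 : 0 ≤ X := integral_nonneg fun _ => by positivity
  have hY0 : 0 ≤ Y := mul_nonneg (by positivity) (integral_nonneg fun _ => norm_nonneg _)
  have hZ0 : 0 ≤ Z := mul_nonneg (by positivity) (integral_nonneg fun _ => norm_nonneg _)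
  obtain ⟨H, hH⟩ : ∃ H : ℝ, H = CH * (Y + Z) := ⟨_, rfl⟩
  have hH0 : 0 ≤ H := by rw [hH]; positivity
  -- continuity / integrability on the big ball
  have hvc : Continuous v := hv.continuous
  have hωc : Continuous (curl v) := continuous_curl (hv.of_le (by norm_num))
  have hint_v : IntegrableOn (fun x => ‖v x‖) (ball x₀ (2 * R)) volume :=
    (hvc.norm.continuousOn.integrableOn_compact (isCompact_closedBall x₀ (2 * R))).mono_set
      ball_subset_closedBall
  have hint_ω : IntegrableOn (fun x => ‖curl v x‖) (ball x₀ (2 * R)) volume :=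
    (hωc.norm.continuousOn.integrableOn_compact (isCompact_closedBall x₀ (2 * R))).mono_set
      ball_subset_closedBall
  have hint_ω2 : IntegrableOn (fun x => ‖curl v x‖ ^ 2) (ball x₀ (2 * R)) volume :=
    ((hωc.norm.pow 2).continuousOn.integrableOn_compact (isCompact_closedBall x₀ (2 * R))).mono_set
      ball_subset_closedBall
  -- the size `Φ = |curl v|·1_{B(x₀,2R)}` and the majorant `G = (4π)⁻¹ I₁Φ`
  set Φ : EuclideanSpace ℝ (Fin 3) → ℝ≥0∞ := (ball x₀ (2 * R)).indicator fun z => ‖curl v z‖ₑ with hΦ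
  have hΦm : Measurable Φ := (hωc.measurable.enorm).indicator measurableSet_ball
  set G : EuclideanSpace ℝ (Fin 3) → ℝ≥0∞ := fun y => ENNReal.ofReal a * rieszPotential volume 1 Φ y
    with hG
  have hGm : Measurable G := (measurable_rieszPotential volume 1 hΦm).const_mul _
  -- Step A: pointwise majorant on the small ball
  have hA : ∀ y ∈ ball x₀ (2 * r), ‖v y‖ₑ ≤ G y + ENNReal.ofReal H := by
    intro y hy
    have hsub : ball y R ⊆ ball x₀ (2 * R) := by
      intro z hz
      rw [mem_ball] at hz hy ⊢
      calc dist z x₀ ≤ dist z y + dist y x₀ := dist_triangle _ _ _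
        _ < R + 2 * r := add_lt_add hz hy
        _ ≤ 2 * R := by linarith
    have h1 := HH v hv hdiv y R hR
    have h2 : ∫ x in ball y R, ‖v x‖ ≤ ∫ x in ball x₀ (2 * R), ‖v x‖ :=
      setIntegral_mono_set hint_v (Filter.Eventually.of_forall fun _ => norm_nonneg _)
        (Filter.Eventually.of_forall fun z (hz : z ∈ ball y R) => hsub hz)
    have h3 : ∫ x in ball y R, ‖curl v x‖ ≤ ∫ x in ball x₀ (2 * R), ‖curl v x‖ :=
      setIntegral_mono_set hint_ω (Filter.Eventually.of_forall fun _ => norm_nonneg _)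
        (Filter.Eventually.of_forall fun z (hz : z ∈ ball y R) => hsub hz)
    have h4 : ‖v y - biotSavart (HelmholtzCentre.cutVorticity v y R) y‖ ≤ H := by
      calc ‖v y - biotSavart (HelmholtzCentre.cutVorticity v y R) y‖
          ≤ CH * ((R ^ 3)⁻¹ * (∫ x in ball y R, ‖v x‖) + (R ^ 2)⁻¹ * (∫ x in ball y R, ‖curl v x‖)) := h1
        _ ≤ CH * (Y + Z) := by
          apply mul_le_mul_of_nonneg_left _ hCH0
          exact add_le_add (mul_le_mul_of_nonneg_left h2 (by positivity))
            (mul_le_mul_of_nonneg_left h3 (by positivity))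
        _ = H := hH.symm
    have h5 : ‖biotSavart (HelmholtzCentre.cutVorticity v y R) y‖ₑ ≤ G y := by
      calc ‖biotSavart (HelmholtzCentre.cutVorticity v y R) y‖ₑ
          ≤ ENNReal.ofReal (4 * Real.pi)⁻¹ *
              rieszPotential volume 1 (fun z => ‖HelmholtzCentre.cutVorticity v y R z‖ₑ) y :=
            enorm_biotSavart_le_rieszPotential _ _
        _ ≤ ENNReal.ofReal a * rieszPotential volume 1 Φ y := by
            rw [ha_def]
            refine mul_le_mul' le_rfl (rieszPotential_mono volume 1 (fun z => ?_) y)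
            rw [HelmholtzCentre.cutVorticity_apply, enorm_smul]
            by_cases hz : z ∈ ball x₀ (2 * R)
            · rw [hΦ, indicator_of_mem hz]
              calc ‖ballCutoff y (R / 3) z‖ₑ * ‖curl v z‖ₑ ≤ 1 * ‖curl v z‖ₑ := by
                    refine mul_le_mul' ?_ le_rfl
                    rw [Real.enorm_eq_ofReal_abs, abs_of_nonneg (ballCutoff_nonneg _ _ _)]
                    exact ENNReal.ofReal_le_one.mpr (ballCutoff_le_one _ _ _)
                _ = ‖curl v z‖ₑ := one_mul _
            · have hfar : 3 * (R / 3) ≤ ‖z - y‖ := by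
                rw [mem_ball, dist_eq_norm] at hy
                rw [mem_ball, dist_eq_norm, not_lt] at hz
                have : ‖z - x₀‖ ≤ ‖z - y‖ + ‖y - x₀‖ := norm_sub_le_norm_sub_add_norm_sub _ _ _
                linarith
              rw [ballCutoff_eq_zero (by positivity) hfar]
              simp
    calc ‖v y‖ₑ = ENNReal.ofReal ‖v y‖ := (ofReal_norm _).symm
      _ ≤ ENNReal.ofReal (‖biotSavart (HelmholtzCentre.cutVorticity v y R) y‖ + H) := by
          refine ENNReal.ofReal_le_ofReal ?_
          have := norm_le_insert' (v y) (biotSavart (HelmholtzCentre.cutVorticity v y R) y)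
          linarith
      _ = ‖biotSavart (HelmholtzCentre.cutVorticity v y R) y‖ₑ + ENNReal.ofReal H := by
          rw [ENNReal.ofReal_add (norm_nonneg _) hH0, ofReal_norm]
      _ ≤ G y + ENNReal.ofReal H := add_le_add h5 le_rfl
  -- Step B: integrate the cube of the majorant over the small ball
  have h4 : (2 : ℝ≥0∞) ^ ((3 : ℝ) - 1) = 4 := by
    rw [show (3 : ℝ) - 1 = ((2 : ℕ) : ℝ) by norm_num, ENNReal.rpow_natCast]; norm_num
  have hB : ∫⁻ x in ball x₀ (2 * r), ‖v x‖ₑ ^ (3 : ℝ) ≤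
      (4 * ∫⁻ x in ball x₀ (2 * r), G x ^ (3 : ℝ)) +
        4 * (ENNReal.ofReal H ^ (3 : ℝ) * volume (ball x₀ (2 * r))) := by
    calc ∫⁻ x in ball x₀ (2 * r), ‖v x‖ₑ ^ (3 : ℝ)
        ≤ ∫⁻ x in ball x₀ (2 * r), (4 * G x ^ (3 : ℝ) + 4 * ENNReal.ofReal H ^ (3 : ℝ)) := by
          refine setLIntegral_mono' measurableSet_ball fun x hx => ?_
          calc ‖v x‖ₑ ^ (3 : ℝ) ≤ (G x + ENNReal.ofReal H) ^ (3 : ℝ) :=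
                ENNReal.rpow_le_rpow (hA x hx) (by norm_num)
            _ ≤ 2 ^ ((3 : ℝ) - 1) * (G x ^ (3 : ℝ) + ENNReal.ofReal H ^ (3 : ℝ)) :=
                ENNReal.rpow_add_le_mul_rpow_add_rpow _ _ (by norm_num)
            _ = 4 * G x ^ (3 : ℝ) + 4 * ENNReal.ofReal H ^ (3 : ℝ) := by rw [h4, mul_add]
      _ = (4 * ∫⁻ x in ball x₀ (2 * r), G x ^ (3 : ℝ)) +
            4 * (ENNReal.ofReal H ^ (3 : ℝ) * volume (ball x₀ (2 * r))) := by
          rw [lintegral_add_left ((hGm.pow_const _).const_mul _), lintegral_const_mul' _ _ (by simp),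
            lintegral_const, Measure.restrict_apply_univ, mul_assoc]
  -- Step C: the Biot–Savart term by strong HLS and Cauchy–Schwarz
  have hΦ2 : ∫⁻ y, Φ y ^ (2 : ℝ) = ∫⁻ y in ball x₀ (2 * R), ‖curl v y‖ₑ ^ (2 : ℝ) := by
    rw [← lintegral_indicator measurableSet_ball]
    refine lintegral_congr fun y => ?_
    by_cases hy : y ∈ ball x₀ (2 * R)
    · simp [hΦ, indicator_of_mem hy]
    · simp [hΦ, indicator_of_notMem hy, ENNReal.zero_rpow_of_pos (by norm_num : (0 : ℝ) < 2)]
  have hΦ2' : ∫⁻ y in ball x₀ (2 * R), ‖curl v y‖ₑ ^ (2 : ℝ) = ENNReal.ofReal X := by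
    rw [hX, ofReal_integral_eq_lintegral_ofReal hint_ω2
      (Filter.Eventually.of_forall fun x => (by positivity : (0 : ℝ) ≤ ‖curl v x‖ ^ 2))]
    refine lintegral_congr fun y => ?_
    rw [← ofReal_norm, ENNReal.ofReal_rpow_of_nonneg (norm_nonneg _) (by norm_num), Real.rpow_two]
  have hE' : volume (ball x₀ (2 * r)) = ENNReal.ofReal (8 * v1 * r ^ (3 : ℝ)) := by
    rw [Measure.addHaar_ball_of_pos volume x₀ (by positivity : (0 : ℝ) < 2 * r),
      finrank_euclideanSpace_fin, hV1eq, ← ENNReal.ofReal_mul (by positivity)]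
    congr 1
    rw [show (3 : ℝ) = ((3 : ℕ) : ℝ) by norm_num, Real.rpow_natCast]; ring
  have hE'' : volume (ball x₀ (2 * r)) = ENNReal.ofReal (8 * v1 * r ^ 3) := by
    rw [Measure.addHaar_ball_of_pos volume x₀ (by positivity : (0 : ℝ) < 2 * r),
      finrank_euclideanSpace_fin, hV1eq, ← ENNReal.ofReal_mul (by positivity)]
    congr 1; ring
  have hG6 : ∫⁻ x in ball x₀ (2 * r), G x ^ (6 : ℝ) ≤
      ENNReal.ofReal (a ^ (6 : ℝ) * cS * X ^ (3 : ℝ)) := by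
    have hpt : ∀ x, G x ^ (6 : ℝ) = ENNReal.ofReal a ^ (6 : ℝ) * rieszPotential volume 1 Φ x ^ (6 : ℝ) :=
      fun x => ENNReal.mul_rpow_of_nonneg _ _ (by norm_num)
    calc ∫⁻ x in ball x₀ (2 * r), G x ^ (6 : ℝ) ≤ ∫⁻ x, G x ^ (6 : ℝ) := setLIntegral_le_lintegral _ _
      _ = ENNReal.ofReal a ^ (6 : ℝ) * ∫⁻ x, rieszPotential volume 1 Φ x ^ (6 : ℝ) := by
          rw [← lintegral_const_mul' _ _
            (ENNReal.rpow_ne_top_of_nonneg (by norm_num) ENNReal.ofReal_ne_top)]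
          exact lintegral_congr hpt
      _ ≤ ENNReal.ofReal a ^ (6 : ℝ) * (CS * (∫⁻ y, Φ y ^ (2 : ℝ)) ^ (3 : ℝ)) :=
          mul_le_mul' le_rfl (HS Φ hΦm.aemeasurable)
      _ = ENNReal.ofReal (a ^ (6 : ℝ) * cS * X ^ (3 : ℝ)) := by
          rw [hΦ2, hΦ2', ENNReal.ofReal_rpow_of_nonneg ha (by norm_num),
            ENNReal.ofReal_rpow_of_nonneg hX0 (by norm_num), hCSeq, ← ENNReal.ofReal_mul hcS,
            ← ENNReal.ofReal_mul (by positivity)]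
          congr 1; ring
  have hC : ∫⁻ x in ball x₀ (2 * r), G x ^ (3 : ℝ) ≤
      ENNReal.ofReal ((a ^ (6 : ℝ) * cS) ^ (1 / 2 : ℝ) * X ^ (3 / 2 : ℝ)) *
        ENNReal.ofReal ((8 * v1) ^ (1 / 2 : ℝ) * r ^ (3 / 2 : ℝ)) := by
    calc ∫⁻ x in ball x₀ (2 * r), G x ^ (3 : ℝ)
        ≤ (∫⁻ x in ball x₀ (2 * r), G x ^ (6 : ℝ)) ^ (1 / 2 : ℝ) *
            volume (ball x₀ (2 * r)) ^ (1 / 2 : ℝ) := setLIntegral_rpow_three_le hGm _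
      _ ≤ ENNReal.ofReal (a ^ (6 : ℝ) * cS * X ^ (3 : ℝ)) ^ (1 / 2 : ℝ) *
            ENNReal.ofReal (8 * v1 * r ^ (3 : ℝ)) ^ (1 / 2 : ℝ) :=
          mul_le_mul' (ENNReal.rpow_le_rpow hG6 (by norm_num))
            (ENNReal.rpow_le_rpow (le_of_eq hE') (by norm_num))
      _ = ENNReal.ofReal ((a ^ (6 : ℝ) * cS) ^ (1 / 2 : ℝ) * X ^ (3 / 2 : ℝ)) *
            ENNReal.ofReal ((8 * v1) ^ (1 / 2 : ℝ) * r ^ (3 / 2 : ℝ)) := by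
          rw [ENNReal.ofReal_rpow_of_nonneg (by positivity) (by norm_num),
            ENNReal.ofReal_rpow_of_nonneg (by positivity) (by norm_num),
            mul_rpow_three_sqrt (by positivity) hX0, mul_rpow_three_sqrt (by positivity) hr.le]
  -- Step D: assemble in `ofReal` form
  have hT1 : 4 * ∫⁻ x in ball x₀ (2 * r), G x ^ (3 : ℝ) ≤
      ENNReal.ofReal (K₁ * (r ^ (3 / 2 : ℝ) * X ^ (3 / 2 : ℝ))) := by
    calc 4 * ∫⁻ x in ball x₀ (2 * r), G x ^ (3 : ℝ)
        ≤ 4 * (ENNReal.ofReal ((a ^ (6 : ℝ) * cS) ^ (1 / 2 : ℝ) * X ^ (3 / 2 : ℝ)) *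
            ENNReal.ofReal ((8 * v1) ^ (1 / 2 : ℝ) * r ^ (3 / 2 : ℝ))) := mul_le_mul' le_rfl hC
      _ = ENNReal.ofReal (4 * (((a ^ (6 : ℝ) * cS) ^ (1 / 2 : ℝ) * X ^ (3 / 2 : ℝ)) *
            ((8 * v1) ^ (1 / 2 : ℝ) * r ^ (3 / 2 : ℝ)))) := by
          rw [← ENNReal.ofReal_mul (by positivity), show (4 : ℝ≥0∞) = ENNReal.ofReal 4 by simp,
            ← ENNReal.ofReal_mul (by norm_num)]
      _ = ENNReal.ofReal (K₁ * (r ^ (3 / 2 : ℝ) * X ^ (3 / 2 : ℝ))) := by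
          congr 1; rw [hK₁]; ring
  have hT2 : 4 * (ENNReal.ofReal H ^ (3 : ℝ) * volume (ball x₀ (2 * r))) ≤
      ENNReal.ofReal (K₂ * (r ^ 3 * Y ^ 3 + r ^ 3 * Z ^ 3)) := by
    have h3 : ENNReal.ofReal H ^ (3 : ℝ) = ENNReal.ofReal (H ^ 3) := by
      rw [ENNReal.ofReal_rpow_of_nonneg hH0 (by norm_num), show (3 : ℝ) = ((3 : ℕ) : ℝ) by norm_num,
        Real.rpow_natCast]
    rw [h3, hE'', ← ENNReal.ofReal_mul (by positivity), show (4 : ℝ≥0∞) = ENNReal.ofReal 4 by simp,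
      ← ENNReal.ofReal_mul (by norm_num)]
    refine ENNReal.ofReal_le_ofReal ?_
    have hYZ : (Y + Z) ^ 3 ≤ 4 * (Y ^ 3 + Z ^ 3) := by
      nlinarith [mul_nonneg (add_nonneg hY0 hZ0) (sq_nonneg (Y - Z)), hY0, hZ0]
    calc 4 * (H ^ 3 * (8 * v1 * r ^ 3)) = 32 * CH ^ 3 * v1 * r ^ 3 * (Y + Z) ^ 3 := by rw [hH]; ring
      _ ≤ 32 * CH ^ 3 * v1 * r ^ 3 * (4 * (Y ^ 3 + Z ^ 3)) :=
          mul_le_mul_of_nonneg_left hYZ (by positivity)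
      _ = K₂ * (r ^ 3 * Y ^ 3 + r ^ 3 * Z ^ 3) := by rw [hK₂]; ring
  calc ∫⁻ x in ball x₀ (2 * r), ‖v x‖ₑ ^ (3 : ℝ)
      ≤ (4 * ∫⁻ x in ball x₀ (2 * r), G x ^ (3 : ℝ)) +
          4 * (ENNReal.ofReal H ^ (3 : ℝ) * volume (ball x₀ (2 * r))) := hB
    _ ≤ ENNReal.ofReal (K₁ * (r ^ (3 / 2 : ℝ) * X ^ (3 / 2 : ℝ))) +
          ENNReal.ofReal (K₂ * (r ^ 3 * Y ^ 3 + r ^ 3 * Z ^ 3)) := add_le_add hT1 hT2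
    _ = ENNReal.ofReal (K₁ * (r ^ (3 / 2 : ℝ) * X ^ (3 / 2 : ℝ)) +
          K₂ * (r ^ 3 * Y ^ 3 + r ^ 3 * Z ^ 3)) :=
        (ENNReal.ofReal_add (by positivity) (by positivity)).symm
    _ ≤ ENNReal.ofReal ((K₁ + K₂ + 1) *
          (r ^ (3 / 2 : ℝ) * X ^ (3 / 2 : ℝ) + r ^ 3 * Y ^ 3 + r ^ 3 * Z ^ 3)) := by
        refine ENNReal.ofReal_le_ofReal ?_
        have h1 : 0 ≤ r ^ (3 / 2 : ℝ) * X ^ (3 / 2 : ℝ) := by positivity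
        have h2 : 0 ≤ r ^ 3 * Y ^ 3 + r ^ 3 * Z ^ 3 := by positivity
        nlinarith [mul_nonneg hK₂0 h1, mul_nonneg hK₁0 h2, h1, h2]

/-! **Q4 `QuietSliceSmallCube → LevelConcentration`** (registered stub `stub_levelConcentration_of_quietSlice`, size L —
the SAME plumbing as β).  Recipe, given `M`: `C_I := C(M)` from I1 (`ThinCascade.stub_uniformScaledEnergy`, PROVED; at the
vertex `t₁` via `frame_restrict`/`typeI_restrict`); `M̃ := (2C_I)^{1/2} ⊔ 1`; `γ, S := S(M̃) ≤ 1/4, β := S/18, C := C(M̃, β)`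
from `BarkerPrange2020_thm1_slab_bounds` (PROVED); `ϱ := ϱ(M)` with `C·8·θ³·c₁³C_I^{3/2}ϱ^{-3} ≤ γ³/3` at `θ = 2S^{-1/2}`
(`c₁`: `∫_{B_{2R}}‖u‖ ≤ c₁R^{3/2}(C_I·2R)^{1/2}` by Cauchy–Schwarz and I1(A) at radius `2R`), then `η := η(M)` with
`C(θ^{3/2}η^{3/2} + 8θ³c₂³η^{3/2}ϱ^{-3/2}) ≤ 2γ³/3`; `ρ := 2ϱ`.  For `D ≥ 8` put `a₁(M,D) := 1 + log(C S^{1/2}√D) ⊔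
½log(36/(8S)) ⊔ log(2ϱ)` (so that `r² ≤ t₁`, `(2R)² ≤ t₁` at every level `k ≥ 0`, and `C/r < e^{a}/√(Dσ)`).  Suppose, at a
level `k < n` (`s = s_{k+1}`, `σ = s/D`), some `t* ∈ [t₁ − 4σ, t₁ − σ]` had `∫_{B(x₀,ρ√σ)}‖ω(t*)‖² < ησ^{-1/2}`.  With
`r := ((t₁ − t*)/S)^{1/2} ∈ [√σ·S^{-1/2}, 2√σ·S^{-1/2}]` and `R := ϱ√σ ≥ 2r`: Q3 ⇒ `‖u(t*)‖_{L³(B(x₀,2r))} ≤ γ`; I1(A) at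
radius `r` (all centres, `t* ∈ [t₁ − r², t₁]` since `4σ ≤ r²`) ⇒ the rescaled datum `v₀(y) := r·u(t*, x₀ + ry)` has
`sup_{x₁}‖v₀‖_{L²(B(x₁,1))} ≤ M̃` and `‖v₀‖_{L³(B(0,2))} ≤ γ`; the rescaled classical solution on `[t*, t₁] = [t*, t* + Sr²]`
is a local energy solution with datum in `E²` (frame: `u(t*) ∈ H^m(ℝ³)` for all `m`; tree
`isLocalEnergySolutionOn_of_bounded_suitable`-type plumbing, Type-I gives boundedness on `[t*, t₁]`) ⇒ BP2020 Thm 1: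
`|u| ≤ C/r` a.e. on `(t* + βr², t₁) × B(x₀, r/3)`, hence by continuity `|u(t₁,x₀)| ≤ C/r ≤ C S^{1/2}/√σ = C S^{1/2}√D·e^{a(k+1)}/√t₁
< e^{a(k+2)}/√t₁ ≤ e^{a(n+1)}/√t₁ ≤ |u(t₁,x₀)|` — contradiction.  Hence `ConcBlock ρ η D u t₁ x₀ s_{k+1}` at every `k < n`. -/

/-! ## §10 (v1.6) The shared plumbing lemma P = `LocalEnergySlice` (critic N1 on g14-3, 12:53Z: "type it once as a support
Prop BEFORE either port starts; then ONE hand closes Q4 and β back-to-back")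

β (`LightSliceRegular`) and Q4 (`QuietSliceSmallCube → LevelConcentration`) consume the PROVED small-data local smoothing
`BarkerPrange2020_thm1_slab_bounds`, whose solution class is Seregin's local energy class on `ℝ³ × (0,S)` with datum in `E²`
and a uniformly-local `L²` bound.  P says that the Navier–Stokes rescaling of the crux frame about any admissible `(t*, x)` at
any scale `r` IS such a solution, with the uloc constant a function of the Type-I constant only (from I1 clause A,
`ThinCascade.stub_uniformScaledEnergy`, PROVED).  PORT (all inputs PROVED; `Lines/flat-chain.md` § PORT MAP): time shift
`IsClassicalNSSolutionOn.comp_add_right` + scaling `ThinCascade.rescale_classical` / `rescale_lintegral_sq` / `rescale_rate` +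
`ThinCascade.pressure_normalised_of_classical` (`p = Π[u] + C(t)` a.e.; suitability is insensitive to `C(t)` because `div u = 0`) +
`IsClassicalNSSolutionOn.onRegion` / `IsClassicalNSSolutionOnRegion.isSuitableWeakSolutionOn` + `isLocalEnergySolutionOn_of_bounded_suitable`
(its hypotheses: joint continuity ✓ classical; a bound `K` ✓ Type-I away from `T+τ`, any `K` will do; `u ∈ L⁴` of the slab ⇐ bounded ×
uniformly `L²` slices; `Π[u] ∈ L²` of the slab ⇐ Calderón–Zygmund on `u ⊗ u ∈ L²`) + `memE2_of_memLp` (`p = 2`) + I1(A) at a vertex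
`T' ∈ [max(t*, r²), min(t* + r², T)]` (non-empty by `0 ≤ t*`, `r² ≤ T`, `t* ≤ T`) after `ThinCascade.frame_restrict`/`typeI_restrict`,
transported by `ThinCascade.setLIntegral_ball_comp_add_smul`: `‖v(0)‖²_{L²(B(x₁,1))} = r⁻¹∫_{B(x + r x₁, r)}‖u(t*)‖² ≤ C_I(M)`.
Size L.  Why it might fail: it cannot mathematically (classical, bounded, `L²`-slice solutions are local energy solutions); the
risk is only bookkeeping (the decay clause of `IsLocalEnergySolutionOn` and of `MemE2` needs `u(t*) ∈ L²`, which the frame's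
`m = 0` Sobolev clause supplies). -/

/-- The Navier–Stokes rescaling of `u` about `(t*, x)` at scale `r`: `v(σ, y) = r · u(t* + r²σ, x + r y)` — typed (v1.7) as
the tree's `r • stPull (r²) r t* x u` so that the rescaling tool-kit (`ThinCascade.rescale_*`, `lintegral_sq_ball_zoom`,
`IsClassicalNSSolutionOn.stRescale`) applies verbatim; `sliceField_apply` is the pointwise form (`rfl`). -/
noncomputable def sliceField (u : ℝ → EuclideanSpace ℝ (Fin 3) → EuclideanSpace ℝ (Fin 3)) (x : EuclideanSpace ℝ (Fin 3))
    (tstar r : ℝ) : ℝ → EuclideanSpace ℝ (Fin 3) → EuclideanSpace ℝ (Fin 3) :=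
  r • stPull (r ^ 2) r tstar x u

@[simp] theorem sliceField_apply (u : ℝ → EuclideanSpace ℝ (Fin 3) → EuclideanSpace ℝ (Fin 3))
    (x : EuclideanSpace ℝ (Fin 3)) (tstar r σ : ℝ) (y : EuclideanSpace ℝ (Fin 3)) :
    sliceField u x tstar r σ y = r • u (tstar + r ^ 2 * σ) (x + r • y) := rfl

/-- **P = `LocalEnergySlice`** (support Prop, v1.6; registered stub `stub_localEnergySlice`, size L; β and Q4 are `M` GIVEN P).
For every Type-I constant `M` there is `M̃ = M̃(M) > 0` such that for every crux frame `(u,p)` on `[0,T]` with the rate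
`‖u(t,x)‖ ≤ M(T+τ−t)^{-1/2}`, every centre `x`, base time `t* ≥ 0`, scale `r > 0` with `r² ≤ T` and window length `S ∈ (0,1]` with
`t* + S r² ≤ T`, the rescaled field `v = sliceField u x t* r` on `[0,S]` is, for SOME pressure `π`, a local energy solution
`IsLocalEnergySolutionOn S 1 (v 0) v π` (Seregin 2014 Def. B.1, tree) whose datum lies in `E²` (`MemE2`) with
`‖v 0‖_{L²(B(x₁,1))} ≤ M̃` for all `x₁`.  [Seregin2014 App. B; KangMiuraTsai2021 Def. 3.1; BarkerPrange2020 Def. 16; tree names in §10] -/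
def LocalEnergySlice : Prop :=
  ∀ M : ℝ, ∃ Mt : ℝ, 0 < Mt ∧
    ∀ (T τ : ℝ) (u : ℝ → EuclideanSpace ℝ (Fin 3) → EuclideanSpace ℝ (Fin 3))
      (p : ℝ → EuclideanSpace ℝ (Fin 3) → ℝ),
      (IsClassicalNSSolutionOn (Icc 0 T) 1 0 u p ∧
        ∀ m : ℕ, ∃ C : NNReal, ∀ t ∈ Icc 0 T, eLpNorm (iteratedFDeriv ℝ m (u t)) 2 volume ≤ C) →
      0 < τ →
      (∀ t ∈ Icc 0 T, ∀ x : EuclideanSpace ℝ (Fin 3), ‖u t x‖ ≤ M * (T + τ - t) ^ (-(1 / 2 : ℝ))) →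
      ∀ (x : EuclideanSpace ℝ (Fin 3)) (tstar r S : ℝ), 0 < r → 0 < S → S ≤ 1 → 0 ≤ tstar →
        r ^ 2 ≤ T → tstar + S * r ^ 2 ≤ T →
        ∃ π : ℝ → EuclideanSpace ℝ (Fin 3) → ℝ,
          IsLocalEnergySolutionOn S 1 (sliceField u x tstar r 0) (sliceField u x tstar r) π ∧
          MemE2 (sliceField u x tstar r 0) ∧
          ∀ x₁ : EuclideanSpace ℝ (Fin 3),
            eLpNorm (sliceField u x tstar r 0) 2 (volume.restrict (ball x₁ 1)) ≤ ENNReal.ofReal Mt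

/-- **P♭ = `LocalEnergySliceLES`** (v1.7): the local-energy-solution clause of P ALONE — the REGISTERED residual of P
(`stub_localEnergySliceLES`, size L−); the `E²` clause and the uloc clause of P are PROVED below (`sliceField_memE2`,
`sliceField_eLpNorm_unitBall_le`) and `localEnergySlice_of_les : LocalEnergySliceLES → LocalEnergySlice` is kernel-checked. -/
def LocalEnergySliceLES : Prop :=
  ∀ (M T τ : ℝ) (u : ℝ → EuclideanSpace ℝ (Fin 3) → EuclideanSpace ℝ (Fin 3))
    (p : ℝ → EuclideanSpace ℝ (Fin 3) → ℝ),
    (IsClassicalNSSolutionOn (Icc 0 T) 1 0 u p ∧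
      ∀ m : ℕ, ∃ C : NNReal, ∀ t ∈ Icc 0 T, eLpNorm (iteratedFDeriv ℝ m (u t)) 2 volume ≤ C) →
    0 < τ →
    (∀ t ∈ Icc 0 T, ∀ x : EuclideanSpace ℝ (Fin 3), ‖u t x‖ ≤ M * (T + τ - t) ^ (-(1 / 2 : ℝ))) →
    ∀ (x : EuclideanSpace ℝ (Fin 3)) (tstar r S : ℝ), 0 < r → 0 < S → S ≤ 1 → 0 ≤ tstar →
      r ^ 2 ≤ T → tstar + S * r ^ 2 ≤ T →
      ∃ π : ℝ → EuclideanSpace ℝ (Fin 3) → ℝ,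
        IsLocalEnergySolutionOn S 1 (sliceField u x tstar r 0) (sliceField u x tstar r) π

/-! ### §10a (v1.7) The `E²` and uloc clauses of P — PROVED (I1 clause A transported by `lintegral_sq_ball_zoom`;
square-integrability by `rescale_lintegral_sq`; continuity from classical smoothness) -/

section PClauses

open Summit.NavierStokesRegularity.NavierStokesRegularity.Cruxes.TypeIQuantSubcubicExp.ThinCascade
  (TaoFrame UniformScaledEnergy stub_uniformScaledEnergy)
open Summit.NavierStokesRegularity.NavierStokesRegularity.Theorems.ThinCascade
  (lintegral_sq_ball_zoom rescale_lintegral_sq rescale_rate exists_lintegral_sq_le_of_taoFrame frame_restrict typeI_restrict)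

/-- `∫ ‖f‖ₑ² = (eLpNorm f 2)²`. [folklore] -/
theorem lintegral_enorm_sq_eq_eLpNorm_sq' {α : Type*} [MeasurableSpace α] (μ : Measure α)
    (f : α → EuclideanSpace ℝ (Fin 3)) :
    ∫⁻ x, ‖f x‖ₑ ^ 2 ∂μ = eLpNorm f 2 μ ^ 2 := by
  rw [eLpNorm_eq_lintegral_rpow_enorm_toReal two_ne_zero ENNReal.ofNat_ne_top, ENNReal.toReal_ofNat,
    ← ENNReal.rpow_natCast, ← ENNReal.rpow_mul, show (1 / (2 : ℝ) * ((2 : ℕ) : ℝ)) = 1 by norm_num,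
    ENNReal.rpow_one]
  exact lintegral_congr fun x => by
    rw [show (2 : ℝ) = ((2 : ℕ) : ℝ) by norm_num, ENNReal.rpow_natCast]

/-- **uloc clause of P.**  Under the crux frame with the Type-I rate, the unit-ball energies of the rescaled slice
`sliceField u x t* r 0` are bounded by the I1 constant: `∫_{B(x₁,1)} ‖v(0)‖² ≤ C₊(M)` for every `x₁`. -/
theorem sliceField_lintegral_unitBall_le {M C T τ : ℝ}
    (hC : ∀ (T τ : ℝ) (u : ℝ → EuclideanSpace ℝ (Fin 3) → EuclideanSpace ℝ (Fin 3))
      (p : ℝ → EuclideanSpace ℝ (Fin 3) → ℝ), TaoFrame T u p → 0 < τ →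
      (∀ t ∈ Icc 0 T, ∀ x : EuclideanSpace ℝ (Fin 3), ‖u t x‖ ≤ M * (T + τ - t) ^ (-(1 / 2 : ℝ))) →
      ∀ (x : EuclideanSpace ℝ (Fin 3)) (r : ℝ), 0 < r → r ^ 2 ≤ T →
        (∀ t ∈ Icc (T - r ^ 2) T,
          ∫⁻ y in ball x r, ENNReal.ofReal (‖u t y‖ ^ 2) ≤ ENNReal.ofReal (C * r)) ∧
        (∫⁻ t in Icc (T - r ^ 2) T, ∫⁻ y in ball x r,
          ENNReal.ofReal (‖fderiv ℝ (u t) y‖ ^ 2) ≤ ENNReal.ofReal (C * r)) ∧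
        (∫⁻ t in Icc (T - r ^ 2) T, ∫⁻ y in ball x r,
          ENNReal.ofReal (|p t y - ⨍ z in ball x r, p t z| ^ (3 / 2 : ℝ)) ≤ ENNReal.ofReal (C * r ^ 2)))
    {u : ℝ → EuclideanSpace ℝ (Fin 3) → EuclideanSpace ℝ (Fin 3)} {p : ℝ → EuclideanSpace ℝ (Fin 3) → ℝ}
    (hfr : TaoFrame T u p) (hτ : 0 < τ)
    (hrate : ∀ t ∈ Icc 0 T, ∀ x : EuclideanSpace ℝ (Fin 3), ‖u t x‖ ≤ M * (T + τ - t) ^ (-(1 / 2 : ℝ)))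
    (x : EuclideanSpace ℝ (Fin 3)) {tstar r : ℝ} (hr : 0 < r) (ht0 : 0 ≤ tstar) (htT : tstar ≤ T)
    (hrT : r ^ 2 ≤ T) (x₁ : EuclideanSpace ℝ (Fin 3)) :
    ∫⁻ y in ball x₁ 1, ‖sliceField u x tstar r 0 y‖ₑ ^ 2 ≤ ENNReal.ofReal (max C 0) := by
  have hr2 : 0 < r ^ 2 := by positivity
  -- the auxiliary vertex `T' = min (t* + r²) T`
  set T' : ℝ := min (tstar + r ^ 2) T with hT'
  have hT'T : T' ≤ T := min_le_right _ _
  have htT' : tstar ≤ T' := le_min (by linarith) htT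
  have hrT' : r ^ 2 ≤ T' := le_min (by linarith) hrT
  have hT'0 : 0 < T' := lt_of_lt_of_le hr2 hrT'
  have hwin : tstar ∈ Icc (T' - r ^ 2) T' := ⟨by rw [hT']; have := min_le_left (tstar + r ^ 2) T; linarith, htT'⟩
  have hfr' : TaoFrame T' u p := frame_restrict hfr hT'0 hT'T
  have hrate' := typeI_restrict hrate hT'T
  have hτ' : 0 < T - T' + τ := by linarith
  have hA := (hC T' (T - T' + τ) u p hfr' hτ' hrate' (x + r • x₁) r hr hrT').1 tstar hwin
  -- transport to the rescaled slice
  have hz := lintegral_sq_ball_zoom hr tstar x u 0 x₁ 1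
  rw [mul_one, mul_zero, add_zero] at hz
  have hconv : ∫⁻ y in ball (x + r • x₁) r, ‖u tstar y‖ₑ ^ 2
      = ∫⁻ y in ball (x + r • x₁) r, ENNReal.ofReal (‖u tstar y‖ ^ 2) := by
    refine lintegral_congr fun y => ?_
    rw [ENNReal.ofReal_pow (norm_nonneg _), ofReal_norm]
  have hr0 : ENNReal.ofReal r ≠ 0 := (ENNReal.ofReal_pos.2 hr).ne'
  calc ∫⁻ y in ball x₁ 1, ‖sliceField u x tstar r 0 y‖ₑ ^ 2
      = (ENNReal.ofReal r)⁻¹ * ∫⁻ y in ball (x + r • x₁) r, ‖u tstar y‖ₑ ^ 2 := hz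
    _ ≤ (ENNReal.ofReal r)⁻¹ * ENNReal.ofReal (max C 0 * r) := by
        rw [hconv]
        refine mul_le_mul' le_rfl (hA.trans (ENNReal.ofReal_le_ofReal ?_))
        exact mul_le_mul_of_nonneg_right (le_max_left _ _) hr.le
    _ = ENNReal.ofReal (max C 0) := by
        rw [ENNReal.ofReal_mul (le_max_right _ _), mul_comm (ENNReal.ofReal (max C 0)), ← mul_assoc,
          ENNReal.inv_mul_cancel hr0 ENNReal.ofReal_ne_top, one_mul]

/-- **uloc clause of P in `eLpNorm` form**: `‖v(0)‖_{L²(B(x₁,1))} ≤ (C₊(M))^{1/2}`. -/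
theorem sliceField_eLpNorm_unitBall_le {M C T τ : ℝ}
    (hC : ∀ (T τ : ℝ) (u : ℝ → EuclideanSpace ℝ (Fin 3) → EuclideanSpace ℝ (Fin 3))
      (p : ℝ → EuclideanSpace ℝ (Fin 3) → ℝ), TaoFrame T u p → 0 < τ →
      (∀ t ∈ Icc 0 T, ∀ x : EuclideanSpace ℝ (Fin 3), ‖u t x‖ ≤ M * (T + τ - t) ^ (-(1 / 2 : ℝ))) →
      ∀ (x : EuclideanSpace ℝ (Fin 3)) (r : ℝ), 0 < r → r ^ 2 ≤ T →
        (∀ t ∈ Icc (T - r ^ 2) T,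
          ∫⁻ y in ball x r, ENNReal.ofReal (‖u t y‖ ^ 2) ≤ ENNReal.ofReal (C * r)) ∧
        (∫⁻ t in Icc (T - r ^ 2) T, ∫⁻ y in ball x r,
          ENNReal.ofReal (‖fderiv ℝ (u t) y‖ ^ 2) ≤ ENNReal.ofReal (C * r)) ∧
        (∫⁻ t in Icc (T - r ^ 2) T, ∫⁻ y in ball x r,
          ENNReal.ofReal (|p t y - ⨍ z in ball x r, p t z| ^ (3 / 2 : ℝ)) ≤ ENNReal.ofReal (C * r ^ 2)))
    {u : ℝ → EuclideanSpace ℝ (Fin 3) → EuclideanSpace ℝ (Fin 3)} {p : ℝ → EuclideanSpace ℝ (Fin 3) → ℝ}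
    (hfr : TaoFrame T u p) (hτ : 0 < τ)
    (hrate : ∀ t ∈ Icc 0 T, ∀ x : EuclideanSpace ℝ (Fin 3), ‖u t x‖ ≤ M * (T + τ - t) ^ (-(1 / 2 : ℝ)))
    (x : EuclideanSpace ℝ (Fin 3)) {tstar r : ℝ} (hr : 0 < r) (ht0 : 0 ≤ tstar) (htT : tstar ≤ T)
    (hrT : r ^ 2 ≤ T) (x₁ : EuclideanSpace ℝ (Fin 3)) :
    eLpNorm (sliceField u x tstar r 0) 2 (volume.restrict (ball x₁ 1))
      ≤ ENNReal.ofReal ((max C 0) ^ (1 / 2 : ℝ)) := by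
  have h := sliceField_lintegral_unitBall_le hC hfr hτ hrate x hr ht0 htT hrT x₁
  rw [lintegral_enorm_sq_eq_eLpNorm_sq'] at h
  have h2 : eLpNorm (sliceField u x tstar r 0) 2 (volume.restrict (ball x₁ 1))
      = (eLpNorm (sliceField u x tstar r 0) 2 (volume.restrict (ball x₁ 1)) ^ 2) ^ (1 / 2 : ℝ) := by
    rw [← ENNReal.rpow_natCast, ← ENNReal.rpow_mul]; norm_num
  rw [h2, ← ENNReal.ofReal_rpow_of_nonneg (le_max_right _ _) (by norm_num : (0 : ℝ) ≤ 1 / 2)]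
  exact ENNReal.rpow_le_rpow h (by norm_num)

/-- **`E²` clause of P.**  The rescaled slice `v(0) = sliceField u x t* r 0` of a crux frame lies in `E²`
(it is continuous and square integrable: `∫ ‖v(0)‖² = r⁻¹ ∫ ‖u(t*)‖² < ∞`). -/
theorem sliceField_memE2 {T : ℝ}
    {u : ℝ → EuclideanSpace ℝ (Fin 3) → EuclideanSpace ℝ (Fin 3)} {p : ℝ → EuclideanSpace ℝ (Fin 3) → ℝ}
    (hfr : TaoFrame T u p) (x : EuclideanSpace ℝ (Fin 3)) {tstar r : ℝ} (hr : 0 < r) (ht0 : 0 ≤ tstar)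
    (htT : tstar ≤ T) : MemE2 (sliceField u x tstar r 0) := by
  have hr2 : 0 < r ^ 2 := by positivity
  -- continuity of the slice
  have hts : tstar ∈ Icc 0 T := ⟨ht0, htT⟩
  have hcont : Continuous (u tstar) := (hfr.1.smooth_velocity.contDiff_slice hts).continuous
  have hcontv : Continuous (sliceField u x tstar r 0) := by
    have e : sliceField u x tstar r 0 = fun y => r • u tstar (x + r • y) := by
      funext y; rw [sliceField_apply, mul_zero, add_zero]
    rw [e]
    exact (hcont.comp (continuous_const.add (continuous_id.const_smul r))).const_smul r
  -- square integrability via the tree's `rescale_lintegral_sq` at rescaled time `t*/r²`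
  obtain ⟨E₀, hE₀, hE⟩ := exists_lintegral_sq_le_of_taoFrame hfr
  obtain ⟨E₁, hE₁, hE1⟩ := rescale_lintegral_sq hr x hE₀ hE
  have hs : tstar / r ^ 2 ∈ Icc 0 (T / r ^ 2) :=
    ⟨div_nonneg ht0 hr2.le, div_le_div_of_nonneg_right htT hr2.le⟩
  have e0 : sliceField u x tstar r 0 = (r • stPull (r ^ 2) r 0 x u) (tstar / r ^ 2) := by
    funext y
    have ht : tstar + r ^ 2 * 0 = 0 + r ^ 2 * (tstar / r ^ 2) := by
      rw [mul_zero, add_zero, zero_add, mul_div_cancel₀ _ hr2.ne']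
    rw [sliceField_apply, smul_stPull_apply, ht]
  have hfin : ∫⁻ y, ‖sliceField u x tstar r 0 y‖ₑ ^ 2 < ⊤ := by
    rw [e0]; exact lt_of_le_of_lt (hE1 _ hs) hE₁.lt_top
  have hmem : MemLp (sliceField u x tstar r 0) 2 volume := by
    refine ⟨hcontv.aestronglyMeasurable, ?_⟩
    rw [lintegral_enorm_sq_eq_eLpNorm_sq'] at hfin
    by_contra htop
    rw [not_lt, top_le_iff] at htop
    rw [htop, ENNReal.top_pow two_ne_zero] at hfin
    exact lt_irrefl _ hfin
  exact memE2_of_memLp hmem le_rfl ENNReal.ofNat_ne_top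

/-- The slice field is the origin-`0` rescaling read at the shifted time `t*/r² + σ` — so every origin-`0` tool of the
`ThinCascade` kit (`rescale_classical`, `rescale_rate`, `rescale_lintegral_sq`) applies to it. -/
theorem sliceField_eq_rescale_shift (u : ℝ → EuclideanSpace ℝ (Fin 3) → EuclideanSpace ℝ (Fin 3))
    (x : EuclideanSpace ℝ (Fin 3)) {tstar r : ℝ} (hr : 0 < r) (σ : ℝ) :
    sliceField u x tstar r σ = (r • stPull (r ^ 2) r 0 x u) (tstar / r ^ 2 + σ) := by
  have hr2 : (r ^ 2 : ℝ) ≠ 0 := by positivity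
  funext y
  have ht : tstar + r ^ 2 * σ = 0 + r ^ 2 * (tstar / r ^ 2 + σ) := by
    rw [zero_add, mul_add, mul_div_cancel₀ _ hr2]
  rw [sliceField_apply, smul_stPull_apply, ht]

/-- **The rescaled pair is a classical solution on `[0, S]`** (`ν = 1`, zero force) whenever the window
`[t*, t* + S r²]` lies in `[0, T]`: `(sliceField u x t* r, r² • stPull (r²) r t* x p)`. [folklore] -/
theorem sliceField_classical {T : ℝ}
    {u : ℝ → EuclideanSpace ℝ (Fin 3) → EuclideanSpace ℝ (Fin 3)} {p : ℝ → EuclideanSpace ℝ (Fin 3) → ℝ}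
    (hcl : IsClassicalNSSolutionOn (Icc 0 T) 1 0 u p) (x : EuclideanSpace ℝ (Fin 3)) {tstar r S : ℝ}
    (hr : 0 < r) (hS : 0 < S) (ht0 : 0 ≤ tstar) (hwin : tstar + S * r ^ 2 ≤ T) :
    IsClassicalNSSolutionOn (Icc 0 S) 1 0 (sliceField u x tstar r) (r ^ 2 • stPull (r ^ 2) r tstar x p) := by
  have hr2 : 0 < r ^ 2 := by positivity
  have key := hcl.stRescale (α := r) (β := r ^ 2) (γ := r) hr hr (by ring) tstar x
  have hν : r * (1 : ℝ) / r = 1 := by field_simp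
  rw [hν, smul_stPull_zero] at key
  have hsub : Icc 0 S ⊆ (fun s => tstar + r ^ 2 * s) ⁻¹' Icc 0 T := by
    intro s hs
    simp only [mem_preimage, mem_Icc]
    exact ⟨by nlinarith [hs.1], by nlinarith [hs.2]⟩
  exact key.mono hsub (uniqueDiffOn_Icc hS)

/-- **The Type-I rate of the slice field** (scale covariance): for `t* + r²σ ∈ [0, T]`,
`‖v(σ, y)‖ ≤ M ((T + τ − t*)/r² − σ)^{-1/2}`. [folklore] -/
theorem sliceField_rate {M T τ : ℝ} {u : ℝ → EuclideanSpace ℝ (Fin 3) → EuclideanSpace ℝ (Fin 3)}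
    (hrate : ∀ t ∈ Icc 0 T, ∀ y, ‖u t y‖ ≤ M * (T + τ - t) ^ (-(1 / 2 : ℝ))) (hτ : 0 < τ)
    (x : EuclideanSpace ℝ (Fin 3)) {tstar r : ℝ} (hr : 0 < r) {σ : ℝ} (h0 : 0 ≤ tstar + r ^ 2 * σ)
    (hT : tstar + r ^ 2 * σ ≤ T) (y : EuclideanSpace ℝ (Fin 3)) :
    ‖sliceField u x tstar r σ y‖ ≤ M * ((T + τ - tstar) / r ^ 2 - σ) ^ (-(1 / 2 : ℝ)) := by
  have hr2 : 0 < r ^ 2 := by positivity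
  have hs : tstar / r ^ 2 + σ ∈ Icc 0 (T / r ^ 2) := by
    constructor
    · rw [show tstar / r ^ 2 + σ = (tstar + r ^ 2 * σ) / r ^ 2 by field_simp]
      exact div_nonneg h0 hr2.le
    · rw [show tstar / r ^ 2 + σ = (tstar + r ^ 2 * σ) / r ^ 2 by field_simp]
      exact div_le_div_of_nonneg_right hT hr2.le
  have h := rescale_rate hr hτ x hrate _ hs y
  rw [sliceField_eq_rescale_shift u x hr σ]
  have e : T / r ^ 2 + τ / r ^ 2 - (tstar / r ^ 2 + σ) = (T + τ - tstar) / r ^ 2 - σ := by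
    field_simp
    ring
  rw [e] at h
  exact h

/-- **A uniform bound for the slice field on a window inside `[0,T]`**: `‖v(σ,y)‖ ≤ M r τ^{-1/2}`. [folklore] -/
theorem sliceField_bound {M T τ : ℝ} {u : ℝ → EuclideanSpace ℝ (Fin 3) → EuclideanSpace ℝ (Fin 3)}
    (hrate : ∀ t ∈ Icc 0 T, ∀ y, ‖u t y‖ ≤ M * (T + τ - t) ^ (-(1 / 2 : ℝ))) (hτ : 0 < τ)
    (x : EuclideanSpace ℝ (Fin 3)) {tstar r S : ℝ} (hr : 0 < r) (ht0 : 0 ≤ tstar) (hwin : tstar + S * r ^ 2 ≤ T) :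
    ∀ σ ∈ Icc 0 S, ∀ y, ‖sliceField u x tstar r σ y‖ ≤ M * r * τ ^ (-(1 / 2 : ℝ)) := by
  intro σ hσ y
  have hr2 : 0 < r ^ 2 := by positivity
  have ht : tstar + r ^ 2 * σ ∈ Icc 0 T := ⟨by nlinarith [hσ.1], by nlinarith [hσ.2]⟩
  have h := hrate _ ht (x + r • y)
  have hM : 0 ≤ M := by
    have h1 := hrate _ ht (x + r • y)
    have hpos : 0 < (T + τ - (tstar + r ^ 2 * σ)) ^ (-(1 / 2 : ℝ)) := Real.rpow_pos_of_pos (by linarith [ht.2]) _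
    nlinarith [norm_nonneg (u (tstar + r ^ 2 * σ) (x + r • y))]
  rw [sliceField_apply, norm_smul, Real.norm_of_nonneg hr.le]
  have hτle : (T + τ - (tstar + r ^ 2 * σ)) ^ (-(1 / 2 : ℝ)) ≤ τ ^ (-(1 / 2 : ℝ)) :=
    Real.rpow_le_rpow_of_nonpos hτ (by linarith [ht.2]) (by norm_num)
  calc r * ‖u (tstar + r ^ 2 * σ) (x + r • y)‖ ≤ r * (M * (T + τ - (tstar + r ^ 2 * σ)) ^ (-(1 / 2 : ℝ))) :=
        mul_le_mul_of_nonneg_left h hr.le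
    _ ≤ r * (M * τ ^ (-(1 / 2 : ℝ))) := mul_le_mul_of_nonneg_left (mul_le_mul_of_nonneg_left hτle hM) hr.le
    _ = M * r * τ ^ (-(1 / 2 : ℝ)) := by ring

/-- **Joint continuity of the slice field** on `[0,S] × ℝ³`. [folklore] -/
theorem sliceField_continuousOn {T : ℝ}
    {u : ℝ → EuclideanSpace ℝ (Fin 3) → EuclideanSpace ℝ (Fin 3)} {p : ℝ → EuclideanSpace ℝ (Fin 3) → ℝ}
    (hcl : IsClassicalNSSolutionOn (Icc 0 T) 1 0 u p) (x : EuclideanSpace ℝ (Fin 3)) {tstar r S : ℝ}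
    (hr : 0 < r) (hS : 0 < S) (ht0 : 0 ≤ tstar) (hwin : tstar + S * r ^ 2 ≤ T) :
    ContinuousOn (Function.uncurry (sliceField u x tstar r)) (Icc 0 S ×ˢ univ) :=
  (sliceField_classical hcl x hr hS ht0 hwin).smooth_velocity.continuousOn

/-- **`L⁴` clause**: the slice field is in `L⁴` of the slab `(0,S) × ℝ³` (bounded × uniformly `L²` slices). [folklore] -/
theorem sliceField_memLp_four {M T τ : ℝ}
    {u : ℝ → EuclideanSpace ℝ (Fin 3) → EuclideanSpace ℝ (Fin 3)} {p : ℝ → EuclideanSpace ℝ (Fin 3) → ℝ}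
    (hfr : TaoFrame T u p) (hτ : 0 < τ)
    (hrate : ∀ t ∈ Icc 0 T, ∀ y, ‖u t y‖ ≤ M * (T + τ - t) ^ (-(1 / 2 : ℝ)))
    (x : EuclideanSpace ℝ (Fin 3)) {tstar r S : ℝ} (hr : 0 < r) (hS : 0 < S) (ht0 : 0 ≤ tstar)
    (hwin : tstar + S * r ^ 2 ≤ T) :
    MemLp (Function.uncurry (sliceField u x tstar r)) 4
      (volume.restrict (Ioo 0 S ×ˢ (univ : Set (EuclideanSpace ℝ (Fin 3))))) := by
  have hr2 : 0 < r ^ 2 := by positivity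
  set v := sliceField u x tstar r with hv
  set slab : Set (ℝ × EuclideanSpace ℝ (Fin 3)) := Ioo 0 S ×ˢ univ with hslab
  have hmeas_slab : MeasurableSet slab := measurableSet_Ioo.prod MeasurableSet.univ
  have hcont := sliceField_continuousOn hfr.1 x hr hS ht0 hwin
  have hcont' : ContinuousOn (Function.uncurry v) slab :=
    hcont.mono (prod_mono Ioo_subset_Icc_self Subset.rfl)
  have haesm : AEStronglyMeasurable (Function.uncurry v) (volume.restrict slab) :=
    hcont'.aestronglyMeasurable hmeas_slab
  refine ⟨haesm, ?_⟩
  have hK := sliceField_bound hrate hτ x hr ht0 hwin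
  set K : ℝ := M * r * τ ^ (-(1 / 2 : ℝ)) with hKdef
  have hK0 : 0 ≤ K := le_trans (norm_nonneg _) (hK 0 ⟨le_rfl, hS.le⟩ 0)
  obtain ⟨E₀, hE₀, hE⟩ := exists_lintegral_sq_le_of_taoFrame hfr
  obtain ⟨E₁, hE₁, hE1⟩ := rescale_lintegral_sq hr x hE₀ hE
  have hslice : ∀ σ ∈ Icc 0 S, ∫⁻ y, ‖v σ y‖ₑ ^ 2 ≤ E₁ := by
    intro σ hσ
    have hs : tstar / r ^ 2 + σ ∈ Icc 0 (T / r ^ 2) := by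
      rw [show tstar / r ^ 2 + σ = (tstar + r ^ 2 * σ) / r ^ 2 by field_simp]
      exact ⟨div_nonneg (by nlinarith [hσ.1]) hr2.le, div_le_div_of_nonneg_right (by nlinarith [hσ.2]) hr2.le⟩
    rw [hv, sliceField_eq_rescale_shift u x hr σ]
    exact hE1 _ hs
  have hprod : (volume.restrict slab : Measure (ℝ × EuclideanSpace ℝ (Fin 3)))
      = ((volume : Measure ℝ).restrict (Ioo 0 S)).prod (volume : Measure (EuclideanSpace ℝ (Fin 3))) := by
    rw [hslab, show (volume : Measure (ℝ × EuclideanSpace ℝ (Fin 3)))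
        = (volume : Measure ℝ).prod (volume : Measure (EuclideanSpace ℝ (Fin 3))) from rfl,
      ← Measure.restrict_univ (μ := (volume : Measure (EuclideanSpace ℝ (Fin 3)))),
      Measure.prod_restrict, Measure.restrict_univ]
  have h2 : ∫⁻ z, ‖Function.uncurry v z‖ₑ ^ 2 ∂(volume.restrict slab) ≤ E₁ * volume (Ioo (0 : ℝ) S) := by
    have haem : AEMeasurable (fun z => ‖Function.uncurry v z‖ₑ ^ 2)
        (((volume : Measure ℝ).restrict (Ioo 0 S)).prod (volume : Measure (EuclideanSpace ℝ (Fin 3)))) := by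
      rw [← hprod]; exact haesm.enorm.pow_const 2
    rw [hprod, lintegral_prod _ haem]
    calc ∫⁻ σ, ∫⁻ y, ‖Function.uncurry v (σ, y)‖ₑ ^ 2 ∂volume ∂((volume : Measure ℝ).restrict (Ioo 0 S))
        ≤ ∫⁻ _σ, E₁ ∂((volume : Measure ℝ).restrict (Ioo 0 S)) := by
          refine lintegral_mono_ae ((ae_restrict_iff' measurableSet_Ioo).2 (Filter.Eventually.of_forall ?_))
          intro σ hσ
          simpa only [Function.uncurry_apply_pair] using hslice σ (Ioo_subset_Icc_self hσ)
      _ = E₁ * volume (Ioo (0 : ℝ) S) := by rw [lintegral_const, Measure.restrict_apply_univ]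
  have h4 : ∫⁻ z, ‖Function.uncurry v z‖ₑ ^ (4 : ℝ) ∂(volume.restrict slab)
      ≤ ENNReal.ofReal (K ^ 2) * (E₁ * volume (Ioo (0 : ℝ) S)) := by
    calc ∫⁻ z, ‖Function.uncurry v z‖ₑ ^ (4 : ℝ) ∂(volume.restrict slab)
        ≤ ∫⁻ z, ENNReal.ofReal (K ^ 2) * ‖Function.uncurry v z‖ₑ ^ 2 ∂(volume.restrict slab) := by
          refine lintegral_mono_ae ((ae_restrict_iff' hmeas_slab).2 (Filter.Eventually.of_forall ?_))
          intro z hz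
          have hz1 : z.1 ∈ Icc 0 S := Ioo_subset_Icc_self (mem_prod.1 hz).1
          have hb : ‖Function.uncurry v z‖ₑ ≤ ENNReal.ofReal K := by
            rw [← ofReal_norm]
            exact ENNReal.ofReal_le_ofReal (hK z.1 hz1 z.2)
          have e4 : ‖Function.uncurry v z‖ₑ ^ (4 : ℝ)
              = ‖Function.uncurry v z‖ₑ ^ 2 * ‖Function.uncurry v z‖ₑ ^ 2 := by
            rw [show (4 : ℝ) = ((4 : ℕ) : ℝ) by norm_num, ENNReal.rpow_natCast]; ring
          rw [e4]
          refine mul_le_mul' ?_ le_rfl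
          calc ‖Function.uncurry v z‖ₑ ^ 2 ≤ (ENNReal.ofReal K) ^ 2 := pow_le_pow_left' hb 2
            _ = ENNReal.ofReal (K ^ 2) := by rw [ENNReal.ofReal_pow hK0]
      _ = ENNReal.ofReal (K ^ 2) * ∫⁻ z, ‖Function.uncurry v z‖ₑ ^ 2 ∂(volume.restrict slab) :=
          lintegral_const_mul' _ _ ENNReal.ofReal_ne_top
      _ ≤ ENNReal.ofReal (K ^ 2) * (E₁ * volume (Ioo (0 : ℝ) S)) := mul_le_mul' le_rfl h2
  have htop : ∫⁻ z, ‖Function.uncurry v z‖ₑ ^ (4 : ℝ) ∂(volume.restrict slab) < ⊤ := by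
    refine lt_of_le_of_lt h4 (ENNReal.mul_lt_top ENNReal.ofReal_lt_top (ENNReal.mul_lt_top hE₁.lt_top ?_))
    rw [Real.volume_Ioo]; exact ENNReal.ofReal_lt_top
  rw [eLpNorm_eq_lintegral_rpow_enorm_toReal (by norm_num) (by norm_num : (4 : ℝ≥0∞) ≠ ⊤), ENNReal.toReal_ofNat]
  exact ENNReal.rpow_lt_top_of_nonneg (by norm_num) htop.ne

/-- **P♭♭ = `SlicePressure`**: the rescaled slice solves Navier–Stokes in the sense of distributions on the slab
`(0,S) × ℝ³` with SOME pressure in `L²` of the slab.  (The natural witness is the slab Riesz pressure of `v`,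
`exists_rieszPressure_two_slab (sliceField_memLp_four …)`; what remains is the pressure swap `q ↦ Π[v]`, `q − Π[v] = c(t)`
a.e. by `pressure_ae_eq_rieszPressure_add_const`.) -/
def SlicePressure : Prop :=
  ∀ (M T τ : ℝ) (u : ℝ → EuclideanSpace ℝ (Fin 3) → EuclideanSpace ℝ (Fin 3))
    (p : ℝ → EuclideanSpace ℝ (Fin 3) → ℝ),
    (IsClassicalNSSolutionOn (Icc 0 T) 1 0 u p ∧
      ∀ m : ℕ, ∃ C : NNReal, ∀ t ∈ Icc 0 T, eLpNorm (iteratedFDeriv ℝ m (u t)) 2 volume ≤ C) →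
    0 < τ →
    (∀ t ∈ Icc 0 T, ∀ x : EuclideanSpace ℝ (Fin 3), ‖u t x‖ ≤ M * (T + τ - t) ^ (-(1 / 2 : ℝ))) →
    ∀ (x : EuclideanSpace ℝ (Fin 3)) (tstar r S : ℝ), 0 < r → 0 < S → S ≤ 1 → 0 ≤ tstar →
      r ^ 2 ≤ T → tstar + S * r ^ 2 ≤ T →
      ∃ π : ℝ → EuclideanSpace ℝ (Fin 3) → ℝ,
        MemLp (Function.uncurry π) 2 (volume.restrict (Ioo 0 S ×ˢ (univ : Set (EuclideanSpace ℝ (Fin 3))))) ∧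
        IsDistributionalNSSolutionOn (slab (EuclideanSpace ℝ (Fin 3)) (Ioo 0 S) isOpen_Ioo) 1 0
          (sliceField u x tstar r) π

/-- **P♭ from P♭♭** (kernel-checked): boundedness (`sliceField_bound`), joint continuity (`sliceField_continuousOn`),
`L⁴` of the slab (`sliceField_memLp_four`) + the tree's `isSuitableWeakSolutionOn_slab_of_bounded_of_memLp_two` and
`isLocalEnergySolutionOn_of_bounded_suitable`. -/
theorem localEnergySliceLES_of_slicePressure (h : SlicePressure) : LocalEnergySliceLES := by
  intro M T τ u p hfr hτ hrate x tstar r S hr hS hS1 ht0 hrT hwin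
  obtain ⟨π, hp2, hNS⟩ := h M T τ u p hfr hτ hrate x tstar r S hr hS hS1 ht0 hrT hwin
  have hK := sliceField_bound hrate hτ x hr ht0 hwin
  have hcont := sliceField_continuousOn hfr.1 x hr hS ht0 hwin
  have hu4 := sliceField_memLp_four hfr hτ hrate x hr hS ht0 hwin
  have hsuit := isSuitableWeakSolutionOn_slab_of_bounded_of_memLp_two hS hK hNS hp2
  exact ⟨π, isLocalEnergySolutionOn_of_bounded_suitable hS hcont hK hu4 hp2 hsuit⟩

/-- **P from P♭** (v1.7, kernel-checked): the `E²` and uloc clauses of `LocalEnergySlice` are discharged by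
`sliceField_memE2` / `sliceField_eLpNorm_unitBall_le` with `M̃(M) := C₊(M)^{1/2} + 1`, `C(M)` the I1 constant
(`ThinCascade.stub_uniformScaledEnergy`, PROVED); only the local-energy-solution clause remains registered. -/
theorem localEnergySlice_of_les (hP : LocalEnergySliceLES) : LocalEnergySlice := by
  intro M
  obtain ⟨C, hC⟩ := stub_uniformScaledEnergy M
  refine ⟨(max C 0) ^ (1 / 2 : ℝ) + 1, by positivity, ?_⟩
  intro T τ u p hfr hτ hrate x tstar r S hr hS hS1 ht0 hrT hwin
  obtain ⟨π, hles⟩ := hP M T τ u p hfr hτ hrate x tstar r S hr hS hS1 ht0 hrT hwin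
  have hSr : 0 ≤ S * r ^ 2 := by positivity
  have htT : tstar ≤ T := by linarith
  refine ⟨π, hles, sliceField_memE2 hfr x hr ht0 htT, fun x₁ => ?_⟩
  exact (sliceField_eLpNorm_unitBall_le hC hfr hτ hrate x hr ht0 htT hrT x₁).trans
    (ENNReal.ofReal_le_ofReal (by linarith))

end PClauses

/-! ### §11 (v1.12) **Q4|P PROVED**: `levelConcentration_of_slice_holds : LocalEnergySlice → QuietSliceSmallCube → LevelConcentration`

S1 `LevelConcentration` from P (`LocalEnergySlice`, PROVED v1.11) and Q3 (`QuietSliceSmallCube`, PROVED v1.3) by the PROVED tree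
theorems `BarkerPrange2020_thm1_slab_bounds` (i) (small-`L³` short-time sup bound for local energy solutions, Barker–Prange 2020
Thm 1) and I1 `ThinCascade.stub_uniformScaledEnergy` (scale-uniform `r⁻¹∫_{B_r}|u|² ≤ C(M)`), in the sup-rate gauge and by
contraposition: a quiet slice `∫_{B(x₀,ρ√σ)}|ω(t*)|² < ησ^{-1/2}` at some `t* ∈ [t₁−4σ, t₁−σ]` (`σ = s_{k+1}/D`) makes
`‖u(t*)‖_{L³(B(x₀,2r))} ≤ γ` with `r² = (t₁−t*)/S_BP` (Q3 + Cauchy–Schwarz + I1, `ρ` large then `η` small, both depending on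
`M` only), whence BP (i) on the rescaled slice `v = sliceField u x₀ t* r` bounds `‖v‖ ≤ C` on `(S/2,S) × B(0,1/3)`, hence at the
endpoint `(S,0)` by joint continuity, i.e. `‖u(t₁,x₀)‖ ≤ C/r ≤ C√(SD)·e^{a(k+1)}/√t₁ < e^{a(n+1)}/√t₁` once `e^{a} > C√(SD)` —
contradicting the violator.  Everything used is a kernel-checked theorem; no new obligation. -/

section Q4Proof

open Summit.NavierStokesRegularity.NavierStokesRegularity.Cruxes.TypeIQuantSubcubicExp.ThinCascade
  (TaoFrame UniformScaledEnergy stub_uniformScaledEnergy)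
open Summit.NavierStokesRegularity.NavierStokesRegularity.Theorems.ThinCascade
  (frame_restrict typeI_restrict)
open Filter Topology

/-- I1 at an interior time `t* ∈ [0,T]` and any radius `R'` with `R'² ≤ T` (auxiliary vertex `min (t* + R'²) T`). -/
theorem q4_I1_lintegral_at {M C T τ : ℝ}
    (hC : ∀ (T τ : ℝ) (u : ℝ → EuclideanSpace ℝ (Fin 3) → EuclideanSpace ℝ (Fin 3))
      (p : ℝ → EuclideanSpace ℝ (Fin 3) → ℝ), TaoFrame T u p → 0 < τ →
      (∀ t ∈ Icc 0 T, ∀ x : EuclideanSpace ℝ (Fin 3), ‖u t x‖ ≤ M * (T + τ - t) ^ (-(1 / 2 : ℝ))) →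
      ∀ (x : EuclideanSpace ℝ (Fin 3)) (r : ℝ), 0 < r → r ^ 2 ≤ T →
        (∀ t ∈ Icc (T - r ^ 2) T,
          ∫⁻ y in ball x r, ENNReal.ofReal (‖u t y‖ ^ 2) ≤ ENNReal.ofReal (C * r)) ∧
        (∫⁻ t in Icc (T - r ^ 2) T, ∫⁻ y in ball x r,
          ENNReal.ofReal (‖fderiv ℝ (u t) y‖ ^ 2) ≤ ENNReal.ofReal (C * r)) ∧
        (∫⁻ t in Icc (T - r ^ 2) T, ∫⁻ y in ball x r,
          ENNReal.ofReal (|p t y - ⨍ z in ball x r, p t z| ^ (3 / 2 : ℝ)) ≤ ENNReal.ofReal (C * r ^ 2)))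
    {u : ℝ → EuclideanSpace ℝ (Fin 3) → EuclideanSpace ℝ (Fin 3)} {p : ℝ → EuclideanSpace ℝ (Fin 3) → ℝ}
    (hfr : TaoFrame T u p) (hτ : 0 < τ)
    (hrate : ∀ t ∈ Icc 0 T, ∀ x : EuclideanSpace ℝ (Fin 3), ‖u t x‖ ≤ M * (T + τ - t) ^ (-(1 / 2 : ℝ)))
    (x : EuclideanSpace ℝ (Fin 3)) {tstar R' : ℝ} (hR' : 0 < R') (ht0 : 0 ≤ tstar) (htT : tstar ≤ T)
    (hRT : R' ^ 2 ≤ T) :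
    ∫⁻ y in ball x R', ENNReal.ofReal (‖u tstar y‖ ^ 2) ≤ ENNReal.ofReal (max C 0 * R') := by
  have hR2 : 0 < R' ^ 2 := by positivity
  set T' : ℝ := min (tstar + R' ^ 2) T with hT'
  have hT'T : T' ≤ T := min_le_right _ _
  have htT' : tstar ≤ T' := le_min (by linarith) htT
  have hrT' : R' ^ 2 ≤ T' := le_min (by linarith) hRT
  have hT'0 : 0 < T' := lt_of_lt_of_le hR2 hrT'
  have hwin : tstar ∈ Icc (T' - R' ^ 2) T' :=
    ⟨by rw [hT']; have := min_le_left (tstar + R' ^ 2) T; linarith, htT'⟩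
  have hfr' : TaoFrame T' u p := frame_restrict hfr hT'0 hT'T
  have hrate' := typeI_restrict hrate hT'T
  have hτ' : 0 < T - T' + τ := by linarith
  have hA := (hC T' (T - T' + τ) u p hfr' hτ' hrate' x R' hR' hrT').1 tstar hwin
  exact hA.trans (ENNReal.ofReal_le_ofReal (mul_le_mul_of_nonneg_right (le_max_left _ _) hR'.le))

/-- I1 at an interior time, Bochner form: `∫_{B(x,R')} ‖u(t*)‖² ≤ C₊ R'`. -/
theorem q4_I1_integral_at {M C T τ : ℝ}
    (hC : ∀ (T τ : ℝ) (u : ℝ → EuclideanSpace ℝ (Fin 3) → EuclideanSpace ℝ (Fin 3))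
      (p : ℝ → EuclideanSpace ℝ (Fin 3) → ℝ), TaoFrame T u p → 0 < τ →
      (∀ t ∈ Icc 0 T, ∀ x : EuclideanSpace ℝ (Fin 3), ‖u t x‖ ≤ M * (T + τ - t) ^ (-(1 / 2 : ℝ))) →
      ∀ (x : EuclideanSpace ℝ (Fin 3)) (r : ℝ), 0 < r → r ^ 2 ≤ T →
        (∀ t ∈ Icc (T - r ^ 2) T,
          ∫⁻ y in ball x r, ENNReal.ofReal (‖u t y‖ ^ 2) ≤ ENNReal.ofReal (C * r)) ∧
        (∫⁻ t in Icc (T - r ^ 2) T, ∫⁻ y in ball x r,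
          ENNReal.ofReal (‖fderiv ℝ (u t) y‖ ^ 2) ≤ ENNReal.ofReal (C * r)) ∧
        (∫⁻ t in Icc (T - r ^ 2) T, ∫⁻ y in ball x r,
          ENNReal.ofReal (|p t y - ⨍ z in ball x r, p t z| ^ (3 / 2 : ℝ)) ≤ ENNReal.ofReal (C * r ^ 2)))
    {u : ℝ → EuclideanSpace ℝ (Fin 3) → EuclideanSpace ℝ (Fin 3)} {p : ℝ → EuclideanSpace ℝ (Fin 3) → ℝ}
    (hfr : TaoFrame T u p) (hτ : 0 < τ)
    (hrate : ∀ t ∈ Icc 0 T, ∀ x : EuclideanSpace ℝ (Fin 3), ‖u t x‖ ≤ M * (T + τ - t) ^ (-(1 / 2 : ℝ)))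
    (x : EuclideanSpace ℝ (Fin 3)) {tstar R' : ℝ} (hR' : 0 < R') (ht0 : 0 ≤ tstar) (htT : tstar ≤ T)
    (hRT : R' ^ 2 ≤ T) :
    ∫ y in ball x R', ‖u tstar y‖ ^ 2 ≤ max C 0 * R' := by
  have hcont : Continuous (u tstar) := (hfr.1.contDiff_velocity ⟨ht0, htT⟩).continuous
  have hint : IntegrableOn (fun y => ‖u tstar y‖ ^ 2) (ball x R') volume :=
    ((hcont.norm.pow 2).continuousOn.integrableOn_compact (isCompact_closedBall x R')).mono_set
      ball_subset_closedBall
  have h := q4_I1_lintegral_at hC hfr hτ hrate x hR' ht0 htT hRT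
  rw [← ofReal_integral_eq_lintegral_ofReal hint (ae_of_all _ fun y => sq_nonneg _)] at h
  exact (ENNReal.ofReal_le_ofReal_iff (by positivity)).1 h

/-- Cauchy–Schwarz on a ball for a continuous field: `∫_B ‖w‖ ≤ √(|B| ∫_B ‖w‖²)`. [folklore] -/
theorem q4_integral_norm_le_sqrt {F : Type*} [NormedAddCommGroup F]
    {w : EuclideanSpace ℝ (Fin 3) → F} (hw : Continuous w) (x : EuclideanSpace ℝ (Fin 3)) (R' : ℝ) :
    ∫ y in ball x R', ‖w y‖ ≤ Real.sqrt (volume.real (ball x R') * ∫ y in ball x R', ‖w y‖ ^ 2) :=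
  Carleman.setIntegral_le_sqrt_measure_mul_setIntegral_sq measure_ball_lt_top.ne measurableSet_ball
    (fun y _ => norm_nonneg _) hw.norm.aestronglyMeasurable
    (((hw.norm.pow 2).continuousOn.integrableOn_compact (isCompact_closedBall x R')).mono_set
      ball_subset_closedBall)

/-- Volume of a ball of `ℝ³`: `|B(x,R')| = R'³ |B(0,1)|`. [folklore] -/
theorem q4_volume_real_ball (x : EuclideanSpace ℝ (Fin 3)) {R' : ℝ} (hR' : 0 < R') :
    volume.real (ball x R') = R' ^ 3 * volume.real (ball (0 : EuclideanSpace ℝ (Fin 3)) 1) := by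
  rw [measureReal_def, measureReal_def, Measure.addHaar_ball_of_pos volume x hR', finrank_euclideanSpace_fin,
    ENNReal.toReal_mul, ENNReal.toReal_ofReal (by positivity)]

/-- `∫ ‖f‖³ ≤ B³` (`B ≥ 0`) gives `‖f‖_{L³} ≤ B` (copy of the tree's `eLpNorm_three_le_of_lintegral_cube_le`). [folklore] -/
theorem q4_eLpNorm_three_le_of_lintegral_cube_le {α F : Type*} [MeasurableSpace α] {μ : Measure α}
    [NormedAddCommGroup F] {f : α → F} {B : ℝ} (hB : 0 ≤ B)
    (h : ∫⁻ x, ‖f x‖ₑ ^ 3 ∂μ ≤ ENNReal.ofReal (B ^ 3)) :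
    eLpNorm f 3 μ ≤ ENNReal.ofReal B := by
  rw [eLpNorm_eq_lintegral_rpow_enorm_toReal three_ne_zero ENNReal.ofNat_ne_top, ENNReal.toReal_ofNat]
  have e : ∫⁻ x, ‖f x‖ₑ ^ (3 : ℝ) ∂μ = ∫⁻ x, ‖f x‖ₑ ^ 3 ∂μ :=
    lintegral_congr fun x => by rw [show (3 : ℝ) = ((3 : ℕ) : ℝ) by norm_num, ENNReal.rpow_natCast]
  rw [e]
  calc (∫⁻ x, ‖f x‖ₑ ^ 3 ∂μ) ^ (1 / (3 : ℝ)) ≤ (ENNReal.ofReal (B ^ 3)) ^ (1 / (3 : ℝ)) :=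
        ENNReal.rpow_le_rpow h (by norm_num)
    _ = ENNReal.ofReal ((B ^ 3) ^ (1 / (3 : ℝ))) := ENNReal.ofReal_rpow_of_nonneg (by positivity) (by norm_num)
    _ = ENNReal.ofReal B := by
        rw [← Real.rpow_natCast B 3, ← Real.rpow_mul hB]; norm_num

/-- **Endpoint bound by joint continuity**: a bound on the open box `(S/2,S) × B(0,1/3)` of a field continuous on
`[0,S] × ℝ³` holds at the corner point `(S, 0)`. [folklore] -/
theorem q4_norm_endpoint_le {v : ℝ → EuclideanSpace ℝ (Fin 3) → EuclideanSpace ℝ (Fin 3)} {S C : ℝ} (hS : 0 < S)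
    (hcont : ContinuousOn (Function.uncurry v) (Icc 0 S ×ˢ (univ : Set (EuclideanSpace ℝ (Fin 3)))))
    (hall : ∀ w ∈ Ioo (S / 2) S ×ˢ ball (0 : EuclideanSpace ℝ (Fin 3)) (1 / 3), ‖Function.uncurry v w‖ ≤ C) :
    ‖v S 0‖ ≤ C := by
  set Bx : Set (ℝ × EuclideanSpace ℝ (Fin 3)) := Ioo (S / 2) S ×ˢ ball (0 : EuclideanSpace ℝ (Fin 3)) (1 / 3) with hBx
  have hsub : Bx ⊆ Icc 0 S ×ˢ (univ : Set (EuclideanSpace ℝ (Fin 3))) :=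
    prod_mono (fun t ht => ⟨by linarith [ht.1], ht.2.le⟩) (subset_univ _)
  have hmemA : ((S, (0 : EuclideanSpace ℝ (Fin 3))) : ℝ × EuclideanSpace ℝ (Fin 3)) ∈
      Icc 0 S ×ˢ (univ : Set (EuclideanSpace ℝ (Fin 3))) := ⟨⟨hS.le, le_rfl⟩, mem_univ _⟩
  have hcw : ContinuousWithinAt (Function.uncurry v) Bx (S, 0) := (hcont (S, 0) hmemA).mono hsub
  have hcl : ((S, (0 : EuclideanSpace ℝ (Fin 3))) : ℝ × EuclideanSpace ℝ (Fin 3)) ∈ closure Bx := by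
    rw [hBx, closure_prod_eq, closure_Ioo (by linarith : S / 2 ≠ S),
      closure_ball (0 : EuclideanSpace ℝ (Fin 3)) (by norm_num : (1 / 3 : ℝ) ≠ 0)]
    exact ⟨⟨by linarith, le_rfl⟩, mem_closedBall_self (by norm_num)⟩
  haveI : (𝓝[Bx] ((S, (0 : EuclideanSpace ℝ (Fin 3))) : ℝ × EuclideanSpace ℝ (Fin 3))).NeBot :=
    mem_closure_iff_nhdsWithin_neBot.1 hcl
  have ht : Tendsto (fun w => ‖Function.uncurry v w‖) (𝓝[Bx] (S, 0)) (𝓝 ‖v S 0‖) := hcw.tendsto.norm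
  exact le_of_tendsto ht (eventually_nhdsWithin_of_forall hall)

/-- `x^{3/2} ≤ x` on `[0,1]`. -/
theorem q4_rpow_three_halves_le_self {x : ℝ} (hx0 : 0 ≤ x) (hx1 : x ≤ 1) : x ^ (3 / 2 : ℝ) ≤ x := by
  rcases hx0.eq_or_lt with h | h
  · rw [← h, Real.zero_rpow (by norm_num)]
  · calc x ^ (3 / 2 : ℝ) ≤ x ^ (1 : ℝ) := Real.rpow_le_rpow_of_exponent_ge h hx1 (by norm_num)
      _ = x := Real.rpow_one x

/-- **The arithmetic of Q4**: with `R = ρq/2`, `r² ≤ 4q²/S`, `W ≤ η/q`, the Cauchy–Schwarz bounds `I_u² ≤ |B_{2R}|·C₊(2R)`,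
`I_ω² ≤ |B_{2R}|·W` and the parameter choices `ρ ≥ max(1, K₂/g)`, `η ≤ min(√S/2·m, Sρm²/(64B))` (`m = min 1 g`), the three
Q3 terms are each `≤ g`. -/
theorem q4_arith {B CI S ρ η q r R W Iu Iω g : ℝ}
    (hB : 0 < B) (hCI : 0 ≤ CI) (hS : 0 < S) (hq : 0 < q) (hr : 0 < r) (hW0 : 0 ≤ W) (hIu0 : 0 ≤ Iu)
    (hIω0 : 0 ≤ Iω) (hg0 : 0 < g) (hρ1 : 1 ≤ ρ)
    (hρK : (16 * Real.sqrt (B * CI) / Real.sqrt S) ^ 3 / g ≤ ρ)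
    (hη1 : η ≤ Real.sqrt S / 2 * min 1 g) (hη2 : η ≤ S * ρ * (min 1 g) ^ 2 / (64 * B))
    (hR : R = ρ * q / 2) (hr2 : r ^ 2 ≤ 4 * q ^ 2 / S) (hW : W ≤ η / q)
    (hIu : Iu ^ 2 ≤ B * (2 * R) ^ 3 * (CI * (2 * R))) (hIω : Iω ^ 2 ≤ B * (2 * R) ^ 3 * W) :
    r ^ (3 / 2 : ℝ) * W ^ (3 / 2 : ℝ) + r ^ 3 * ((R ^ 3)⁻¹ * Iu) ^ 3 + r ^ 3 * ((R ^ 2)⁻¹ * Iω) ^ 3 ≤ 3 * g := by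
  have hmin0 : 0 < min 1 g := lt_min one_pos hg0
  have hmin1 : min 1 g ≤ 1 := min_le_left _ _
  have hming : min 1 g ≤ g := min_le_right _ _
  have hsqS : 0 < Real.sqrt S := Real.sqrt_pos.2 hS
  have hsqS2 : Real.sqrt S ^ 2 = S := Real.sq_sqrt hS.le
  have hρ0 : 0 < ρ := by linarith
  have hR0 : 0 < R := by rw [hR]; positivity
  -- `r ≤ 2q/√S`
  have hr_le : r ≤ 2 * q / Real.sqrt S := by
    have h : r ^ 2 ≤ (2 * q / Real.sqrt S) ^ 2 := by
      rw [div_pow, mul_pow, hsqS2]; linarith [hr2]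
    exact (pow_le_pow_iff_left₀ hr.le (by positivity) two_ne_zero).1 h
  -- term 1
  have hrW : r * W ≤ 2 * η / Real.sqrt S :=
    calc r * W ≤ (2 * q / Real.sqrt S) * (η / q) := mul_le_mul hr_le hW hW0 (by positivity)
      _ = 2 * η / Real.sqrt S := by field_simp
  have hrW1 : r * W ≤ min 1 g := by
    refine hrW.trans ?_
    rw [div_le_iff₀ hsqS]
    calc 2 * η ≤ 2 * (Real.sqrt S / 2 * min 1 g) := by linarith
      _ = min 1 g * Real.sqrt S := by ring
  have hT1 : r ^ (3 / 2 : ℝ) * W ^ (3 / 2 : ℝ) ≤ g := by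
    rw [← Real.mul_rpow hr.le hW0]
    calc (r * W) ^ (3 / 2 : ℝ) ≤ r * W := q4_rpow_three_halves_le_self (by positivity) (hrW1.trans hmin1)
      _ ≤ g := hrW1.trans hming
  -- term 2
  have hIu_le : Iu ≤ 4 * R ^ 2 * Real.sqrt (B * CI) := by
    have h2 : Iu ^ 2 ≤ (4 * R ^ 2 * Real.sqrt (B * CI)) ^ 2 := by
      calc Iu ^ 2 ≤ B * (2 * R) ^ 3 * (CI * (2 * R)) := hIu
        _ = (4 * R ^ 2) ^ 2 * (B * CI) := by ring
        _ = (4 * R ^ 2 * Real.sqrt (B * CI)) ^ 2 := by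
            rw [mul_pow (4 * R ^ 2), Real.sq_sqrt (by positivity)]
    exact (pow_le_pow_iff_left₀ hIu0 (by positivity) two_ne_zero).1 h2
  have hb2 : (R ^ 3)⁻¹ * Iu * r ≤ 16 * Real.sqrt (B * CI) / Real.sqrt S / ρ := by
    calc (R ^ 3)⁻¹ * Iu * r ≤ (R ^ 3)⁻¹ * (4 * R ^ 2 * Real.sqrt (B * CI)) * (2 * q / Real.sqrt S) := by
          gcongr
      _ = 16 * Real.sqrt (B * CI) / Real.sqrt S / ρ := by
          rw [hR]; field_simp; ring
  have hT2 : r ^ 3 * ((R ^ 3)⁻¹ * Iu) ^ 3 ≤ g := by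
    have hb0 : 0 ≤ (R ^ 3)⁻¹ * Iu * r := by positivity
    set K : ℝ := (16 * Real.sqrt (B * CI) / Real.sqrt S) ^ 3 with hK
    have hK0 : 0 ≤ K := by positivity
    have hKρ : K ≤ ρ * g := (div_le_iff₀ hg0).1 hρK
    calc r ^ 3 * ((R ^ 3)⁻¹ * Iu) ^ 3 = ((R ^ 3)⁻¹ * Iu * r) ^ 3 := by ring
      _ ≤ (16 * Real.sqrt (B * CI) / Real.sqrt S / ρ) ^ 3 := pow_le_pow_left₀ hb0 hb2 3
      _ = K / ρ ^ 3 := by rw [hK, div_pow]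
      _ ≤ K / ρ := div_le_div_of_nonneg_left hK0 hρ0 (le_self_pow₀ hρ1 three_ne_zero)
      _ ≤ g := by
          rw [div_le_iff₀ hρ0]
          calc K ≤ ρ * g := hKρ
            _ = g * ρ := mul_comm _ _
  -- term 3
  have hb3sq : ((R ^ 2)⁻¹ * Iω * r) ^ 2 ≤ 64 * B * η / (S * ρ) := by
    calc ((R ^ 2)⁻¹ * Iω * r) ^ 2 = (R ^ 2)⁻¹ ^ 2 * Iω ^ 2 * r ^ 2 := by ring
      _ ≤ (R ^ 2)⁻¹ ^ 2 * (B * (2 * R) ^ 3 * W) * (4 * q ^ 2 / S) := by gcongr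
      _ = 32 * B * q ^ 2 * W / (R * S) := by field_simp; ring
      _ ≤ 32 * B * q ^ 2 * (η / q) / (R * S) := by gcongr
      _ = 64 * B * η / (S * ρ) := by rw [hR]; field_simp; ring
  have h64 : 64 * B * η ≤ S * ρ * (min 1 g) ^ 2 := by
    have := (le_div_iff₀ (by positivity : (0 : ℝ) < 64 * B)).1 hη2
    calc 64 * B * η = η * (64 * B) := by ring
      _ ≤ S * ρ * (min 1 g) ^ 2 := this
  have hb3sq' : ((R ^ 2)⁻¹ * Iω * r) ^ 2 ≤ (min 1 g) ^ 2 := by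
    refine hb3sq.trans ?_
    rw [div_le_iff₀ (by positivity)]
    calc 64 * B * η ≤ S * ρ * (min 1 g) ^ 2 := h64
      _ = (min 1 g) ^ 2 * (S * ρ) := by ring
  have hb30 : 0 ≤ (R ^ 2)⁻¹ * Iω * r := by positivity
  have hb3 : (R ^ 2)⁻¹ * Iω * r ≤ min 1 g := (pow_le_pow_iff_left₀ hb30 hmin0.le two_ne_zero).1 hb3sq'
  have hT3 : r ^ 3 * ((R ^ 2)⁻¹ * Iω) ^ 3 ≤ g := by
    calc r ^ 3 * ((R ^ 2)⁻¹ * Iω) ^ 3 = ((R ^ 2)⁻¹ * Iω * r) ^ 3 := by ring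
      _ ≤ (min 1 g) ^ 3 := pow_le_pow_left₀ hb30 hb3 3
      _ ≤ min 1 g := pow_le_of_le_one hmin0.le hmin1 three_ne_zero
      _ ≤ g := hming
  linarith [hT1, hT2, hT3]

/-- `e^{-a} ≤ c` once `1 ≤ c·e^{a}`. -/
theorem q4_exp_neg_le {a c : ℝ} (h : 1 ≤ c * Real.exp a) : Real.exp (-a) ≤ c :=
  calc Real.exp (-a) = Real.exp (-a) * 1 := (mul_one _).symm
    _ ≤ Real.exp (-a) * (c * Real.exp a) := mul_le_mul_of_nonneg_left h (Real.exp_pos _).le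
    _ = c := by rw [mul_left_comm, ← Real.exp_add, neg_add_cancel, Real.exp_zero, mul_one]

/-- **Q4|P (PROVED, v1.12).** `LocalEnergySlice → QuietSliceSmallCube → LevelConcentration` — see the §11 docblock. -/
theorem levelConcentration_of_slice_holds : LocalEnergySlice → QuietSliceSmallCube → LevelConcentration := by
  intro hP hQ M
  -- ## constants depending on `M` only
  obtain ⟨Mt, hMt, HP⟩ := hP M
  obtain ⟨CQ, hCQ, HQ⟩ := hQ
  obtain ⟨CI, HI⟩ := stub_uniformScaledEnergy M
  obtain ⟨γ, hγ, HBP⟩ := BarkerPrange2020_thm1_slab_bounds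
  obtain ⟨S, hS, hS4, HS⟩ := HBP Mt hMt
  obtain ⟨Cb, C₁, hCb, -, HB⟩ := HS (S / 2) ⟨by linarith, by linarith⟩
  have hS1 : S ≤ 1 := hS4.trans (by norm_num)
  have hsqS : 0 < Real.sqrt S := Real.sqrt_pos.2 hS
  have hsqS2 : Real.sqrt S ^ 2 = S := Real.sq_sqrt hS.le
  set Cp : ℝ := max CI 0 with hCp
  have hCp0 : 0 ≤ Cp := le_max_right _ _
  set B : ℝ := volume.real (ball (0 : EuclideanSpace ℝ (Fin 3)) 1) with hBdef
  have hB : 0 < B := by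
    rw [hBdef, measureReal_def]
    exact ENNReal.toReal_pos (measure_ball_pos volume _ one_pos).ne' measure_ball_lt_top.ne
  set g : ℝ := γ ^ 3 / (3 * CQ) with hgdef
  have hg0 : 0 < g := by positivity
  have h3g : CQ * (3 * g) = γ ^ 3 := by rw [hgdef]; field_simp
  set K₂ : ℝ := (16 * Real.sqrt (B * Cp) / Real.sqrt S) ^ 3 with hK₂
  set ρ : ℝ := max (max 1 (8 / Real.sqrt S)) (K₂ / g) with hρdef
  have hρ1 : 1 ≤ ρ := (le_max_left _ _).trans (le_max_left _ _)
  have hρ0 : 0 < ρ := lt_of_lt_of_le one_pos hρ1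
  have hρ8 : 8 / Real.sqrt S ≤ ρ := (le_max_right _ _).trans (le_max_left _ _)
  have hρK : K₂ / g ≤ ρ := le_max_right _ _
  have hρ64 : 64 / S ≤ ρ ^ 2 := by
    have h : (8 / Real.sqrt S) ^ 2 = 64 / S := by rw [div_pow, hsqS2]; norm_num
    rw [← h]
    exact pow_le_pow_left₀ (by positivity) hρ8 2
  set m : ℝ := min 1 g with hmdef
  have hm0 : 0 < m := lt_min one_pos hg0
  set η : ℝ := min (Real.sqrt S / 2 * m) (S * ρ * m ^ 2 / (64 * B)) with hηdef
  have hη0 : 0 < η := lt_min (by positivity) (by positivity)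
  have hη1 : η ≤ Real.sqrt S / 2 * m := min_le_left _ _
  have hη2 : η ≤ S * ρ * m ^ 2 / (64 * B) := min_le_right _ _
  refine ⟨ρ, η, hρ0, hη0, fun D hD => ?_⟩
  -- ## the threshold `a₁(M, D)`
  have hD0 : 0 < D := lt_of_lt_of_le (by norm_num) hD
  have hpS : 0 ≤ 1 / S := by positivity
  have hpC : 0 ≤ Cb * Real.sqrt (S * D) := by positivity
  have hpρ : 0 ≤ ρ ^ 2 := by positivity
  refine ⟨ρ ^ 2 + 1 / S + Cb * Real.sqrt (S * D) + 1, by positivity, fun a ha => ?_⟩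
  have ha0 : 0 ≤ a := by linarith only [ha, hpS, hpC, hpρ]
  have haρ : ρ ^ 2 ≤ a := by linarith only [ha, hpS, hpC]
  have haS : 1 / S ≤ a := by linarith only [ha, hpρ, hpC]
  have haC : Cb * Real.sqrt (S * D) + 1 ≤ a := by linarith only [ha, hpS, hpρ]
  have hexp2a : 2 * a + 1 ≤ Real.exp (2 * a) := Real.add_one_le_exp (2 * a)
  -- `ρ² e^{-2a} ≤ 8` and `e^{-2a} ≤ 2S`
  have he2aρ : ρ ^ 2 * Real.exp (-(2 * a)) ≤ 8 := by
    have h1 : Real.exp (-(2 * a)) ≤ 8 / ρ ^ 2 := by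
      refine q4_exp_neg_le ?_
      rw [div_mul_eq_mul_div, le_div_iff₀ (by positivity)]
      linarith only [hexp2a, haρ, hpρ]
    calc ρ ^ 2 * Real.exp (-(2 * a)) ≤ ρ ^ 2 * (8 / ρ ^ 2) := mul_le_mul_of_nonneg_left h1 hpρ
      _ = 8 := by field_simp
  have he2aS : Real.exp (-(2 * a)) ≤ 2 * S := by
    refine q4_exp_neg_le ?_
    have h1 : 1 ≤ a * S := by rw [div_le_iff₀ hS] at haS; exact haS
    have h2 := mul_le_mul_of_nonneg_left hexp2a (by positivity : (0 : ℝ) ≤ 2 * S)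
    linarith only [h1, h2, hS.le]
  have he2a1 : Real.exp (-(2 * a)) ≤ 1 := Real.exp_le_one_iff.2 (by linarith only [ha0])
  intro T τ t₁ x₀ u p n hfr hτ hrate ht₁ hviol k hk t ht
  by_contra hlt
  rw [not_le] at hlt
  -- ## the scales of level `k+1`
  have ht₁0 : 0 < t₁ := ht₁.1
  have ht₁T : t₁ ≤ T := ht₁.2
  have hk1 : (1 : ℝ) ≤ ((k + 1 : ℕ) : ℝ) := by exact_mod_cast Nat.le_add_left 1 k
  have hkn : ((k + 1 : ℕ) : ℝ) ≤ (n : ℝ) := by exact_mod_cast Nat.succ_le_of_lt hk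
  obtain ⟨E, hEdef⟩ : ∃ E : ℝ, Real.exp (-2 * a * ((k + 1 : ℕ) : ℝ)) = E := ⟨_, rfl⟩
  have hE0 : 0 < E := by rw [← hEdef]; exact Real.exp_pos _
  have hEa : E ≤ Real.exp (-(2 * a)) := by
    rw [← hEdef]
    refine Real.exp_le_exp.2 ?_
    have h := mul_le_mul_of_nonneg_left hk1 (by linarith only [ha0] : (0 : ℝ) ≤ 2 * a)
    linarith only [h]
  -- `σ = s_{k+1}/D`, `q = √σ`
  obtain ⟨σ, hσdef⟩ : ∃ σ : ℝ, levelScale a t₁ (k + 1) / D = σ := ⟨_, rfl⟩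
  rw [hσdef] at ht hlt
  have hσE : σ = t₁ * E / D := by rw [← hσdef, ← hEdef]; rfl
  have hσ0 : 0 < σ := by rw [hσE]; positivity
  have hσle : σ ≤ t₁ * Real.exp (-(2 * a)) / 8 := by
    calc σ = t₁ * E / D := hσE
      _ ≤ t₁ * Real.exp (-(2 * a)) / D := by gcongr
      _ ≤ t₁ * Real.exp (-(2 * a)) / 8 := by gcongr
  have h4σ : 4 * σ ≤ t₁ / 2 := by
    have : t₁ * Real.exp (-(2 * a)) ≤ t₁ * 1 := mul_le_mul_of_nonneg_left he2a1 ht₁0.le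
    linarith only [hσle, this]
  have ht0 : 0 ≤ t := by linarith only [ht.1, h4σ, ht₁0]
  have htT : t ≤ T := by linarith only [ht.2, hσ0, ht₁T]
  have htI : t ∈ Icc 0 T := ⟨ht0, htT⟩
  obtain ⟨d, hddef⟩ : ∃ d : ℝ, t₁ - t = d := ⟨_, rfl⟩
  have hdσ : σ ≤ d := by rw [← hddef]; linarith only [ht.2]
  have hd4 : d ≤ 4 * σ := by rw [← hddef]; linarith only [ht.1]
  have hd0 : 0 < d := lt_of_lt_of_le hσ0 hdσ
  obtain ⟨q, hqdef⟩ : ∃ q : ℝ, Real.sqrt σ = q := ⟨_, rfl⟩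
  rw [hqdef] at hlt
  have hq0 : 0 < q := by rw [← hqdef]; exact Real.sqrt_pos.2 hσ0
  have hq2 : q ^ 2 = σ := by rw [← hqdef]; exact Real.sq_sqrt hσ0.le
  -- the smoothing radius `r`, `r² = (t₁ - t)/S ∈ [σ/S, 4σ/S]`
  obtain ⟨r, hrdef⟩ : ∃ r : ℝ, Real.sqrt (d / S) = r := ⟨_, rfl⟩
  have hr0 : 0 < r := by rw [← hrdef]; exact Real.sqrt_pos.2 (by positivity)
  have hr2 : r ^ 2 = d / S := by rw [← hrdef]; exact Real.sq_sqrt (by positivity)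
  have hr2le : r ^ 2 ≤ 4 * q ^ 2 / S := by rw [hr2, hq2]; gcongr
  have hSr : S * r ^ 2 = d := by rw [hr2]; field_simp
  have hwin : t + S * r ^ 2 ≤ T := by rw [hSr, ← hddef]; linarith only [ht₁T]
  have htS : t + r ^ 2 * S = t₁ := by rw [mul_comm, hSr, ← hddef]; ring
  have hr2T : r ^ 2 ≤ T := by
    calc r ^ 2 ≤ 4 * q ^ 2 / S := hr2le
      _ = 4 * σ / S := by rw [hq2]
      _ ≤ 4 * (t₁ * Real.exp (-(2 * a)) / 8) / S := by gcongr
      _ = t₁ * Real.exp (-(2 * a)) / (2 * S) := by ring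
      _ ≤ t₁ * (2 * S) / (2 * S) := by gcongr
      _ = t₁ := by field_simp
      _ ≤ T := ht₁T
  -- the quiet radius `2R = ρ q`
  obtain ⟨R, hRdef⟩ : ∃ R : ℝ, R = ρ * q / 2 := ⟨_, rfl⟩
  have hR0 : 0 < R := by rw [hRdef]; positivity
  have h2R : 2 * R = ρ * q := by rw [hRdef]; ring
  have hρq0 : 0 < ρ * q := by positivity
  have h2rR : 2 * r ≤ R := by
    have hsq : (2 * r) ^ 2 ≤ R ^ 2 := by
      calc (2 * r) ^ 2 = 4 * r ^ 2 := by ring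
        _ ≤ 4 * (4 * q ^ 2 / S) := by gcongr
        _ = (64 / S) * q ^ 2 / 4 := by ring
        _ ≤ ρ ^ 2 * q ^ 2 / 4 := by gcongr
        _ = R ^ 2 := by rw [hRdef]; ring
    exact (pow_le_pow_iff_left₀ (by positivity) hR0.le two_ne_zero).1 hsq
  have hRT : (ρ * q) ^ 2 ≤ T := by
    calc (ρ * q) ^ 2 = ρ ^ 2 * σ := by rw [mul_pow, hq2]
      _ ≤ ρ ^ 2 * (t₁ * Real.exp (-(2 * a)) / 8) := by gcongr
      _ = t₁ * (ρ ^ 2 * Real.exp (-(2 * a))) / 8 := by ring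
      _ ≤ t₁ * 8 / 8 := by gcongr
      _ = t₁ := by ring
      _ ≤ T := ht₁T
  -- ## P: the rescaled slice is a local energy solution with `E²` datum and uloc bound `Mt`
  obtain ⟨π, hles, hE2, huloc⟩ := HP T τ u p hfr hτ hrate x₀ t r S hr0 hS hS1 ht0 hr2T hwin
  -- ## the slice `u(t)` is smooth and divergence-free
  have hCinf := hfr.1.contDiff_velocity htI
  have hC2 : ContDiff ℝ 2 (u t) := contDiff_infty.1 hCinf 2
  have hC1 : ContDiff ℝ 1 (u t) := contDiff_infty.1 hCinf 1
  have hcu : Continuous (u t) := hCinf.continuous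
  have hcω : Continuous (curl (u t)) := continuous_curl hC1
  have hdiv : VectorCalculus.IsDivFree (u t) := hfr.1.divFree t htI
  -- ## Q3 at the slice
  have hQ3 := HQ (u t) hC2 hdiv x₀ r R hr0 h2rR
  rw [h2R] at hQ3
  obtain ⟨W, hWdef⟩ : ∃ W : ℝ, (∫ y in ball x₀ (ρ * q), ‖curl (u t) y‖ ^ 2) = W := ⟨_, rfl⟩
  obtain ⟨Iu, hIudef⟩ : ∃ Iu : ℝ, (∫ y in ball x₀ (ρ * q), ‖u t y‖) = Iu := ⟨_, rfl⟩
  obtain ⟨Iω, hIωdef⟩ : ∃ Iω : ℝ, (∫ y in ball x₀ (ρ * q), ‖curl (u t) y‖) = Iω := ⟨_, rfl⟩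
  rw [hWdef, hIudef, hIωdef] at hQ3
  have hW0 : 0 ≤ W := by rw [← hWdef]; exact integral_nonneg fun y => sq_nonneg _
  have hIu0 : 0 ≤ Iu := by rw [← hIudef]; exact integral_nonneg fun y => norm_nonneg _
  have hIω0 : 0 ≤ Iω := by rw [← hIωdef]; exact integral_nonneg fun y => norm_nonneg _
  -- the quiet hypothesis `W < η σ^{-1/2} = η/q`
  have hWle : W ≤ η / q := by
    have h1 : η * σ ^ (-(1 / 2 : ℝ)) = η / q := by
      rw [Real.rpow_neg hσ0.le, ← Real.sqrt_eq_rpow, hqdef, div_eq_mul_inv]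
    have h2 : W < η * σ ^ (-(1 / 2 : ℝ)) := by rw [← hWdef]; simpa only [vorticity_apply] using hlt
    rw [h1] at h2
    exact h2.le
  -- I1 at `(t, x₀)`, radius `ρ q`
  have hI1 : ∫ y in ball x₀ (ρ * q), ‖u t y‖ ^ 2 ≤ Cp * (ρ * q) :=
    q4_I1_integral_at HI hfr hτ hrate x₀ hρq0 ht0 htT hRT
  -- Cauchy–Schwarz on `B(x₀, ρ q)`
  have hvol : volume.real (ball x₀ (ρ * q)) = (ρ * q) ^ 3 * B := q4_volume_real_ball x₀ hρq0
  have hIu2 : Iu ^ 2 ≤ B * (2 * R) ^ 3 * (Cp * (2 * R)) := by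
    have h := q4_integral_norm_le_sqrt hcu x₀ (ρ * q)
    rw [hIudef] at h
    have hX0 : 0 ≤ volume.real (ball x₀ (ρ * q)) * ∫ y in ball x₀ (ρ * q), ‖u t y‖ ^ 2 :=
      mul_nonneg measureReal_nonneg (integral_nonneg fun _ => sq_nonneg _)
    calc Iu ^ 2 ≤ (Real.sqrt (volume.real (ball x₀ (ρ * q)) * ∫ y in ball x₀ (ρ * q), ‖u t y‖ ^ 2)) ^ 2 :=
          pow_le_pow_left₀ hIu0 h 2
      _ = volume.real (ball x₀ (ρ * q)) * ∫ y in ball x₀ (ρ * q), ‖u t y‖ ^ 2 := Real.sq_sqrt hX0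
      _ ≤ (ρ * q) ^ 3 * B * (Cp * (ρ * q)) := by rw [hvol]; gcongr
      _ = B * (2 * R) ^ 3 * (Cp * (2 * R)) := by rw [h2R]; ring
  have hIω2 : Iω ^ 2 ≤ B * (2 * R) ^ 3 * W := by
    have h := q4_integral_norm_le_sqrt hcω x₀ (ρ * q)
    rw [hWdef, hIωdef] at h
    have hX0 : 0 ≤ volume.real (ball x₀ (ρ * q)) * W := mul_nonneg measureReal_nonneg hW0
    calc Iω ^ 2 ≤ (Real.sqrt (volume.real (ball x₀ (ρ * q)) * W)) ^ 2 := pow_le_pow_left₀ hIω0 h 2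
      _ = volume.real (ball x₀ (ρ * q)) * W := Real.sq_sqrt hX0
      _ = B * (2 * R) ^ 3 * W := by rw [hvol, h2R]; ring
  -- ## the arithmetic: the three Q3 terms are `≤ g = γ³/(3 C_Q)` each
  have harith := q4_arith hB hCp0 hS hq0 hr0 hW0 hIu0 hIω0 hg0 hρ1 hρK hη1 hη2 hRdef hr2le hWle hIu2 hIω2
  have hcube : ∫⁻ y in ball x₀ (2 * r), ‖u t y‖ₑ ^ (3 : ℝ) ≤ ENNReal.ofReal (γ ^ 3) := by
    refine hQ3.trans (ENNReal.ofReal_le_ofReal ?_)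
    rw [← h3g]
    exact mul_le_mul_of_nonneg_left harith hCQ.le
  have hcube' : ∫⁻ y in ball x₀ (2 * r), ‖u t y‖ₑ ^ 3 ≤ ENNReal.ofReal (γ ^ 3) := by
    have e : ∫⁻ y in ball x₀ (2 * r), ‖u t y‖ₑ ^ (3 : ℝ) = ∫⁻ y in ball x₀ (2 * r), ‖u t y‖ₑ ^ 3 :=
      lintegral_congr fun y => by rw [show (3 : ℝ) = ((3 : ℕ) : ℝ) by norm_num, ENNReal.rpow_natCast]
    rw [← e]; exact hcube
  have hL3u : eLpNorm (u t) 3 (volume.restrict (ball x₀ (2 * r))) ≤ ENNReal.ofReal γ :=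
    q4_eLpNorm_three_le_of_lintegral_cube_le hγ.le hcube'
  -- ## transport to the rescaled datum: `‖v(0)‖_{L³(B(0,2))} ≤ γ`
  have hv0 : sliceField u x₀ t r 0 = fun y => r • u t (x₀ + r • y) := by
    funext y; rw [sliceField_apply, mul_zero, add_zero]
  have hsmul : ∀ (q' : ℝ≥0∞) (μ : Measure (EuclideanSpace ℝ (Fin 3))),
      eLpNorm (fun y => r • u t (x₀ + r • y)) q' μ = ‖r‖ₑ * eLpNorm (fun y => u t (x₀ + r • y)) q' μ :=
    fun q' μ => by
      rw [show (fun y => r • u t (x₀ + r • y)) = r • fun y => u t (x₀ + r • y) from rfl, eLpNorm_const_smul]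
  have hlr : ‖r‖ₑ = ENNReal.ofReal r := Real.enorm_eq_ofReal hr0.le
  have hL3' : eLpNorm (sliceField u x₀ t r 0) 3 (volume.restrict (ball (0 : EuclideanSpace ℝ (Fin 3)) 2)) ≤
      ENNReal.ofReal γ := by
    rw [hv0]
    calc eLpNorm (fun y => r • u t (x₀ + r • y)) 3 (volume.restrict (ball (0 : EuclideanSpace ℝ (Fin 3)) 2))
        = ‖r‖ₑ * (ENNReal.ofReal ((r ^ 3)⁻¹) ^ (1 / (3 : ℝ≥0∞)).toReal *
            eLpNorm (u t) 3 (volume.restrict (ball (x₀ + r • (0 : EuclideanSpace ℝ (Fin 3))) (r * 2)))) := by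
          rw [hsmul, eLpNorm_comp_add_smul_ball (u t) x₀ 0 hr0 2 (by norm_num)]
      _ ≤ ‖r‖ₑ * (ENNReal.ofReal r⁻¹ * ENNReal.ofReal γ) := by
          rw [ofReal_inv_cube_rpow_third hr0, smul_zero, add_zero, mul_comm r 2]
          gcongr
      _ = ENNReal.ofReal γ := by
          rw [hlr, ← ENNReal.ofReal_mul (by positivity), ← ENNReal.ofReal_mul (by positivity)]
          congr 1
          field_simp
  -- ## Barker–Prange (i): `‖v‖ ≤ Cb` a.e. on `(S/2,S) × B(0,1/3)`, hence everywhere there, hence at `(S,0)`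
  obtain ⟨hae, -, -⟩ := HB _ _ π hles hE2 huloc hL3'
  have hcontv := sliceField_continuousOn hfr.1 x₀ hr0 hS ht0 hwin
  set U : Set (ℝ × EuclideanSpace ℝ (Fin 3)) := Ioo (S / 2) S ×ˢ ball (0 : EuclideanSpace ℝ (Fin 3)) (1 / 3) with hU
  have hUsub : U ⊆ Icc 0 S ×ˢ (univ : Set (EuclideanSpace ℝ (Fin 3))) :=
    prod_mono (fun s' hs' => ⟨by linarith [hs'.1], hs'.2.le⟩) (subset_univ _)
  have hae' : ∀ᵐ z ∂(volume.restrict U), ‖Function.uncurry (sliceField u x₀ t r) z‖ ≤ Cb :=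
    hae.mono fun w hw => hw
  have hall := norm_le_of_ae_le_of_continuousOn (isOpen_Ioo.prod isOpen_ball) (hcontv.mono hUsub) hae'
  have hend : ‖sliceField u x₀ t r S 0‖ ≤ Cb := q4_norm_endpoint_le hS hcontv hall
  have hvS : sliceField u x₀ t r S 0 = r • u t₁ x₀ := by
    rw [sliceField_apply, smul_zero, add_zero, htS]
  rw [hvS, norm_smul, Real.norm_of_nonneg hr0.le] at hend
  -- ## the contradiction with the violator `e^{a(n+1)} ≤ ‖u(t₁,x₀)‖ √t₁`
  have hEe : E * Real.exp (a * ((k + 1 : ℕ) : ℝ)) ^ 2 = 1 := by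
    rw [← hEdef, sq, ← Real.exp_add, ← Real.exp_add, ← Real.exp_zero]
    congr 1; ring
  have hσD : σ * D = t₁ * E := by rw [hσE]; field_simp
  have ht₁eq : t₁ = σ * D * Real.exp (a * ((k + 1 : ℕ) : ℝ)) ^ 2 := by
    rw [hσD]
    calc t₁ = t₁ * (E * Real.exp (a * ((k + 1 : ℕ) : ℝ)) ^ 2) := by rw [hEe, mul_one]
      _ = t₁ * E * Real.exp (a * ((k + 1 : ℕ) : ℝ)) ^ 2 := by ring
  have hkey : Real.sqrt t₁ ≤ r * (Real.sqrt (S * D) * Real.exp (a * ((k + 1 : ℕ) : ℝ))) := by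
    have h0 : 0 ≤ r * (Real.sqrt (S * D) * Real.exp (a * ((k + 1 : ℕ) : ℝ))) := by positivity
    have hsq : Real.sqrt t₁ ^ 2 ≤ (r * (Real.sqrt (S * D) * Real.exp (a * ((k + 1 : ℕ) : ℝ)))) ^ 2 := by
      calc Real.sqrt t₁ ^ 2 = t₁ := Real.sq_sqrt ht₁0.le
        _ = σ * D * Real.exp (a * ((k + 1 : ℕ) : ℝ)) ^ 2 := ht₁eq
        _ ≤ d * D * Real.exp (a * ((k + 1 : ℕ) : ℝ)) ^ 2 := by gcongr
        _ = (r * (Real.sqrt (S * D) * Real.exp (a * ((k + 1 : ℕ) : ℝ)))) ^ 2 := by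
            rw [mul_pow, mul_pow, Real.sq_sqrt (by positivity), hr2]; field_simp
    exact (pow_le_pow_iff_left₀ (Real.sqrt_nonneg _) h0 two_ne_zero).1 hsq
  have hexpkn : Real.exp (a * ((k + 1 : ℕ) : ℝ)) ≤ Real.exp (a * n) :=
    Real.exp_le_exp.2 (mul_le_mul_of_nonneg_left hkn ha0)
  have hCe : Cb * Real.sqrt (S * D) < Real.exp a := by linarith only [Real.add_one_le_exp a, haC]
  have hchain : ‖u t₁ x₀‖ * Real.sqrt t₁ < Real.exp (a * (n + 1)) := by
    calc ‖u t₁ x₀‖ * Real.sqrt t₁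
        ≤ ‖u t₁ x₀‖ * (r * (Real.sqrt (S * D) * Real.exp (a * ((k + 1 : ℕ) : ℝ)))) :=
          mul_le_mul_of_nonneg_left hkey (norm_nonneg _)
      _ = (r * ‖u t₁ x₀‖) * (Real.sqrt (S * D) * Real.exp (a * ((k + 1 : ℕ) : ℝ))) := by ring
      _ ≤ Cb * (Real.sqrt (S * D) * Real.exp (a * ((k + 1 : ℕ) : ℝ))) :=
          mul_le_mul_of_nonneg_right hend (by positivity)
      _ ≤ Cb * (Real.sqrt (S * D) * Real.exp (a * n)) := by gcongr
      _ = (Cb * Real.sqrt (S * D)) * Real.exp (a * n) := by ring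
      _ < Real.exp a * Real.exp (a * n) := mul_lt_mul_of_pos_right hCe (Real.exp_pos _)
      _ = Real.exp (a * (n + 1)) := by rw [← Real.exp_add]; congr 1; ring
  exact absurd hviol (not_le.2 hchain)

end Q4Proof

/-! ## §12 (v1.14) LINE g15-1 «light_slice» — β|P EXECUTED: `LocalEnergySlice → LightSliceRegular` ⟸ B1|P `SliceWindowBound` + B2 `BoundedCylinderRegular`,
kernel `lightSliceRegular_of_windowBound_of_cylinder` sorry-free

THE LEVER (new vs every filed line and vs the β plan of record, `Lines/slice-census.md` «β|P EXECUTION PLAN»): a BOUNDED velocity is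
SUBCRITICAL — on sub-cylinders of ratio `κ` the scale-invariant cube functional DECAYS, `C(κϱ; z) ≤ |B₁|·B³·κ³` when `‖u‖ ≤ B/ϱ` on `Q_ϱ(z)`
(tree `cknC_le_of_ae_bound_subset`), with NO smallness of the velocity; so ONE Seregin–Šverák pressure-decay step
(`seregin_sverak_pressure_decay_holds`, tree) from the Type-I pressure budget `D(ϱ₀; z) ≤ C₂(M)` at EVERY scale (E-chain CS2
`ColdSmoothing.stub_coldPressureGauge`, PROVED `Theorems/QuarterLogPincerColdSmoothingPressureGauge.lean`) reaches the ε-regularity threshold of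
CS3 `ColdSmoothing.stub_smallEnergySmoothing` (PROVED `…ColdSmoothingSmallEnergy.lean`): B2 is `ColdSmoothing.coldRegularity_of_stubs` with
COLDNESS REPLACED BY BOUNDEDNESS (choose `θ(M)` against `C₂`, then the first ratio `κ₀(M,B)` against `θ⁻²|B₁|B³κ₀³`).  This DELETES from the
β plan of record the `NSBoundedHigherRegularityBounds` representative `V`, the gauge bookkeeping (b)–(c) and the a.e.-to-everywhere step (f)
(CS3 already concludes pointwise, up to the vertex time, for the classical `u`).  The boundedness itself is Barker–Prange 2020 Thm 1 (i) on
the light slice — B1|P = P + `BarkerPrange2020_thm1_slab_bounds` (i), the §11 pattern VERBATIM up to the last five lines (a.e. → every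
point of the OPEN box by `norm_le_of_ae_le_of_continuousOn`; no corner point needed: B2's cylinders are open in time).
bears_on: W7 «R0-rate» `CubicRung.TypeIQuantCubicExp` through `typeIQuantCubicExp_of_sliceCensus_of_lightSlice` (tree
`Theorems/QuarterLogPincerFlatChainAssembly.lean`) — with β|P closed, `SliceCensus → TypeIQuantCubicExp` is UNCONDITIONAL and (afl-r1
`sliceCensus_iff_typeIQuantCubicExp`, `Negative/SliceCensusIsRung.lean`) `SliceCensus ↔ TypeIQuantCubicExp` modulo S1 (PROVED): the record
«R0-rate ⇔ slab-initial slice census» becomes a theorem pair.  No summit is proved: `SliceCensus`, R0-rate, ⟨24077⟩, W7, NS regularity OPEN.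
Cheapest falsifier of B2: a bounded classical NS flow on `Q_1` with UNBOUNDED gradient at the vertex — impossible for bounded pressure budget
(Seregin–Šverák 2009 Thm 2.x «bounded ancient solutions are smooth»; tree `NSBoundedHigherRegularityBounds_holds`); B2 can only fail at the
constants' dependence `(κ, c_K)(M, B)`, which the two-ratio choice makes explicit.  Instrument row: `D(ϱ; z) > C₂(M)` for some admissible
cylinder under Type-I(M) — excluded by I1 (PROVED). -/
section LightSlice

/-- **B1 `SliceWindowBound`** (size M; B1|P `stub_sliceWindowBound_of_slice` REGISTERED v1.14).  For `M ≥ 1` there are `γ = γ_BP > 0`,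
`ϑ = √(8/S_BP(M̃(M))) ≥ 2` and `C_b = C_BP > 0`: if the slice `u(t₁ − 2s)` carries `≤ γ³` of cube mass on `B(x, ϑ√s)` (`0 < s`, `2s ≤ t₁ ≤ T`,
`(ϑ/2)²s ≤ T`), then `‖u(t,y)‖ ≤ C_b s^{-1/2}` for `t ∈ (t₁ − s, t₁)`, `y ∈ B(x, ϑ√s/6)`.
Mechanism: P at `(x, t* = t₁ − 2s, r = ϑ√s/2, S)` (`S r² = 2s`, so slab time `σ ∈ (S/2,S)` is `t ∈ (t₁ − s, t₁)` and `B(0,1/3)` is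
`B(x, r/3)`); the datum's `L³(B(0,2))` norm is `≤ γ` by `eLpNorm_comp_add_smul_ball` (§11 verbatim); BP (i) gives `‖v‖ ≤ C_b` a.e. on the open
box, everywhere by `norm_le_of_ae_le_of_continuousOn` + `sliceField_continuousOn`; unscale `‖u(t,y)‖ = ‖v(σ,y')‖/r ≤ 2C_b/(ϑ√s) ≤ C_b s^{-1/2}`.
Why it might fail: not as mathematics (it is §11's BP step with the point `(σ, y')` interior instead of the corner).
[BarkerPrange2020 Thm 1 = tree `BarkerPrange2020_thm1_slab_bounds`; P = `stub_localEnergySlice` (PROVED v1.11)] -/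
def SliceWindowBound : Prop :=
  ∀ M : ℝ, 1 ≤ M → ∃ γ ϑ Cb : ℝ, 0 < γ ∧ 2 ≤ ϑ ∧ 0 < Cb ∧
    ∀ (T τ : ℝ) (u : ℝ → EuclideanSpace ℝ (Fin 3) → EuclideanSpace ℝ (Fin 3))
      (p : ℝ → EuclideanSpace ℝ (Fin 3) → ℝ),
      (IsClassicalNSSolutionOn (Icc 0 T) 1 0 u p ∧
        ∀ m : ℕ, ∃ C : NNReal, ∀ t ∈ Icc 0 T, eLpNorm (iteratedFDeriv ℝ m (u t)) 2 volume ≤ C) →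
      0 < τ →
      (∀ t ∈ Icc 0 T, ∀ x : EuclideanSpace ℝ (Fin 3), ‖u t x‖ ≤ M * (T + τ - t) ^ (-(1 / 2 : ℝ))) →
      ∀ (t₁ s : ℝ) (x : EuclideanSpace ℝ (Fin 3)), 0 < s → 2 * s ≤ t₁ → (ϑ / 2) ^ 2 * s ≤ T → t₁ ≤ T →
        (∫⁻ y in ball x (ϑ * Real.sqrt s), ‖u (t₁ - 2 * s) y‖ₑ ^ (3 : ℝ) ≤ ENNReal.ofReal (γ ^ 3)) →
        ∀ t ∈ Ioo (t₁ - s) t₁, ∀ y ∈ ball x (ϑ * Real.sqrt s / 6), ‖u t y‖ ≤ Cb * s ^ (-(1 / 2 : ℝ))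

/-- **B2 `BoundedCylinderRegular`** (size M; `stub_boundedCylinderRegular` REGISTERED v1.14) — BOUNDED CYLINDERS OF A TYPE-I FRAME ARE
QUANTITATIVELY REGULAR UP TO THE VERTEX.  For `M ≥ 1`, `B > 0` there are `κ = κ(M,B) ∈ (0,1]`, `c_K ≥ 1`: in the crux frame with rate `M`,
a backward cylinder `Q_ϱ(z)` with `ϱ² ≤ z₁ ≤ T` on which `‖u‖ ≤ B/ϱ` carries `‖∇ʲu(t,x)‖ ≤ c_K (κϱ)^{-(j+1)}` for
`t ∈ [z₁ − (κϱ/2)², z₁]`, `x ∈ B(z₂, κϱ/2)`, `j ≤ 2`.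
Mechanism (= `ColdSmoothing.coldRegularity_of_stubs` with coldness replaced by boundedness): `C(r'; z) ≤ |B₁|B³(r'/ϱ)³` for `r' ≤ ϱ`
(`cknC_le_of_ae_bound_subset`); CS2 at `(z, ϱ₀ := κ₀ϱ)`: `(u, p̃)` suitable in every `Q_{ϱ'}(z)`, `ϱ' ≤ ϱ₀`, `D(ϱ₀) ≤ C₂(M)`; one decay step
`D(θϱ₀) ≤ c(θ C₂ + θ⁻²|B₁|B³κ₀³)`; with `θ := min(1/2, ε⋆/(4(c+1)C₂))`, `κ₀³ := min(1, ε⋆θ²/(4(c+1)|B₁|B³ + 1))`-type choices,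
`C(θϱ₀) + D(θϱ₀) < ε⋆` and CS3 at `r = θκ₀ϱ =: κϱ` concludes.  Why it might fail: not as mathematics for the Type-I frame (pressure budget
from I1); without Type I the pressure budget is missing (Serrin's example `u = ∇h(t,x)` is bounded and irregular in time but its
SPATIAL derivatives are still bounded — the statement only claims spatial derivatives).
[Seregin–Šverák 2009 (as13) = tree `seregin_sverak_pressure_decay_holds`; Seregin 2014 Lemma 6.1 = `seregin2014_lemma61_holds`; CS2/CS3 tree] -/
def BoundedCylinderRegular : Prop :=
  ∀ M B : ℝ, 1 ≤ M → 0 < B → ∃ κ cK : ℝ, 0 < κ ∧ κ ≤ 1 ∧ 1 ≤ cK ∧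
    ∀ (T τ : ℝ) (u : ℝ → EuclideanSpace ℝ (Fin 3) → EuclideanSpace ℝ (Fin 3))
      (p : ℝ → EuclideanSpace ℝ (Fin 3) → ℝ),
      (IsClassicalNSSolutionOn (Icc 0 T) 1 0 u p ∧
        ∀ m : ℕ, ∃ C : NNReal, ∀ t ∈ Icc 0 T, eLpNorm (iteratedFDeriv ℝ m (u t)) 2 volume ≤ C) →
      0 < τ →
      (∀ t ∈ Icc 0 T, ∀ x : EuclideanSpace ℝ (Fin 3), ‖u t x‖ ≤ M * (T + τ - t) ^ (-(1 / 2 : ℝ))) →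
      ∀ (z : ℝ × EuclideanSpace ℝ (Fin 3)) (ϱ : ℝ), 0 < ϱ → ϱ ^ 2 ≤ z.1 → z.1 ≤ T →
        (∀ w ∈ parabolicCylinder ϱ z, ‖u w.1 w.2‖ ≤ B / ϱ) →
        ∀ t ∈ Icc (z.1 - (κ * ϱ / 2) ^ 2) z.1, ∀ x ∈ ball z.2 (κ * ϱ / 2), ∀ j : ℕ, j ≤ 2 →
          ‖iteratedFDeriv ℝ j (u t) x‖ ≤ cK * (κ * ϱ) ^ (-((j : ℝ) + 1))

/-- **KERNEL of LINE g15-1 (sorry-free): B1 → B2 → β.**  Constants: `R := 2ρ√s` (window points are light-block points since `ρ ≥ 4M > 0`,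
`Λ·R ≤ e^{a}√s` from `4Λρ ≤ e^{a}`); `a₂ := (ϑ/2)² + 1` (so `2s ≤ s·3 ≤ t₁` and `(ϑ/2)²s ≤ T`); B2 at vertex `z = (t, x)` for EACH window time
`t ∈ [t₁ − s/32, t₁]` with `ϱ := √s/3` (`Q_ϱ(z) ⊂ (t₁ − s, t₁) × B(x, ϑ√s/6)` as `ϑ ≥ 2`), `B := C_b/3`; read off at the vertex:
`c_K(κ√s/3)^{-(j+1)} ≤ c_K(3/κ)³ s^{-(j+1)/2}`, `Cg := max 1 (c_K(3/κ)³)`. -/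
theorem lightSliceRegular_of_windowBound_of_cylinder (h1 : SliceWindowBound) (h2 : BoundedCylinderRegular) :
    LightSliceRegular := by
  intro M hM
  obtain ⟨γ, ϑ, Cb, hγ, hϑ2, hCb, H1⟩ := h1 M hM
  obtain ⟨κ, cK, hκ, hκ1, hcK, H2⟩ := h2 M (Cb / 3) hM (by positivity)
  have hM0 : 0 < M := lt_of_lt_of_le one_pos hM
  have hϑ0 : 0 < ϑ := lt_of_lt_of_le two_pos hϑ2
  set Cg : ℝ := max 1 (cK * (3 / κ) ^ 3) with hCg
  refine ⟨Cg, γ, ϑ, (ϑ / 2) ^ 2 + 1, le_max_left _ _, hγ, by linarith, by positivity, ?_⟩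
  intro Λ a hΛ ha T τ t₁ x₀ u p k ρ hfr hτ hrate ht₁ hρM hρϑ hρΛ hlight
  have ht₁0 : 0 < t₁ := ht₁.1
  have ht₁T : t₁ ≤ T := ht₁.2
  have hρ0 : 0 < ρ := by linarith
  have hΛ0 : 0 < Λ := lt_of_lt_of_le one_pos hΛ
  have ha1 : 1 ≤ a := le_trans (by nlinarith [sq_nonneg (ϑ / 2)]) ha
  have ha0 : 0 ≤ a := le_trans zero_le_one ha1
  -- ## the scale `s = s_{k+1}` and its size
  set s : ℝ := levelScale a t₁ (k + 1) with hs
  have hsE : s = t₁ * Real.exp (-2 * a * ((k + 1 : ℕ) : ℝ)) := by rw [hs, levelScale]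
  have hs0 : 0 < s := by rw [hsE]; positivity
  have hsqrt : 0 < Real.sqrt s := Real.sqrt_pos.2 hs0
  have hexp2a : 2 * a + 1 ≤ Real.exp (2 * a) := Real.add_one_le_exp (2 * a)
  have hk1 : (1 : ℝ) ≤ ((k + 1 : ℕ) : ℝ) := by exact_mod_cast Nat.le_add_left 1 k
  have hEa : Real.exp (-2 * a * ((k + 1 : ℕ) : ℝ)) ≤ Real.exp (-(2 * a)) := by
    refine Real.exp_le_exp.2 ?_
    have h := mul_le_mul_of_nonneg_left hk1 (by linarith only [ha0] : (0 : ℝ) ≤ 2 * a)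
    linarith only [h]
  have he3 : Real.exp (-(2 * a)) ≤ 1 / 3 := by
    refine q4_exp_neg_le ?_
    linarith only [hexp2a, ha1]
  have heϑ : Real.exp (-(2 * a)) ≤ 1 / ((ϑ / 2) ^ 2 + 1) := by
    refine q4_exp_neg_le ?_
    rw [div_mul_eq_mul_div, one_mul, le_div_iff₀ (by positivity)]
    linarith only [hexp2a, ha, ha1]
  have hs3 : s ≤ t₁ / 3 := by
    calc s = t₁ * Real.exp (-2 * a * ((k + 1 : ℕ) : ℝ)) := hsE
      _ ≤ t₁ * Real.exp (-(2 * a)) := mul_le_mul_of_nonneg_left hEa ht₁0.le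
      _ ≤ t₁ * (1 / 3) := mul_le_mul_of_nonneg_left he3 ht₁0.le
      _ = t₁ / 3 := by ring
  have h2s : 2 * s ≤ t₁ := by linarith only [hs3, hs0]
  have hsϑ : (ϑ / 2) ^ 2 * s ≤ T := by
    have hfrac : (ϑ / 2) ^ 2 / ((ϑ / 2) ^ 2 + 1) ≤ 1 := by
      rw [div_le_one (by positivity)]; linarith
    calc (ϑ / 2) ^ 2 * s ≤ (ϑ / 2) ^ 2 * (t₁ * Real.exp (-(2 * a))) := by
          rw [hsE]; exact mul_le_mul_of_nonneg_left (mul_le_mul_of_nonneg_left hEa ht₁0.le) (by positivity)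
      _ ≤ (ϑ / 2) ^ 2 * (t₁ * (1 / ((ϑ / 2) ^ 2 + 1))) := by gcongr
      _ = t₁ * ((ϑ / 2) ^ 2 / ((ϑ / 2) ^ 2 + 1)) := by ring
      _ ≤ t₁ * 1 := mul_le_mul_of_nonneg_left hfrac ht₁0.le
      _ ≤ T := by rw [mul_one]; exact ht₁T
  -- ## the witness radius `R = 2ρ√s`
  show ∃ R : ℝ, 4 * M * Real.sqrt s ≤ R ∧ Λ * R ≤ Real.exp a * Real.sqrt s ∧
    ∀ t ∈ Icc (t₁ - s / 32) t₁, ∀ x : EuclideanSpace ℝ (Fin 3), R < ‖x - x₀‖ → ‖x - x₀‖ < Λ * R →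
      ∀ j : ℕ, j ≤ 2 → ‖iteratedFDeriv ℝ j (u t) x‖ ≤ Cg * s ^ (-(((j : ℝ) + 1) / 2))
  refine ⟨2 * ρ * Real.sqrt s, ?_, ?_, ?_⟩
  · have h : 4 * M ≤ 2 * ρ := by linarith
    exact mul_le_mul_of_nonneg_right h hsqrt.le
  · calc Λ * (2 * ρ * Real.sqrt s) = 2 * Λ * ρ * Real.sqrt s := by ring
      _ ≤ 4 * Λ * ρ * Real.sqrt s := by
          have h : 2 * Λ * ρ ≤ 4 * Λ * ρ := by nlinarith [mul_pos hΛ0 hρ0]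
          exact mul_le_mul_of_nonneg_right h hsqrt.le
      _ ≤ Real.exp a * Real.sqrt s := mul_le_mul_of_nonneg_right hρΛ hsqrt.le
  intro t ht x hxR hxΛ j hj
  -- ## `x` is a light-block point ⇒ small cube mass of the slice `u(t₁ − 2s)` on `B(x, ϑ√s)`
  have hρs0 : 0 ≤ ρ * Real.sqrt s := by positivity
  have hx1 : ρ * Real.sqrt s ≤ ‖x - x₀‖ := by linarith only [hxR, hρs0]
  have hx2 : ‖x - x₀‖ ≤ 4 * Λ * ρ * Real.sqrt s := by
    have h : Λ * (2 * ρ * Real.sqrt s) ≤ 4 * Λ * ρ * Real.sqrt s := by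
      have h' : 2 * Λ * ρ ≤ 4 * Λ * ρ := by nlinarith [mul_pos hΛ0 hρ0]
      calc Λ * (2 * ρ * Real.sqrt s) = 2 * Λ * ρ * Real.sqrt s := by ring
        _ ≤ 4 * Λ * ρ * Real.sqrt s := mul_le_mul_of_nonneg_right h' hsqrt.le
    linarith only [hxΛ, h]
  have hL3 : ∫⁻ y in ball x (ϑ * Real.sqrt s), ‖u (t₁ - 2 * s) y‖ₑ ^ (3 : ℝ) ≤ ENNReal.ofReal (γ ^ 3) :=
    hlight x hx1 hx2
  -- ## B1: the window bound on `(t₁ − s, t₁) × B(x, ϑ√s/6)`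
  have HB := H1 T τ u p hfr hτ hrate t₁ s x hs0 h2s hsϑ ht₁T hL3
  -- ## B2 at the vertex `(t, x)`, radius `ϱ = √s/3`
  obtain ⟨ϱ, hϱdef⟩ : ∃ ϱ : ℝ, ϱ = Real.sqrt s / 3 := ⟨_, rfl⟩
  have hϱ0 : 0 < ϱ := by rw [hϱdef]; positivity
  have hϱ2 : ϱ ^ 2 = s / 9 := by rw [hϱdef, div_pow, Real.sq_sqrt hs0.le]; norm_num
  have htt₁ : t ≤ t₁ := ht.2
  have ht32 : t₁ - s / 32 ≤ t := ht.1
  have hϱt : ϱ ^ 2 ≤ t := by rw [hϱ2]; linarith only [ht32, hs3, hs0]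
  have htT : t ≤ T := htt₁.trans ht₁T
  have hbd : ∀ w ∈ parabolicCylinder ϱ ((t, x) : ℝ × EuclideanSpace ℝ (Fin 3)), ‖u w.1 w.2‖ ≤ Cb / 3 / ϱ := by
    intro w hw
    rw [mem_parabolicCylinder] at hw
    obtain ⟨⟨hw1a, hw1b⟩, hw2⟩ := hw
    dsimp only at hw1a hw1b hw2
    have hw1 : w.1 ∈ Ioo (t₁ - s) t₁ := ⟨by rw [hϱ2] at hw1a; linarith only [hw1a, ht32, hs0], by linarith only [hw1b, htt₁]⟩
    have hw2' : w.2 ∈ ball x (ϑ * Real.sqrt s / 6) := by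
      rw [mem_ball]
      have h : ϱ ≤ ϑ * Real.sqrt s / 6 := by
        rw [hϱdef]
        have h' := mul_le_mul_of_nonneg_right hϑ2 hsqrt.le
        linarith only [h']
      exact lt_of_lt_of_le hw2 h
    have h := HB w.1 hw1 w.2 hw2'
    have e : Cb * s ^ (-(1 / 2 : ℝ)) = Cb / 3 / ϱ := by
      rw [hϱdef, Real.rpow_neg hs0.le, ← Real.sqrt_eq_rpow]
      field_simp [hsqrt.ne']
    rw [← e]
    exact h
  have hreg := H2 T τ u p hfr hτ hrate (t, x) ϱ hϱ0 hϱt htT hbd t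
    (show t ∈ Icc (t - (κ * ϱ / 2) ^ 2) t from ⟨by nlinarith [sq_nonneg (κ * ϱ / 2)], le_rfl⟩) x
    (mem_ball_self (by positivity : (0 : ℝ) < κ * ϱ / 2)) j hj
  -- ## read-off: `c_K (κ√s/3)^{-(j+1)} ≤ Cg s^{-(j+1)/2}`
  have hj3 : (j : ℝ) + 1 ≤ 3 := by
    have h : (j : ℝ) ≤ 2 := by exact_mod_cast hj
    linarith only [h]
  have hκ3 : 0 < κ / 3 := by positivity
  have hκ31 : κ / 3 ≤ 1 := by linarith only [hκ1]
  have hcK0 : 0 ≤ cK := le_trans zero_le_one hcK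
  have e1 : (κ * ϱ) ^ (-((j : ℝ) + 1)) = (κ / 3) ^ (-((j : ℝ) + 1)) * s ^ (-(((j : ℝ) + 1) / 2)) := by
    have hkr : κ * ϱ = (κ / 3) * Real.sqrt s := by rw [hϱdef]; ring
    rw [hkr, Real.mul_rpow hκ3.le (Real.sqrt_nonneg _), Real.sqrt_eq_rpow, ← Real.rpow_mul hs0.le,
      show (1 / 2 : ℝ) * -((j : ℝ) + 1) = -(((j : ℝ) + 1) / 2) by ring]
  have e2 : (κ / 3) ^ (-((j : ℝ) + 1)) ≤ (3 / κ) ^ 3 := by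
    calc (κ / 3) ^ (-((j : ℝ) + 1)) ≤ (κ / 3) ^ (-(3 : ℝ)) :=
          Real.rpow_le_rpow_of_exponent_ge hκ3 hκ31 (by linarith only [hj3])
      _ = (3 / κ) ^ 3 := by
          rw [Real.rpow_neg hκ3.le, ← Real.inv_rpow hκ3.le, inv_div]
          exact_mod_cast Real.rpow_natCast (3 / κ) 3
  have hspos : 0 < s ^ (-(((j : ℝ) + 1) / 2)) := Real.rpow_pos_of_pos hs0 _
  calc ‖iteratedFDeriv ℝ j (u t) x‖ ≤ cK * (κ * ϱ) ^ (-((j : ℝ) + 1)) := hreg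
    _ = cK * (κ / 3) ^ (-((j : ℝ) + 1)) * s ^ (-(((j : ℝ) + 1) / 2)) := by rw [e1, mul_assoc]
    _ ≤ cK * (3 / κ) ^ 3 * s ^ (-(((j : ℝ) + 1) / 2)) :=
        mul_le_mul_of_nonneg_right (mul_le_mul_of_nonneg_left e2 hcK0) hspos.le
    _ ≤ Cg * s ^ (-(((j : ℝ) + 1) / 2)) := mul_le_mul_of_nonneg_right (le_max_right _ _) hspos.le

end LightSlice



/-- **B1|P PROVED (v1.16)**: the window bound from P (`LocalEnergySlice`) and `BarkerPrange2020_thm1_slab_bounds` (i), read at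
interior points of the open box `(t₁ − s, t₁) × B(x, ϑ√s/6)` (a.e. → everywhere by joint continuity; no corner point).  Constants:
`γ := γ_BP`, `ϑ := √(8/S_BP(Mt(M)))` (so that `r := ϑ√s/2` has `S r² = 2s`), `Cb := C_BP(Mt, S/2)`. -/
theorem sliceWindowBound_of_slice_holds : LocalEnergySlice → SliceWindowBound := by
  intro hP M hM
  -- ## constants depending on `M` only
  obtain ⟨Mt, hMt, HP⟩ := hP M
  obtain ⟨γ, hγ, HBP⟩ := BarkerPrange2020_thm1_slab_bounds
  obtain ⟨S, hS, hS4, HS⟩ := HBP Mt hMt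
  obtain ⟨Cb, C₁, hCb, -, HB⟩ := HS (S / 2) ⟨by linarith, by linarith⟩
  have hS1 : S ≤ 1 := hS4.trans (by norm_num)
  obtain ⟨ϑ, hϑdef⟩ : ∃ ϑ : ℝ, Real.sqrt (8 / S) = ϑ := ⟨_, rfl⟩
  have hϑ0 : 0 < ϑ := by rw [← hϑdef]; exact Real.sqrt_pos.2 (by positivity)
  have hϑsq : ϑ ^ 2 = 8 / S := by rw [← hϑdef]; exact Real.sq_sqrt (by positivity)
  have hϑ2 : 2 ≤ ϑ := by
    have h2 : (2 : ℝ) = Real.sqrt 4 := by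
      rw [show (4 : ℝ) = 2 ^ 2 by norm_num, Real.sqrt_sq (by norm_num)]
    rw [h2, ← hϑdef]
    refine Real.sqrt_le_sqrt ?_
    rw [le_div_iff₀ hS]
    linarith
  have hϑh : (ϑ / 2) ^ 2 = 2 / S := by rw [div_pow, hϑsq]; ring
  refine ⟨γ, ϑ, Cb, hγ, hϑ2, hCb, ?_⟩
  intro T τ u p hfr hτ hrate t₁ s x hs0 h2s hsϑT ht₁T hL3 t ht y hy
  -- ## the scales: `r := ϑ√s/2`, `S r² = 2 s`, initial time `t₁ − 2s`
  have hsq : 0 < Real.sqrt s := Real.sqrt_pos.2 hs0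
  have hsq2 : Real.sqrt s ^ 2 = s := Real.sq_sqrt hs0.le
  obtain ⟨r, hrdef⟩ : ∃ r : ℝ, ϑ * Real.sqrt s / 2 = r := ⟨_, rfl⟩
  have hr0 : 0 < r := by rw [← hrdef]; positivity
  have hr2 : r ^ 2 = (ϑ / 2) ^ 2 * s := by
    rw [← hrdef, show ϑ * Real.sqrt s / 2 = ϑ / 2 * Real.sqrt s by ring, mul_pow, hsq2]
  have hSr : S * r ^ 2 = 2 * s := by rw [hr2, hϑh]; field_simp
  have hr2T : r ^ 2 ≤ T := by rw [hr2]; exact hsϑT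
  have ht0 : 0 ≤ t₁ - 2 * s := by linarith
  have hwin : t₁ - 2 * s + S * r ^ 2 ≤ T := by rw [hSr]; linarith
  have h2r : ϑ * Real.sqrt s = 2 * r := by rw [← hrdef]; ring
  have hrs : Real.sqrt s ≤ r := by
    have h := mul_le_mul_of_nonneg_right hϑ2 hsq.le
    rw [← hrdef]; linarith
  -- ## P: the rescaled slice is a local energy solution with `E²` datum and uloc bound `Mt`
  obtain ⟨π, hles, hE2, huloc⟩ := HP T τ u p hfr hτ hrate x (t₁ - 2 * s) r S hr0 hS hS1 ht0 hr2T hwin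
  -- ## the light hypothesis as an `L³` bound of the datum
  rw [h2r] at hL3
  have hcube' : ∫⁻ z in ball x (2 * r), ‖u (t₁ - 2 * s) z‖ₑ ^ 3 ≤ ENNReal.ofReal (γ ^ 3) := by
    have e : ∫⁻ z in ball x (2 * r), ‖u (t₁ - 2 * s) z‖ₑ ^ (3 : ℝ) = ∫⁻ z in ball x (2 * r), ‖u (t₁ - 2 * s) z‖ₑ ^ 3 :=
      lintegral_congr fun z => by rw [show (3 : ℝ) = ((3 : ℕ) : ℝ) by norm_num, ENNReal.rpow_natCast]
    rw [← e]; exact hL3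
  have hL3u : eLpNorm (u (t₁ - 2 * s)) 3 (volume.restrict (ball x (2 * r))) ≤ ENNReal.ofReal γ :=
    q4_eLpNorm_three_le_of_lintegral_cube_le hγ.le hcube'
  have hv0 : sliceField u x (t₁ - 2 * s) r 0 = fun z => r • u (t₁ - 2 * s) (x + r • z) := by
    funext z; rw [sliceField_apply, mul_zero, add_zero]
  have hsmul : ∀ (q' : ℝ≥0∞) (μ : Measure (EuclideanSpace ℝ (Fin 3))),
      eLpNorm (fun z => r • u (t₁ - 2 * s) (x + r • z)) q' μ =
        ‖r‖ₑ * eLpNorm (fun z => u (t₁ - 2 * s) (x + r • z)) q' μ :=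
    fun q' μ => by
      rw [show (fun z => r • u (t₁ - 2 * s) (x + r • z)) = r • fun z => u (t₁ - 2 * s) (x + r • z) from rfl,
        eLpNorm_const_smul]
  have hlr : ‖r‖ₑ = ENNReal.ofReal r := Real.enorm_eq_ofReal hr0.le
  have hL3' : eLpNorm (sliceField u x (t₁ - 2 * s) r 0) 3 (volume.restrict (ball (0 : EuclideanSpace ℝ (Fin 3)) 2)) ≤
      ENNReal.ofReal γ := by
    rw [hv0]
    calc eLpNorm (fun z => r • u (t₁ - 2 * s) (x + r • z)) 3 (volume.restrict (ball (0 : EuclideanSpace ℝ (Fin 3)) 2))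
        = ‖r‖ₑ * (ENNReal.ofReal ((r ^ 3)⁻¹) ^ (1 / (3 : ℝ≥0∞)).toReal *
            eLpNorm (u (t₁ - 2 * s)) 3
              (volume.restrict (ball (x + r • (0 : EuclideanSpace ℝ (Fin 3))) (r * 2)))) := by
          rw [hsmul, eLpNorm_comp_add_smul_ball (u (t₁ - 2 * s)) x 0 hr0 2 (by norm_num)]
      _ ≤ ‖r‖ₑ * (ENNReal.ofReal r⁻¹ * ENNReal.ofReal γ) := by
          rw [ofReal_inv_cube_rpow_third hr0, smul_zero, add_zero, mul_comm r 2]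
          gcongr
      _ = ENNReal.ofReal γ := by
          rw [hlr, ← ENNReal.ofReal_mul (by positivity), ← ENNReal.ofReal_mul (by positivity)]
          congr 1
          field_simp
  -- ## Barker–Prange (i): `‖v‖ ≤ Cb` a.e. on `(S/2,S) × B(0,1/3)`, hence everywhere there (joint continuity)
  obtain ⟨hae, -, -⟩ := HB _ _ π hles hE2 huloc hL3'
  have hcontv := sliceField_continuousOn hfr.1 x hr0 hS ht0 hwin
  set U : Set (ℝ × EuclideanSpace ℝ (Fin 3)) := Ioo (S / 2) S ×ˢ ball (0 : EuclideanSpace ℝ (Fin 3)) (1 / 3) with hU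
  have hUsub : U ⊆ Icc 0 S ×ˢ (univ : Set (EuclideanSpace ℝ (Fin 3))) :=
    prod_mono (fun s' hs' => ⟨by linarith [hs'.1], hs'.2.le⟩) (subset_univ _)
  have hae' : ∀ᵐ z ∂(volume.restrict U), ‖Function.uncurry (sliceField u x (t₁ - 2 * s) r) z‖ ≤ Cb :=
    hae.mono fun w hw => hw
  have hall := norm_le_of_ae_le_of_continuousOn (isOpen_Ioo.prod isOpen_ball) (hcontv.mono hUsub) hae'
  -- ## unscale at the point `(t, y)`: `σ := (t − (t₁ − 2s))/r² ∈ (S/2, S)`, `y' := r⁻¹(y − x) ∈ B(0, 1/3)`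
  obtain ⟨σ, hσ⟩ : ∃ σ : ℝ, (t - (t₁ - 2 * s)) / r ^ 2 = σ := ⟨_, rfl⟩
  have hr20 : 0 < r ^ 2 := by positivity
  have hσr : r ^ 2 * σ = t - (t₁ - 2 * s) := by rw [← hσ]; field_simp
  have hσ1 : S / 2 < σ := by
    rw [← hσ, lt_div_iff₀ hr20]
    linarith [ht.1, hSr]
  have hσ2 : σ < S := by
    rw [← hσ, div_lt_iff₀ hr20]
    linarith [ht.2, hSr]
  have hyx : ‖y - x‖ < r / 3 := by
    have h : dist y x < ϑ * Real.sqrt s / 6 := mem_ball.1 hy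
    rw [dist_eq_norm] at h
    linarith [h, h2r]
  have hy' : r⁻¹ • (y - x) ∈ ball (0 : EuclideanSpace ℝ (Fin 3)) (1 / 3) := by
    rw [mem_ball_zero_iff, norm_smul, norm_inv, Real.norm_of_nonneg hr0.le]
    calc r⁻¹ * ‖y - x‖ < r⁻¹ * (r / 3) := mul_lt_mul_of_pos_left hyx (inv_pos.2 hr0)
      _ = 1 / 3 := by field_simp
  have hmem : (σ, r⁻¹ • (y - x)) ∈ U := mk_mem_prod ⟨hσ1, hσ2⟩ hy'
  have hv := hall (σ, r⁻¹ • (y - x)) hmem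
  have e1 : t₁ - 2 * s + r ^ 2 * σ = t := by rw [hσr]; ring
  have e2 : x + r • (r⁻¹ • (y - x)) = y := by
    rw [smul_smul, mul_inv_cancel₀ hr0.ne', one_smul]; abel
  rw [Function.uncurry_apply_pair, sliceField_apply, e1, e2, norm_smul, Real.norm_of_nonneg hr0.le] at hv
  -- ## `‖u t y‖ ≤ Cb / r ≤ Cb / √s`
  have h1 : ‖u t y‖ ≤ Cb / r := by
    rw [le_div_iff₀ hr0, mul_comm]; exact hv
  calc ‖u t y‖ ≤ Cb / r := h1
    _ ≤ Cb / Real.sqrt s := div_le_div_of_nonneg_left hCb.le hsq hrs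
    _ = Cb * s ^ (-(1 / 2 : ℝ)) := by rw [Real.rpow_neg hs0.le, ← Real.sqrt_eq_rpow, div_eq_mul_inv]

/-! ## Registered stubs (v1.16: NO sorry left — B1|P `stub_sliceWindowBound_of_slice` PROVED (`sliceWindowBound_of_slice_holds`), B2 `stub_boundedCylinderRegular` CLOSED BY NAME (tree `boundedRegularity`), β|P `stub_lightSliceRegular_of_slice` DERIVED (§12 kernel); v1.13: β|P `stub_lightSliceRegular_of_slice` — Q3 (§9a), P (§10), Q4|P (§11) and hence S1 are PROVED here; S3 (✓p720976) and S4′ (✓p723153) are PROVED in the tree and imported; β is DERIVED from β|P; the S2 stubs of v1/v1.1 are RETIRED) -/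

/-- Q3 — quiet slice ⇒ small local cube mass: **PROVED** in §9a (`quietSliceSmallCube_holds`, v1.3); kept under its
registered name as a sorry-free alias. -/
theorem stub_quietSliceSmallCube : QuietSliceSmallCube :=
  quietSliceSmallCube_holds

/-- **P♭♭ `SlicePressure` PROVED** — the pressure swap is done by the tree's very-weak ⇒ distributional machinery
(`isDistributionalNSSolutionOn_slab_of_veryWeak_four`), exactly as in `isDistributionalNSSolutionOn_slab_of_oseenForward`
with the Oseen-mild hypothesis replaced by classicality: `v` is a KNSS bounded weak solution on `(0,S)`
(`IsClassicalNSSolutionOn.isBoundedWeakNSSolutionOn`: the classical pressure `q` drops out against divergence-free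
tests), its slices are weakly divergence free, and the slab Riesz pressure `π ∈ L²` of `v ∈ L⁴` (`exists_rieszPressure_two_slab`)
solves the weak Poisson equation slice-wise. -/
theorem slicePressure_holds : SlicePressure := by
  intro M T τ u p hfr hτ hrate x tstar r S hr hS hS1 ht0 hrT hwin
  have hu4 := sliceField_memLp_four hfr hτ hrate x hr hS ht0 hwin
  obtain ⟨π, hπ2, hsl⟩ := exists_rieszPressure_two_slab hu4
  refine ⟨π, hπ2, ?_⟩
  have hcl := sliceField_classical hfr.1 x hr hS ht0 hwin
  have hclo : IsClassicalNSSolutionOn (Ioo 0 S) 1 0 (sliceField u x tstar r) (r ^ 2 • stPull (r ^ 2) r tstar x p) :=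
    hcl.mono Ioo_subset_Icc_self (uniqueDiffOn_Ioo 0 S)
  have hbd : IsBoundedOn (Ioo 0 S) (sliceField u x tstar r) :=
    ⟨M * r * τ ^ (-(1 / 2 : ℝ)), fun σ hσ y => sliceField_bound hrate hτ x hr ht0 hwin σ (Ioo_subset_Icc_self hσ) y⟩
  have hBW := hclo.isBoundedWeakNSSolutionOn hbd
  have hu1 : LocallyIntegrableOn (Function.uncurry (sliceField u x tstar r))
      ((slab (EuclideanSpace ℝ (Fin 3)) (Ioo 0 S) isOpen_Ioo : TopologicalSpace.Opens (ℝ × (EuclideanSpace ℝ (Fin 3)))) :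
        Set (ℝ × (EuclideanSpace ℝ (Fin 3)))) volume :=
    locallyIntegrableOn_slab_of_memLp hu4 (by norm_num)
  have hu2 : LocallyIntegrableOn (fun z => ‖Function.uncurry (sliceField u x tstar r) z‖ ^ 2)
      ((slab (EuclideanSpace ℝ (Fin 3)) (Ioo 0 S) isOpen_Ioo : TopologicalSpace.Opens (ℝ × (EuclideanSpace ℝ (Fin 3)))) :
        Set (ℝ × (EuclideanSpace ℝ (Fin 3)))) volume :=
    locallyIntegrableOn_slab_of_memLp (memLp_norm_sq_of_memLp_four hu4) (by norm_num)
  have hp1 : LocallyIntegrableOn (Function.uncurry π)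
      ((slab (EuclideanSpace ℝ (Fin 3)) (Ioo 0 S) isOpen_Ioo : TopologicalSpace.Opens (ℝ × (EuclideanSpace ℝ (Fin 3)))) :
        Set (ℝ × (EuclideanSpace ℝ (Fin 3)))) volume :=
    locallyIntegrableOn_slab_of_memLp hπ2 (by norm_num)
  refine isDistributionalNSSolutionOn_slab_of_veryWeak_four hu4 hπ2 (fun θ hθ => ?_) (fun θ hθ => ?_)
    (fun ψ hψ hdivψ => ?_)
  · exact setIntegral_inner_gradient_eq_zero_of_forall_isWeaklyDivFree hu1
      (fun t ht => VectorCalculus.IsDivFree.isWeaklyDivFree_holds (hcl.divFree t ht)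
        (contDiff_infty.1 (hcl.contDiff_velocity ht) 1)) hθ
  · exact setIntegral_pressure_laplacian_eq_of_ae_slice hu1 hu2 hp1 (hsl.mono fun t ht => ht.2) hθ
  · exact setIntegral_veryWeak_eq_zero_of_iterated hu1 hu2 hψ (hBW.2.2.2 ψ hψ hdivψ)

/-- P♭♭ — `SlicePressure`: **PROVED (v1.11)** by `slicePressure_holds`; the registered name is kept as a sorry-free alias. -/
theorem stub_slicePressure : SlicePressure :=
  slicePressure_holds

/-- P♭ — the local-energy-solution clause (§10, `LocalEnergySliceLES`): DERIVED (v1.8) from P♭♭ by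
`localEnergySliceLES_of_slicePressure` (boundedness, joint continuity, `L⁴(slab)` PROVED in §10a + the tree's
`isSuitableWeakSolutionOn_slab_of_bounded_of_memLp_two` / `isLocalEnergySolutionOn_of_bounded_suitable`). -/
theorem stub_localEnergySliceLES : LocalEnergySliceLES :=
  localEnergySliceLES_of_slicePressure stub_slicePressure

/-- P — the shared plumbing lemma `LocalEnergySlice` (§10): DERIVED (v1.7) from P♭ by `localEnergySlice_of_les`. -/
theorem stub_localEnergySlice : LocalEnergySlice :=
  localEnergySlice_of_les stub_localEnergySliceLES

/-- Q4 given P — S1 from Q3 by `BarkerPrange2020_thm1_slab_bounds` (i) (PROVED) + I1 (PROVED): **PROVED (v1.12)** by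
`levelConcentration_of_slice_holds` (§11); the registered name is kept as a sorry-free alias. -/
theorem stub_levelConcentration_of_slice : LocalEnergySlice → QuietSliceSmallCube → LevelConcentration :=
  levelConcentration_of_slice_holds

/-- **B1|P** — the window bound from P + `BarkerPrange2020_thm1_slab_bounds` (i) (PROVED); size M−; registered v1.14 (LINE g15-1);
**PROVED (v1.16)** as `sliceWindowBound_of_slice_holds` (§12). -/
theorem stub_sliceWindowBound_of_slice : LocalEnergySlice → SliceWindowBound :=
  sliceWindowBound_of_slice_holds

/-- **B2** — bounded cylinders of a Type-I frame are quantitatively regular up to the vertex (CS2 + one pressure-decay step + CS3, all tree,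
PROVED); size M; registered v1.14 (LINE g15-1); **CLOSED BY NAME (v1.15)**: derived from the tree theorem `FlatChain.boundedRegularity`
(`Theorems/QuarterLogPincerFlatChainBoundedRegularity.lean`, typer g39, PROVED) by shrinking the bounded cylinder `Q_ϱ(z)` (`‖u‖ ≤ B/ϱ`) to the
radius `min 1 (κ/B)·ϱ`, where the product cap `(B/ϱ)·ϱ' ≤ κ(M)` of that theorem holds. -/
theorem stub_boundedCylinderRegular : BoundedCylinderRegular := by
  intro M B hM hB
  obtain ⟨θ, κ, cs, hθ, hθ1, hκ, hcs, H⟩ := boundedRegularity M hM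
  set l : ℝ := min 1 (κ / B) with hl
  have hl0 : 0 < l := lt_min one_pos (div_pos hκ hB)
  have hl1 : l ≤ 1 := min_le_left _ _
  have hlB : B * l ≤ κ := by
    have h : l ≤ κ / B := min_le_right _ _
    rw [le_div_iff₀ hB] at h
    linarith
  refine ⟨θ * l, cs, mul_pos hθ hl0, ?_, hcs, ?_⟩
  · calc θ * l ≤ 1 * 1 := mul_le_mul hθ1 hl1 hl0.le zero_le_one
      _ = 1 := one_mul 1
  intro T τ u p hfr hτ hrate z ϱ hϱ hϱz hzT hbd t ht x hx j hj
  -- shrink to the radius `ϱ' := l ϱ`, on which the product cap `(B/ϱ)·ϱ' = B l ≤ κ` holds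
  have hρ0 : 0 < l * ϱ := mul_pos hl0 hϱ
  have hρle : l * ϱ ≤ ϱ := by nlinarith
  have hsub : parabolicCylinder (l * ϱ) z ⊆ parabolicCylinder ϱ z := parabolicCylinder_mono hρ0.le hρle z
  have hK0 : 0 ≤ B / ϱ := (div_pos hB hϱ).le
  have hbd' : ∀ w ∈ parabolicCylinder (l * ϱ) z, ‖u w.1 w.2‖ ≤ B / ϱ := fun w hw => hbd w (hsub hw)
  have hKρ : B / ϱ * (l * ϱ) ≤ κ := by
    calc B / ϱ * (l * ϱ) = B * l * (ϱ / ϱ) := by ring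
      _ = B * l := by rw [div_self hϱ.ne', mul_one]
      _ ≤ κ := hlB
  have hρsq : (l * ϱ) ^ 2 ≤ z.1 := (pow_le_pow_left₀ hρ0.le hρle 2).trans hϱz
  have e : θ * (l * ϱ) = θ * l * ϱ := by ring
  have ht' : t ∈ Icc (z.1 - (θ * (l * ϱ) / 2) ^ 2) z.1 := by rw [e]; exact ht
  have hx' : x ∈ ball z.2 (θ * (l * ϱ) / 2) := by rw [e]; exact hx
  have key := H T τ u p hfr hτ hrate (B / ϱ) z (l * ϱ) hK0 hρ0 hρsq hzT hbd' hKρ t ht' x hx' j hj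
  rw [e] at key
  exact key

/-- β given P — light slice ⇒ regular block: **DERIVED (v1.14)** from B1|P and B2 by the §12 kernel
`lightSliceRegular_of_windowBound_of_cylinder` (no sorry of its own; registered name of v1.6 kept). -/
theorem stub_lightSliceRegular_of_slice : LocalEnergySlice → LightSliceRegular :=
  fun hP => lightSliceRegular_of_windowBound_of_cylinder (stub_sliceWindowBound_of_slice hP) stub_boundedCylinderRegular

/-- Q4 — S1 from Q3 (v1.3 registered name), now DERIVED from P and Q4|P (no sorry of its own since v1.6). -/
theorem stub_levelConcentration_of_quietSlice : QuietSliceSmallCube → LevelConcentration :=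
  stub_levelConcentration_of_slice stub_localEnergySlice

/-- **S1 `LevelConcentration` with the registered stubs plugged in (v1.2: no S2).** -/
theorem levelConcentration_of_stubs : LevelConcentration :=
  stub_levelConcentration_of_quietSlice stub_quietSliceSmallCube

/-! **S3 `stub_typeIEpoch : TypeIEpoch` is PROVED in the tree** (typer g39, ✓p720976 `Theorems/QuarterLogPincerFlatChainTypeIEpoch.lean`,
`fun M => epochBlock_of_typeI M`, same FQN) and IMPORTED since v1.10 — the local `sorry` is deleted; every use below is the tree theorem.
**S4′ `stub_regularBlockTransfer : RegularBlockTransfer` is PROVED in the tree** (typer g39, ✓p723153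
`Theorems/QuarterLogPincerFlatChainRegularBlockTransfer.lean`, `:= regularBlockTransfer_proof`, same FQN; Tao (5.7)ᵘ/(5.17)/(5.18) + scale-free
deposit, ✓p720868/✓p721763/✓p722474/✓p722248) and IMPORTED since v1.13 — the local `sorry` is deleted.  The ten KERNEL theorems
(`levelScale_pos_le` … `typeIQuantCubicExp_of_sliceCensus`) are likewise the tree's since v1.13 (typer ✓p722930
`Theorems/QuarterLogPincerFlatChainKernel.lean`, byte-identical port, same FQNs) — local copies deleted. -/

/-- β — light slice ⇒ regular block [BarkerPrange2020 Thm 1 (tree `BarkerPrange2020_thm1_slab_bounds`, PROVED);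
`NSBoundedHigherRegularityBounds_holds` (PROVED); I1 (PROVED)] — DERIVED from P and β|P since v1.6 (no sorry of its own). -/
theorem stub_lightSliceRegular : LightSliceRegular :=
  stub_lightSliceRegular_of_slice stub_localEnergySlice

/-- S4 (v1's `stub_goodLevelTransfer`) is no longer a stub: it is S4′ specialised. -/
theorem goodLevelTransfer_of_stub : GoodLevelTransfer :=
  goodLevelTransfer_of_regularBlockTransfer stub_regularBlockTransfer

/-! ## Kernel (sorry-free; v1.13: the ten kernel theorems are IMPORTED from `Theorems/QuarterLogPincerFlatChainKernel.lean`, ✓p722930 — only the `_of_stubs` / `_holds_of_stubs` compositions stay local): S2 → (S2 → S1) → S3 → S4 → G2♭ -/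

/-- **Composition to the rung (sorry-free modulo the census and the four stubs):**
`BeadCensus → S2 → (S2 → S1) → S3 → S4 → TypeIQuantCubicExp` (R0-rate, decl of record). -/
theorem typeIQuantCubicExp_of_beadCensus_of_stubs (hcensus : BeadCensus) (h₂ : LocalSmoothingL6)
    (h₁ : LocalSmoothingL6 → LevelConcentration) (h₃ : TypeIEpoch) (h₄ : GoodLevelTransfer) :
    TypeIQuantCubicExp :=
  typeIQuantCubicExp_of_beadCensus_of_bpChainRateFlat hcensus (bpChainRateFlat_of h₂ h₁ h₃ h₄)

/-- The line's concluding edge G2♭ with the registered stubs plugged in — **sorry-free since v1.13** (S1 §11, S3 ✓p720976, S4′ ✓p723153). -/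
theorem bpChainRateFlat_holds_of_stubs : BPChainRateFlat :=
  bpChainRateFlat_of_conc levelConcentration_of_stubs stub_typeIEpoch goodLevelTransfer_of_stub

/-- **LINE g14-1/g14-3 concluding edge with the registered stubs plugged in** (v1.2: no S2):
`BeadCensus → TypeIQuantCubicExp` — **sorry-free since v1.13**: the rung follows from the census node G1♯ ALONE. -/
theorem typeIQuantCubicExp_of_beadCensus_of_stubs' (hcensus : BeadCensus) : TypeIQuantCubicExp :=
  typeIQuantCubicExp_of_beadCensus_of_conc hcensus levelConcentration_of_stubs stub_typeIEpoch
    goodLevelTransfer_of_stub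

/-! ## §8 Kernel of LINE g14-2 (sorry-free): `SliceCensus → β → S2 → (S2 → S1) → S3 → S4′ → TypeIQuantCubicExp` -/

/-- **LINE g14-2/g14-3/g15-1 concluding edge with the registered stubs plugged in** (v1.16: SORRY-FREE — axioms [propext, Classical.choice, Quot.sound]; the hypothesis `SliceCensus` is the line's single open node, R0-equivalent; v1.2: no S2):
`SliceCensus → TypeIQuantCubicExp` (R0-rate, decl of record). -/
theorem typeIQuantCubicExp_of_sliceCensus_of_stubs (hcen : SliceCensus) : TypeIQuantCubicExp :=
  typeIQuantCubicExp_of_sliceCensus_conc hcen stub_lightSliceRegular levelConcentration_of_stubs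
    stub_typeIEpoch stub_regularBlockTransfer

end

end Summit.NavierStokesRegularity.NavierStokesRegularity.Cruxes.TypeIQuantSubcubicExp.FlatChain
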